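import Literature.NumberTheory.GaloisRepresentations.ConjugationDescent
import Literature.NumberTheory.GaloisRepresentations.ContinuousRepHomDual
import Mathlib.RepresentationTheory.Intertwining
import Literature.NumberTheory.GaloisRepresentations.GaloisCohomologyKummerProofs
import Literature.NumberTheory.GaloisRepresentations.HilbertNinetySubgroup
import Literature.NumberTheory.GaloisRepresentations.GaloisSubgroups
import Literature.NumberTheory.GaloisRepresentations.TateDualityCounting
import Literature.NumberTheory.GaloisRepresentations.CyclicIndexEulerChar
import Literature.NumberTheory.GaloisRepresentations.LocalFieldFiniteExtension
import Literature.NumberTheory.GaloisRepresentations.LocalField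
import Literature.NumberTheory.GaloisRepresentations.LocalDualityTwoZero
import Literature.NumberTheory.GaloisRepresentations.LocalEulerPoincareCharacteristic
import Literature.NumberTheory.GaloisRepresentations.CohomologicalDimension
import Literature.NumberTheory.GaloisRepresentations.AbsGaloisGroup
import Mathlib.FieldTheory.Galois.Infinite
import Literature.NumberTheory.GaloisRepresentations.KummerTwo
import Literature.NumberTheory.GaloisRepresentations.PPrimaryDevissage
import Literature.NumberTheory.GaloisRepresentations.GaloisCohomology
import Literature.NumberTheory.GaloisRepresentations.TameInertia
import Mathlib.FieldTheory.Finite.Basic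
import Literature.NumberTheory.GaloisRepresentations.InertiaCohomologyFinite
import Mathlib.Data.ZMod.QuotientGroup
import Mathlib.Data.Nat.Factorization.Basic
import Literature.NumberTheory.GaloisRepresentations.LocalFieldCdTwo
import Mathlib.GroupTheory.Perm.Cycle.Type
import Mathlib.LinearAlgebra.Quotient.Card
import Literature.NumberTheory.IwasawaTheory.Greenberg2006.LocalEulerPoincareCorank
import Literature.NumberTheory.GaloisRepresentations.LocalEPCDevissageDescentProofs
import Literature.NumberTheory.GaloisRepresentations.LocalUnitsModPCountsProofs
import HarnessLib

/-!
# Tate's local Euler–Poincaré characteristic formula `#H⁰·#H²·#(𝒪_F/#M) = #H¹` PROVED (Milne ADT I Thm. 2.8), and Greenberg 2006 Prop. 4.2 (the local `Λ`-corank formula) — file 3 of 3 (re-homed proofs)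

Family `bsd` material RE-HOMED into `Literature/` by the Hodge foundations lane (`lit-hodgefound`, seat p20, generation 35),
file 3 of 3 of the LOCAL EULER–POINCARÉ cone: verbatim ports, in dependency order and each with its original module docstring (Parts 1–16),
of the cell `b2b-bsdres` (team n1011, row T-EPC, seat p04) modules TrivialActionHOneDescent, EquivariantHomDualCount, KummerSubgroupCocycles, KummerSubgroupEquiv, RootsOfUnityTorsionUnits, EPCRepresentationGlue, EPCLocalFieldGlue, TameLayerEulerCharacteristic, EPCGaloisBaseChange, EPCBottomLayer, EPCTamePrelim, EPCTameChain, EPCPrimeTorsion, EPCReductionToPrimeTorsion, LocalEulerPoincareCharacteristicHolds, SignedBaseChangeAnticyclotomicEisensteinDivisibilityLocalEulerPoincareCorank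
(under `Summits/BirchSwinnertonDyer/Rank1Residual/GaloisImage/`; the last part is `Summits/BirchSwinnertonDyer/BirchSwinnertonDyer/Theorems/SignedBaseChangeAnticyclotomicEisensteinDivisibilityLocalEulerPoincareCorank.lean` (width seat `bsd-line-sbc-p1-w2`)), namespace
`Summit.BirchSwinnertonDyer.Rank1Residual.GaloisImage` (with its sub-namespaces `QuotientPow`, `EPCMul`, `EPCDevissage`, `EPCTransport`, `EPCDescent`,
`ModPRepCount`, `OneUnits`, `LocalIntegers`, `TrivialAction`, `EquivariantHom`, `KummerSubgroup`, `EPCGlue`, `EPCLocalField`, `TameLayer`, `EPCBaseChange`,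
`EPCBottom`, `EPCTame`, `EPCChain`, `EPCPrime`) re-rooted as `Literature.NumberTheory.GaloisRepresentations.LocalEPC` and `…Theorems.SignedBaseChangeAcDivLocalEulerPoincareCorank` as `Literature.NumberTheory.IwasawaTheory.Greenberg2006.LocalEulerPoincareCorank`;
theorems only (no definition, no named fact), imports Literature/Mathlib only; all `[folklore]` helpers privatised — Part 0 (files 2, 3) re-proves
privately, verbatim with their scope context, the `[folklore]` helpers of the earlier files that the file's parts use; `open` commands of shadowed
Mathlib roots made `_root_`-explicit.  CONTENT: `H¹`-descent for trivial actions (Part 1), counting equivariant homs and duals (Part 2), equivariant Kummer theory (Parts 3–5), gluing of representations / local fields (Parts 6–7), the Euler characteristic of the TAME layer (Part 8), Galois base change, the bottom layer, the tame chain (Parts 9–12), reduction to prime torsion and the prime-torsion case (Parts 13–14), the assembly = Tate's formula (Part 15) and Greenberg's corank corollary (Part 16).  WHY: the cone is the only proof in the tree of **Tate's local Euler–Poincaré characteristic formula** — the Literature named fact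
`NumberTheory.GaloisRepresentations.localEulerPoincareCharacteristic F` (Milne *ADT* I Thm. 2.8; Serre *CG* II §5.7 Thm. 5; Tate 1962: for a
non-archimedean local field `F` of characteristic `0` and every finite discrete `Γ_F`-module `M`, `H¹(F, M)`, `H²(F, M)` are finite and
`#H⁰·#H²·#(𝒪_F/#M) = #H¹`) — and, through the tree's `Greenberg2006.prop42_of_localEulerPoincareCharacteristic`, of
`NumberTheory.IwasawaTheory.Greenberg2006.prop42_localEulerPoincareCorank` (Greenberg 2006 Prop. 4.2, the local Euler–Poincaré `Λ`-corank
formula).  Both discharges already EXIST under their fully-qualified names of record — but as declarations of Summits modules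
(`theorem _root_.Literature.….localEulerPoincareCharacteristic_holds` in `GaloisImage/LocalEulerPoincareCharacteristicHolds.lean`,
`theorem _root_.Literature.….prop42_localEulerPoincareCorank_holds` in the `SignedBaseChange…` file), which `Literature/` cannot import
(e.g. `AnabelianGeometry/AbsoluteAnabelian/MLFGaloisTFGProofs.lean` still carries Tate's formula as a hypothesis `hEP` for exactly this
reason); the re-homed copies therefore live INSIDE the ported namespaces:
`Literature.NumberTheory.GaloisRepresentations.LocalEPC.localEulerPoincareCharacteristic_holds` (file 3, Part 15) and
`Literature.NumberTheory.IwasawaTheory.Greenberg2006.LocalEulerPoincareCorank.prop42_localEulerPoincareCorank_holds` (file 3, Part 16).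
The Summits originals stay in place (transitional duplication; cited here).  Honest framing of the originals stands: a discharge of published
inputs; nothing is booked; BSD is not proved by any of this.
-/

noncomputable section

/-! ## Part 0 — 14 `[folklore]` helper(s) of files 1–2 (private there), re-proved privately (verbatim, with their scope context) -/

section Part0

-- from `EPCCohomologyTransport`
section
open _root_.CategoryTheory _root_.Function
open Literature.NumberTheory.GaloisRepresentations
universe u
namespace Literature.NumberTheory.GaloisRepresentations.LocalEPC
namespace EPCTransport
variable {G H : Type u} [Group G] [TopologicalSpace G] [IsTopologicalGroup G]
  [Group H] [TopologicalSpace H] [IsTopologicalGroup H]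
variable {M : Type u} [AddCommGroup M] [TopologicalSpace M] [DiscreteTopology M]
omit [IsTopologicalGroup G] [IsTopologicalGroup H] in
/-- Invariants do not change: `M^G = M^H` (as subgroups of `M`) when `τ g = σ (e g)` for a
bijective `e`. [folklore] -/
private theorem invariants_eq (e : G ≃ₜ* H) (τ : ContinuousRep G ℤ M) (σ : ContinuousRep H ℤ M)
    (hc : ∀ g m, τ g m = σ (e g) m) :
    τ.toTopRep.ρ.invariants = σ.toTopRep.ρ.invariants := by
  ext m
  constructor
  · intro h x
    have := h (e.symm x)
    rw [show τ.toTopRep.ρ (e.symm x) m = τ (e.symm x) m from rfl, hc,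
      ContinuousMulEquiv.apply_symm_apply] at this
    exact this
  · intro h g
    have := h (e g)
    rw [show σ.toTopRep.ρ (e g) m = σ (e g) m from rfl, ← hc] at this
    exact this
end EPCTransport
end Literature.NumberTheory.GaloisRepresentations.LocalEPC
end

-- from `EPCCohomologyTransport`
section
open _root_.CategoryTheory _root_.Function
open Literature.NumberTheory.GaloisRepresentations
universe u
namespace Literature.NumberTheory.GaloisRepresentations.LocalEPC
namespace EPCTransport
variable {G H : Type u} [Group G] [TopologicalSpace G] [IsTopologicalGroup G]
  [Group H] [TopologicalSpace H] [IsTopologicalGroup H]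
variable {M : Type u} [AddCommGroup M] [TopologicalSpace M] [DiscreteTopology M]
omit [IsTopologicalGroup G] [IsTopologicalGroup H] in
/-- `#M^G = #M^H` along `e : G ≃ₜ* H` with `τ g = σ (e g)`. [folklore] -/
private theorem natCard_invariants_congr (e : G ≃ₜ* H) (τ : ContinuousRep G ℤ M) (σ : ContinuousRep H ℤ M)
    (hc : ∀ g m, τ g m = σ (e g) m) :
    Nat.card τ.toTopRep.ρ.invariants = Nat.card σ.toTopRep.ρ.invariants := by
  rw [invariants_eq e τ σ hc]
end EPCTransport
end Literature.NumberTheory.GaloisRepresentations.LocalEPC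
end

-- from `EPCCyclicDescent`
section
open _root_.CategoryTheory _root_.Function
open Literature.NumberTheory.GaloisRepresentations
universe u
namespace Literature.NumberTheory.GaloisRepresentations.LocalEPC
namespace EPCDescent
variable {Γ : Type u} [Group Γ] [TopologicalSpace Γ] [IsTopologicalGroup Γ] [CompactSpace Γ]
  [T2Space Γ] [TotallyDisconnectedSpace Γ]
variable {M : Type u} [AddCommGroup M] [TopologicalSpace M] [DiscreteTopology M] [Finite M]
variable (ρ : ContinuousRep Γ ℤ M) {p : ℕ}
omit [IsTopologicalGroup Γ] [CompactSpace Γ] [T2Space Γ] [TotallyDisconnectedSpace Γ] [DiscreteTopology M]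
  [Finite M] in
/-- The restriction to `⊤ ≤ Γ` is `ρ` along `⊤ ≃ₜ* Γ`. [folklore] -/
private theorem exists_equiv_restrict_top :
    ∃ e : (⊤ : Subgroup Γ) ≃ₜ* Γ, ∀ x m, (ρ.restrict (subgroupIncl ⊤)) x m = ρ (e x) m := by
  refine ⟨{ Subgroup.topEquiv with
    continuous_toFun := continuous_subtype_val
    continuous_invFun := Continuous.subtype_mk continuous_id _ }, fun x m => rfl⟩
end EPCDescent
end Literature.NumberTheory.GaloisRepresentations.LocalEPC
end

-- from `EPCCyclicDescent`
section
open _root_.CategoryTheory _root_.Function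
open Literature.NumberTheory.GaloisRepresentations
universe u
namespace Literature.NumberTheory.GaloisRepresentations.LocalEPC
namespace EPCDescent
variable {Γ : Type u} [Group Γ] [TopologicalSpace Γ] [IsTopologicalGroup Γ] [CompactSpace Γ]
  [T2Space Γ] [TotallyDisconnectedSpace Γ]
variable {M : Type u} [AddCommGroup M] [TopologicalSpace M] [DiscreteTopology M] [Finite M]
variable (ρ : ContinuousRep Γ ℤ M) {p : ℕ}
omit [CompactSpace Γ] [T2Space Γ] [TotallyDisconnectedSpace Γ] [Finite M] in
/-- `#H^q(⊤, M) = #H^q(Γ, M)`. [folklore] -/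
private theorem natCard_restrict_top (q : ℕ) :
    Nat.card (continuousCohomology q (ρ.restrict (subgroupIncl ⊤)).toTopRep) =
      Nat.card (continuousCohomology q ρ.toTopRep) := by
  obtain ⟨e, he⟩ := exists_equiv_restrict_top ρ
  exact EPCTransport.natCard_continuousCohomology_congr e _ _ he q
end EPCDescent
end Literature.NumberTheory.GaloisRepresentations.LocalEPC
end

-- from `EPCCyclicDescent`
section
open _root_.CategoryTheory _root_.Function
open Literature.NumberTheory.GaloisRepresentations
universe u
namespace Literature.NumberTheory.GaloisRepresentations.LocalEPC
namespace EPCDescent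
variable {Γ : Type u} [Group Γ] [TopologicalSpace Γ] [IsTopologicalGroup Γ] [CompactSpace Γ]
  [T2Space Γ] [TotallyDisconnectedSpace Γ]
variable {M : Type u} [AddCommGroup M] [TopologicalSpace M] [DiscreteTopology M] [Finite M]
variable (ρ : ContinuousRep Γ ℤ M) {p : ℕ}
omit [CompactSpace Γ] [T2Space Γ] [TotallyDisconnectedSpace Γ] [Finite M] in
/-- `H^q(⊤, M)` is finite iff `H^q(Γ, M)` is. [folklore] -/
private theorem finite_restrict_top_iff (q : ℕ) :
    Finite (continuousCohomology q (ρ.restrict (subgroupIncl ⊤)).toTopRep) ↔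
      Finite (continuousCohomology q ρ.toTopRep) := by
  obtain ⟨e, he⟩ := exists_equiv_restrict_top ρ
  exact EPCTransport.finite_continuousCohomology_iff e _ _ he q
end EPCDescent
end Literature.NumberTheory.GaloisRepresentations.LocalEPC
end

-- from `EPCCyclicDescent`
section
open _root_.CategoryTheory _root_.Function
open Literature.NumberTheory.GaloisRepresentations
universe u
namespace Literature.NumberTheory.GaloisRepresentations.LocalEPC
namespace EPCDescent
variable {Γ : Type u} [Group Γ] [TopologicalSpace Γ] [IsTopologicalGroup Γ] [CompactSpace Γ]
  [T2Space Γ] [TotallyDisconnectedSpace Γ]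
variable {M : Type u} [AddCommGroup M] [TopologicalSpace M] [DiscreteTopology M] [Finite M]
variable (ρ : ContinuousRep Γ ℤ M) {p : ℕ}
omit [IsTopologicalGroup Γ] [CompactSpace Γ] [T2Space Γ] [TotallyDisconnectedSpace Γ] [Finite M] in
/-- `#M^⊤ = #M^Γ`. [folklore] -/
private theorem natCard_invariants_restrict_top :
    Nat.card (ρ.restrict (subgroupIncl ⊤)).toTopRep.ρ.invariants = Nat.card ρ.toTopRep.ρ.invariants := by
  obtain ⟨e, he⟩ := exists_equiv_restrict_top ρ
  exact EPCTransport.natCard_invariants_congr e _ _ he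
end EPCDescent
end Literature.NumberTheory.GaloisRepresentations.LocalEPC
end

-- from `ModPRepresentationInvariantsCount`
section
open _root_.Function
namespace Literature.NumberTheory.GaloisRepresentations.LocalEPC
namespace ModPRepCount
open _root_.Representation
variable {G : Type*} [Group G]
variable {Z : Type*} [AddCommGroup Z] {A : Type*} [AddCommGroup A] {B : Type*} [AddCommGroup B]
  {C : Type*} [AddCommGroup C] (σ : Representation ℤ G Z) (α : Representation ℤ G A) (β : Representation ℤ G B)
  (γ : Representation ℤ G C)
/-- **Transport on the right**: `#Hom_G(Z, B) = #Hom_G(Z, C)` for equivalent `B ≃ C`. [folklore] -/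
private theorem natCard_intertwiningMap_congr_right (e : β.Equiv γ) :
    Nat.card (IntertwiningMap σ β) = Nat.card (IntertwiningMap σ γ) := by
  refine Nat.card_congr
    { toFun := fun h => e.toIntertwiningMap.comp h
      invFun := fun h => e.symm.toIntertwiningMap.comp h
      left_inv := fun h => DFunLike.ext _ _ fun z => ?_
      right_inv := fun h => DFunLike.ext _ _ fun z => ?_ }
  · rw [IntertwiningMap.comp_apply, IntertwiningMap.comp_apply]
    exact e.symm_apply_apply (h z)
  · rw [IntertwiningMap.comp_apply, IntertwiningMap.comp_apply]
    exact e.apply_symm_apply (h z)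
end ModPRepCount
end Literature.NumberTheory.GaloisRepresentations.LocalEPC
end

-- from `ModPLatticeHerbrandCount`
section
open _root_.Function
namespace Literature.NumberTheory.GaloisRepresentations.LocalEPC
namespace ModPRepCount
open _root_.Representation
variable {G : Type*} [Group G]
variable {V : Type*} [AddCommGroup V] (ρ : Representation ℤ G V) (p : ℕ)
/-- `V[p] = ker (p : V → V)` is `G`-stable. [folklore] -/
private theorem ker_lsmul_le_comap (g : G) :
    LinearMap.ker (LinearMap.lsmul ℤ V p) ≤ (LinearMap.ker (LinearMap.lsmul ℤ V p)).comap (ρ g) := by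
  intro v hv
  simp only [Submodule.mem_comap, LinearMap.mem_ker, LinearMap.lsmul_apply] at hv ⊢
  rw [← LinearMap.map_smul_of_tower, hv, map_zero]
end ModPRepCount
end Literature.NumberTheory.GaloisRepresentations.LocalEPC
end

-- from `ModPLatticeHerbrandCount`
section
open _root_.Function
namespace Literature.NumberTheory.GaloisRepresentations.LocalEPC
namespace ModPRepCount
open _root_.Representation
variable {G : Type*} [Group G]
variable {V : Type*} [AddCommGroup V] (ρ : Representation ℤ G V) (p : ℕ)
/-- `pV = im (p : V → V)` is `G`-stable. [folklore] -/
private theorem range_lsmul_le_comap (g : G) :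
    LinearMap.range (LinearMap.lsmul ℤ V p) ≤ (LinearMap.range (LinearMap.lsmul ℤ V p)).comap (ρ g) := by
  rintro _ ⟨v, rfl⟩
  refine ⟨ρ g v, ?_⟩
  simp only [LinearMap.lsmul_apply]
  rw [LinearMap.map_smul_of_tower]
end ModPRepCount
end Literature.NumberTheory.GaloisRepresentations.LocalEPC
end

-- from `LocalOneUnitsGaloisModP`
section
open _root_.Function
open scoped ValuativeRel
namespace Literature.NumberTheory.GaloisRepresentations.LocalEPC
namespace OneUnits
open _root_.Representation
variable {K : Type*} [Field K] {E : Type*} [Field E] [Algebra K E] [ValuativeRel E]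
variable (p : ℕ) [hp : Fact p.Prime]
section Algebra
omit hp in
/-- The valuation of `1 + p^k b` is `1` for `b ∈ 𝒪_E`, `k ≥ 1`, `|p| < 1`. [folklore] -/
private theorem valuation_one_add_eq_one (hpv : ValuativeRel.valuation E p < 1) {k : ℕ} (hk : 1 ≤ k) {b : E}
    (hb : b ∈ 𝒪[E]) : ValuativeRel.valuation E (1 + (p : E) ^ k * b) = 1 := by
  have hlt : ValuativeRel.valuation E ((p : E) ^ k * b) < 1 := by
    rw [map_mul, map_pow]
    have h1 : ValuativeRel.valuation E (p : E) ^ k < 1 := pow_lt_one₀ zero_le hpv (by omega)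
    calc ValuativeRel.valuation E (p : E) ^ k * ValuativeRel.valuation E b
        ≤ ValuativeRel.valuation E (p : E) ^ k * 1 := by
          gcongr
          exact (Valuation.mem_integer_iff _ _).1 hb
      _ < 1 := by rw [mul_one]; exact h1
  rw [Valuation.map_add_eq_of_lt_left _ (by rwa [map_one]), map_one]
end Algebra
end OneUnits
end Literature.NumberTheory.GaloisRepresentations.LocalEPC
end

-- from `LocalOneUnitsModPCount`
section
open _root_.Function
open scoped ValuativeRel _root_.Topology
namespace Literature.NumberTheory.GaloisRepresentations.LocalEPC
namespace OneUnits
open _root_.Representation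
variable {K : Type*} [Field K] {E : Type*} [Field E] [Algebra K E] [ValuativeRel E]
  [TopologicalSpace E] [IsNonarchimedeanLocalField E]
variable (p : ℕ) [hp : Fact p.Prime]
section Hypotheses
omit hp [TopologicalSpace E] [IsNonarchimedeanLocalField E] in
/-- `a ∈ p^m 𝒪_E` whenever `v(a) ≤ v(p^m)` (`p ≠ 0`). [folklore] -/
private theorem mem_span_pow_of_valuation_le [CharZero E] (hp0 : p ≠ 0) (m : ℕ) (a : 𝒪[E])
    (ha : ValuativeRel.valuation E (a : E) ≤ ValuativeRel.valuation E ((p : E) ^ m)) :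
    a ∈ Ideal.span {((p : 𝒪[E]) ^ m)} := by
  have hpm : ((p : E) ^ m) ≠ 0 := pow_ne_zero _ (Nat.cast_ne_zero.2 hp0)
  have hq : (a : E) / (p : E) ^ m ∈ 𝒪[E] := by
    rw [Valuation.mem_integer_iff, map_div₀]
    exact div_le_one_of_le₀ ha zero_le
  refine Ideal.mem_span_singleton'.2 ⟨⟨_, hq⟩, Subtype.ext ?_⟩
  simp only [Subring.coe_mul, Subring.coe_pow, Subring.coe_natCast]
  exact div_mul_cancel₀ _ hpm
end Hypotheses
end OneUnits
end Literature.NumberTheory.GaloisRepresentations.LocalEPC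
end

-- from `LocalOneUnitsModPCount`
section
open _root_.Function
open scoped ValuativeRel _root_.Topology
namespace Literature.NumberTheory.GaloisRepresentations.LocalEPC
namespace OneUnits
open _root_.Representation
variable {K : Type*} [Field K] {E : Type*} [Field E] [Algebra K E] [ValuativeRel E]
  [TopologicalSpace E] [IsNonarchimedeanLocalField E]
variable (p : ℕ) [hp : Fact p.Prime]
section Hypotheses
/-- **`𝒪_E` is a compact `p`-adic ring** in the sense of `OneUnits.exists_subgroup_continuousMulEquiv`:
`p` is a non-zero-divisor, `1 + p a` is a unit, the ideals `p^m 𝒪_E` are open and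
`⋂ₘ p^m 𝒪_E = 0` (Krull). [folklore] -/
private theorem integer_hypotheses [CharZero E] (hpv : ValuativeRel.valuation E p < 1) :
    (∀ a : 𝒪[E], (p : 𝒪[E]) * a = 0 → a = 0) ∧
    (∀ a : 𝒪[E], IsUnit (1 + (p : 𝒪[E]) * a)) ∧
    (∀ m : ℕ, IsOpen ((Ideal.span {((p : 𝒪[E]) ^ m)} : Ideal 𝒪[E]) : Set 𝒪[E])) ∧
    (∀ a : 𝒪[E], (∀ m : ℕ, a ∈ Ideal.span {((p : 𝒪[E]) ^ m)}) → a = 0) := by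
  have hp0 : p ≠ 0 := hp.out.ne_zero
  have hpE : (p : E) ≠ 0 := Nat.cast_ne_zero.2 hp0
  refine ⟨fun a ha => ?_, fun a => ?_, fun m => ?_, fun a ha => ?_⟩
  · have h' : (p : E) * (a : E) = 0 := by
      have := congrArg (Subtype.val : 𝒪[E] → E) ha
      simpa using this
    rcases mul_eq_zero.1 h' with h | h
    · exact absurd h hpE
    · exact Subtype.ext h
  · refine (Valuation.integer.integers (ValuativeRel.valuation E)).isUnit_of_one' ?_
    change ValuativeRel.valuation E ((1 + (p : 𝒪[E]) * a : 𝒪[E]) : E) = 1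
    simp only [Subring.coe_add, Subring.coe_one, Subring.coe_mul, Subring.coe_natCast]
    have := valuation_one_add_eq_one p hpv le_rfl a.2 (E := E)
    rwa [pow_one] at this
  · -- `p^m 𝒪_E` contains the neighbourhood `{a | v(a) < v(p^m)}` of `0`
    refine AddSubgroup.isOpen_of_mem_nhds (Ideal.span {((p : 𝒪[E]) ^ m)}).toAddSubgroup
      (g := 0) ?_
    have hγ0 : ValuativeRel.valuation E ((p : E) ^ m) ≠ 0 :=
      (Valuation.ne_zero_iff _).2 (pow_ne_zero _ hpE)
    have hmem : {z : E | ValuativeRel.valuation E z < Units.mk0 _ hγ0} ∈ 𝓝 (0 : E) :=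
      (IsValuativeTopology.mem_nhds_zero_iff _).2 ⟨Units.mk0 _ hγ0, subset_rfl⟩
    have hmem' : Subtype.val ⁻¹' {z : E | ValuativeRel.valuation E z < Units.mk0 _ hγ0} ∈
        𝓝 (0 : 𝒪[E]) := by
      rw [nhds_subtype]
      exact Filter.preimage_mem_comap (by simpa using hmem)
    refine Filter.mem_of_superset hmem' fun a ha => ?_
    exact mem_span_pow_of_valuation_le p hp0 m a (le_of_lt ha)
  · have hle : Ideal.span {(p : 𝒪[E])} ≤ 𝓂[E] := by
      rw [Ideal.span_le, Set.singleton_subset_iff]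
      exact Literature.NumberTheory.GaloisRepresentations.LocalField.natCast_mem_maximalIdeal hpv
    have hinf := Ideal.iInf_pow_eq_bot_of_isLocalRing (I := 𝓂[E]) (IsLocalRing.maximalIdeal.isMaximal _).ne_top
    have hmem : a ∈ ⨅ m : ℕ, 𝓂[E] ^ m := by
      refine Ideal.mem_iInf.2 fun m => ?_
      have h1 : a ∈ Ideal.span {(p : 𝒪[E])} ^ m := by rw [Ideal.span_singleton_pow]; exact ha m
      exact Ideal.pow_right_mono hle m h1
    rw [hinf] at hmem
    exact (Submodule.mem_bot _).1 hmem
end Hypotheses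
end OneUnits
end Literature.NumberTheory.GaloisRepresentations.LocalEPC
end

-- from `LocalOneUnitsModPCount`
section
open _root_.Function
open scoped ValuativeRel _root_.Topology
namespace Literature.NumberTheory.GaloisRepresentations.LocalEPC
namespace OneUnits
open _root_.Representation
variable {K : Type*} [Field K] {E : Type*} [Field E] [Algebra K E] [ValuativeRel E]
  [TopologicalSpace E] [IsNonarchimedeanLocalField E]
variable (p : ℕ) [hp : Fact p.Prime]
section Equiv
omit hp [TopologicalSpace E] [IsNonarchimedeanLocalField E] in
/-- `#(O/pO) = #(𝒪_E/(p))` for the `ℤ`-submodule copy `O` of `𝒪_E` in `E`. [folklore] -/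
private theorem natCard_quotient_integer_eq (O : Submodule ℤ E) (hO : ∀ x, x ∈ O ↔ x ∈ 𝒪[E]) :
    Nat.card (O ⧸ LinearMap.range (LinearMap.lsmul ℤ O p)) =
      Nat.card (𝒪[E] ⧸ Ideal.span {(p : 𝒪[E])}) := by
  let e : O ≃+ 𝒪[E] :=
    { toFun := fun x => ⟨x.1, (hO _).1 x.2⟩
      invFun := fun y => ⟨y.1, (hO _).2 y.2⟩
      left_inv := fun x => rfl
      right_inv := fun y => rfl
      map_add' := fun x y => rfl }
  have hmap : AddSubgroup.map e.toAddMonoidHom (LinearMap.range (LinearMap.lsmul ℤ O p)).toAddSubgroup =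
      (Ideal.span {(p : 𝒪[E])}).toAddSubgroup := by
    ext y
    simp only [AddSubgroup.mem_map, Submodule.mem_toAddSubgroup, LinearMap.mem_range,
      LinearMap.lsmul_apply, AddEquiv.coe_toAddMonoidHom]
    constructor
    · rintro ⟨_, ⟨z, rfl⟩, rfl⟩
      refine Ideal.mem_span_singleton'.2 ⟨e z, Subtype.ext ?_⟩
      change ((e z : 𝒪[E]) : E) * (p : E) = (((p : ℤ) • z : O) : E)
      rw [Submodule.coe_smul_of_tower, zsmul_eq_mul, Int.cast_natCast, mul_comm]; rfl
    · intro hy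
      obtain ⟨a, ha⟩ := Ideal.mem_span_singleton'.1 hy
      refine ⟨(p : ℤ) • e.symm a, ⟨e.symm a, rfl⟩, Subtype.ext ?_⟩
      change (((p : ℤ) • e.symm a : O) : E) = (y : E)
      rw [Submodule.coe_smul_of_tower, zsmul_eq_mul, Int.cast_natCast, ← ha, Subring.coe_mul,
        Subring.coe_natCast, mul_comm]; rfl
  exact Nat.card_congr (QuotientAddGroup.congr _ _ e hmap).toEquiv
end Equiv
end OneUnits
end Literature.NumberTheory.GaloisRepresentations.LocalEPC
end

-- from `LocalIntegersNormalBasisLattice`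
section
open _root_.Function
open scoped ValuativeRel
namespace Literature.NumberTheory.GaloisRepresentations.LocalEPC
namespace LocalIntegers
open _root_.Representation
variable {K : Type*} [Field K] {E : Type*} [Field E] [Algebra K E] [ValuativeRel E]
  [TopologicalSpace E] [IsNonarchimedeanLocalField E]
variable (p : ℕ) [hp : Fact p.Prime]
omit hp [TopologicalSpace E] [IsNonarchimedeanLocalField E] in
/-- **`𝒪_E` as a membership-characterised `ℤ`-submodule of `E`.** [folklore] -/
private theorem exists_submodule_integer :
    ∃ O : Submodule ℤ E, ∀ x : E, x ∈ O ↔ x ∈ 𝒪[E] :=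
  ⟨AddSubgroup.toIntSubmodule (𝒪[E]).toAddSubgroup, fun _ => Iff.rfl⟩
end LocalIntegers
end Literature.NumberTheory.GaloisRepresentations.LocalEPC
end

end Part0

/-!
## Part 1 — port of `Summits/BirchSwinnertonDyer/Rank1Residual/GaloisImage/TrivialActionHOneDescent.lean`

# `H¹(G, M) = Hom_G(N, M)` for an open normal subgroup acting trivially, `(G : N)` invertible on `M`
# (cell `b2b-bsdres`, team n1011, row T-EPC = Tate's local Euler–Poincaré characteristic; seat p04 GEN 8; stage C1)

HONEST FRAMING (cell `b2b-bsdres`, run/shared/lean/b2b/bsd-rank1-residual/, verbatim in every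
file): the goal of the cell is to DELETE the COMBINATION-SHAPED residual classes of the
Birch–Swinnerton-Dyer formula for ALL analytic-rank `≤ 1` elliptic curves over `ℚ` — "full BSD
formula for every rank `≤ 1` curve in class `C`" assembled STRICTLY from published theorems — so
that the rank-`≤ 1` remainder becomes exactly the CONSTRUCTION-SHAPED classes, which are TYPED
(missing-input `Prop`s), NOT attempted. This is not "finishing BSD". Team n1011 (N10 / N11, the
additive block X4 ∧ `p = 3`): research route; no claim beyond the stated classes; nothing is
booked; no mark / label is changed by this file. Theorems only (no definition, no named fact, no
`sorry`); TOOL theorems of profinite group cohomology.  (Placement: Summits/GaloisImage with the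
rest of the T-EPC cone.)

## What

Stage C of the T-EPC programme computes `h¹(K, W)` over the tame layer: `Γ = Γ_K ⊳ N = Γ_E`
open of index prime to `p`, `W` a finite discrete `Γ`-module killed by `p` on which `N` acts
trivially.  Then (Serre, *Corps locaux* VII §6 / *Cohomologie galoisienne* I §2.4 Prop. 9:
`res : H¹(Γ, W) → H¹(N, W)^{Γ/N}` is an isomorphism when `(Γ : N)` is invertible on `W` — the
tree's `ConjugationDescent`) and `H¹(N, W) = Hom_cont(N, W)` (no coboundaries for a trivial
action), so that `H¹(Γ, W)` "is" the group of continuous homomorphisms `φ : N → W` with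
`φ(g⁻¹ n g) = g⁻¹ φ(n)`.  This file proves the counted form, for any topological group `G`, open
normal subgroup `N` of finite index and discrete `G`-module `M` with `N` acting trivially and
`m ↦ (G:N) m` bijective on `M`:

* `TrivialAction.natCard_continuousCohomology_one_eq` —
  **`#H¹(G, M) = #{φ ∈ Z¹_cont(N, M) | ∀ g, g·φ = φ}`**, where `Z¹_cont(N, M)` is the tree's
  `contOneCocycles (subgroupRep _ N)` (= continuous homomorphisms `N → M`, `apply_mul`) and
  `(g·φ)(x) = g φ(g⁻¹ x g)` is the tree's cocycle-level conjugation
  (`contOneCocycles.pullback (subgroupConj N g) (conjRepHom _ N g)`);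
* `TrivialAction.oneCocycleClass_injective` — `[·] : Z¹_cont(N, M) → H¹(N, M)` is bijective.

References: J.-P. Serre, *Local Fields* (1979), VII §5–§6 [SerreLocalFields1979]; J.-P. Serre,
*Galois Cohomology* (1997), I §2.4 Prop. 9, I §2.6 (b) [SerreGaloisCohomology1997]; J. S. Milne,
*Arithmetic Duality Theorems* (2006), I §2, proof of Thm. 2.8 [MilneADT2006].
-/

section Part1


open _root_.CategoryTheory _root_.Function
open Literature.NumberTheory.GaloisRepresentations
open Literature.NumberTheory.EllipticCurves (subgroupConj subgroupConj_apply_coe)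

universe u

namespace Literature.NumberTheory.GaloisRepresentations.LocalEPC

namespace TrivialAction

variable {G : Type u} [Group G] [TopologicalSpace G] [IsTopologicalGroup G]
variable {M : Type u} [AddCommGroup M] [TopologicalSpace M] [DiscreteTopology M]
variable (ρ : ContinuousRep G ℤ M) (N : Subgroup G)

omit [IsTopologicalGroup G] in
/-- For a subgroup `N` acting trivially, a continuous `1`-cocycle `N → M` is a homomorphism:
`φ (x y) = φ x + φ y`. [folklore] -/
private theorem apply_mul (htriv : ∀ n ∈ N, ∀ m : M, ρ n m = m)
    (φ : contOneCocycles (subgroupRep ρ.toTopRep N)) (x y : N) :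
    φ.1 (x * y) = φ.1 x + φ.1 y := by
  have h := φ.2 x y
  rw [subgroupRep_ρ_apply] at h
  rw [h]
  exact congrArg _ (htriv x x.2 _)

/-- For a subgroup `N` acting trivially, `[·] : Z¹_cont(N, M) → H¹(N, M)` is injective (the only
principal crossed homomorphism is `0`). [cite: SerreGaloisCohomology1997, I §2.2, I §5.1] -/
theorem oneCocycleClass_injective (htriv : ∀ n ∈ N, ∀ m : M, ρ n m = m) :
    Injective (oneCocycleClass (subgroupRep ρ.toTopRep N)) := by
  intro φ ψ h
  rw [← sub_eq_zero] at h ⊢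
  rw [← oneCocycleClass_sub] at h
  obtain ⟨v, hv⟩ := (oneCocycleClass_eq_zero_iff _ _).1 h
  apply Subtype.ext
  ext x
  rw [hv x, subgroupRep_ρ_apply]
  change ρ (x : G) v - v = 0
  rw [htriv x x.2 v, sub_self]

/-- For a subgroup `N` acting trivially, `[·] : Z¹_cont(N, M) → H¹(N, M)` is bijective.
[cite: SerreGaloisCohomology1997, I §2.2, I §5.1] -/
theorem oneCocycleClass_bijective (htriv : ∀ n ∈ N, ∀ m : M, ρ n m = m) :
    Bijective (oneCocycleClass (subgroupRep ρ.toTopRep N)) :=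
  ⟨oneCocycleClass_injective ρ N htriv, oneCocycleClass_surjective _⟩

variable [N.Normal]

/-- The restriction `H¹(G, M) → H¹(N, M)` lands in the `G`-invariant classes, and — when `N` is open
of finite index with `(G : N)` invertible on the discrete module `M` — is a bijection onto them.
[cite: SerreLocalFields1979, VII §6] [cite: SerreGaloisCohomology1997, I §2.4 Prop. 9] -/
theorem resSubgroup_one_bijective_invariants [Fintype (G ⧸ N)] (hNo : IsOpen (N : Set G))
    (hd : Bijective fun m : M => (N.index : ℤ) • m) :
    Bijective fun x : continuousCohomology 1 ρ.toTopRep =>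
      (⟨resSubgroup ρ.toTopRep N 1 x, fun g => conjMap_resSubgroup_one ρ.toTopRep N g x⟩ :
        {y : continuousCohomology 1 (subgroupRep ρ.toTopRep N) // ∀ g : G, conjMap ρ.toTopRep N g 1 y = y}) := by
  refine ⟨fun a b h => resSubgroup_one_injective_of_bijective N ρ hNo hd (congrArg Subtype.val h),
    fun y => ?_⟩
  obtain ⟨x, hx⟩ := exists_resSubgroup_one_eq_of_bijective N ρ hNo hd y.1 y.2
  exact ⟨x, Subtype.ext hx⟩

/-- **`#H¹(G, M) = #{φ ∈ Z¹_cont(N, M) | g·φ = φ ∀ g}`** for an open normal subgroup `N` of finite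
index acting trivially on the discrete `G`-module `M`, with `m ↦ (G:N)·m` bijective on `M`
(`(g·φ)(x) = g φ(g⁻¹ x g)`; the invariant `φ` are the continuous homomorphisms `N → M` with
`φ(g⁻¹ x g) = g⁻¹ φ(x)`).  Restriction is a bijection onto the `G`-invariant classes (the tree's
`ConjugationDescent`), and classes of `N` are cocycles (`oneCocycleClass_bijective`) compatibly
with the action (`conjMap_oneCocycleClass`). [cite: SerreLocalFields1979, VII §6]
[cite: MilneADT2006, I §2 proof of Thm 2.8] -/
theorem natCard_continuousCohomology_one_eq [Fintype (G ⧸ N)] (hNo : IsOpen (N : Set G))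
    (hd : Bijective fun m : M => (N.index : ℤ) • m) (htriv : ∀ n ∈ N, ∀ m : M, ρ n m = m) :
    Nat.card (continuousCohomology 1 ρ.toTopRep) =
      Nat.card {φ : contOneCocycles (subgroupRep ρ.toTopRep N) //
        ∀ g : G, contOneCocycles.pullback (subgroupConj N g) (conjRepHom ρ.toTopRep N g) φ = φ} := by
  rw [Nat.card_eq_of_bijective _ (resSubgroup_one_bijective_invariants ρ N hNo hd)]
  symm
  refine Nat.card_eq_of_bijective
    (fun φ => ⟨oneCocycleClass _ φ.1, fun g => by
      rw [conjMap_oneCocycleClass, φ.2 g]⟩) ⟨fun φ ψ h => ?_, fun y => ?_⟩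
  · exact Subtype.ext (oneCocycleClass_injective ρ N htriv (congrArg Subtype.val h))
  · obtain ⟨φ, hφ⟩ := oneCocycleClass_surjective _ y.1
    refine ⟨⟨φ, fun g => oneCocycleClass_injective ρ N htriv ?_⟩, Subtype.ext hφ⟩
    rw [← conjMap_oneCocycleClass, hφ, y.2 g]

omit [TopologicalSpace G] [IsTopologicalGroup G] [TopologicalSpace M] [DiscreteTopology M] [N.Normal] in
/-- The index `(G : N)` acts bijectively on a module killed by `p` when `p ∤ (G : N)`. [folklore] -/
private theorem bijective_index_smul_of_prime {p : ℕ} [hp : Fact p.Prime] (hpM : ∀ m : M, p • m = 0)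
    (hG : ¬ p ∣ N.index) : Bijective fun m : M => (N.index : ℤ) • m := by
  have hcop : Nat.Coprime N.index p := (Nat.Prime.coprime_iff_not_dvd hp.out).2 hG |>.symm
  obtain ⟨a, b, hab⟩ := Nat.isCoprime_iff_coprime.2 hcop
  have hinv : ∀ m : M, a • ((N.index : ℤ) • m) = m := fun m => by
    rw [smul_smul]
    have h1 : a * (N.index : ℤ) = 1 - b * p := by linarith
    rw [h1, sub_smul, one_smul, mul_smul, natCast_zsmul, hpM, smul_zero, sub_zero]
  have hinv' : ∀ m : M, (N.index : ℤ) • (a • m) = m := fun m => by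
    rw [smul_comm]; exact hinv m
  refine ⟨fun m m' h => ?_, fun m => ⟨a • m, hinv' m⟩⟩
  have h' := congrArg (fun x : M => a • x) h
  simp only [hinv] at h'
  exact h'

end TrivialAction

end Literature.NumberTheory.GaloisRepresentations.LocalEPC

end Part1

/-!
## Part 2 — port of `Summits/BirchSwinnertonDyer/Rank1Residual/GaloisImage/EquivariantHomDualCount.lean`

# Equivariant continuous homs `N → Hom(Z, Ω)` versus `Hom_G(Z, Y)` along `Y ≃ Hom_cont(N, Ω)`
# (cell `b2b-bsdres`, team n1011, row T-EPC = Tate's local Euler–Poincaré characteristic; seat p04 GEN 8; stage C3b)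

HONEST FRAMING (cell `b2b-bsdres`, run/shared/lean/b2b/bsd-rank1-residual/, verbatim in every
file): the goal of the cell is to DELETE the COMBINATION-SHAPED residual classes of the
Birch–Swinnerton-Dyer formula for ALL analytic-rank `≤ 1` elliptic curves over `ℚ` — "full BSD
formula for every rank `≤ 1` curve in class `C`" assembled STRICTLY from published theorems — so
that the rank-`≤ 1` remainder becomes exactly the CONSTRUCTION-SHAPED classes, which are TYPED
(missing-input `Prop`s), NOT attempted. This is not "finishing BSD". Team n1011 (N10 / N11, the
additive block X4 ∧ `p = 3`): research route; no claim beyond the stated classes; nothing is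
booked; no mark / label is changed by this file. Theorems only (no definition, no named fact, no
`sorry`); TOOL theorems of profinite group cohomology.  (Placement: Summits/GaloisImage with the
T-EPC cone.)

## What

The "swap" step of stage C of the T-EPC programme (Milne, *ADT* I Thm. 2.8, proof, p. 34:
`H¹(Gal(K̄/L), M) = Hom(Gal(K̄/L), M)` as a `G`-module, computed through `L^×/L^{×p}`).  Let `G` be a
topological group, `N ⊴ G`, `Ω` a discrete `G`-module and `Z` a finite discrete `G`-module on both
of which `N` acts trivially, and `Y` an abstract `G`-module given with an additive isomorphism
`Ψ : Y ≃ Z¹_cont(N, Ω)` (`= Hom_cont(N, Ω)`) which is `G`-equivariant for the conjugation action on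
cocycles `(g·φ)(m) = g φ(g⁻¹ m g)` (for `Y = Eˣ/Eˣⁿ`, `Ω = μₙ` this is the equivariant Kummer
isomorphism of stage C3a).  Then

* `EquivariantHom.natCard_invariant_cocycles_homRep_eq` —
  **`#{φ ∈ Z¹_cont(N, Hom(Z, Ω)) | g·φ = φ ∀ g} = #Hom_G(Z, Y)`**:
  `φ ↦ (z ↦ Ψ⁻¹(m ↦ φ(m)(z)))` and `Θ ↦ (m ↦ (z ↦ Ψ(Θ z)(m)))` are inverse bijections between the
  `G`-invariant continuous crossed homomorphisms `N → Hom(Z, Ω) = Z^D` (the tree's dual module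
  `ContinuousRep.homRep`) and the `G`-equivariant additive maps `Z → Y`
  (`Representation.IntertwiningMap`).

With stage C1 (`#H¹(G, M) = #{G-invariant φ : N → M}`), `M ≅ M^{DD}` and C3a this gives
`h¹(K, M) = #Hom_Γ(M^D, Eˣ/Eˣᵖ)`, to which Lemma 2.11 (stage B7) applies.

References: J. S. Milne, *Arithmetic Duality Theorems* (2006), I §2, proof of Thm. 2.8
[MilneADT2006]; J.-P. Serre, *Local Fields* (1979), VII §5 [SerreLocalFields1979].
-/

section Part2


open _root_.CategoryTheory _root_.Function
open Literature.NumberTheory.GaloisRepresentations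
open Literature.NumberTheory.EllipticCurves (subgroupConj subgroupConj_apply_coe)

universe u

namespace Literature.NumberTheory.GaloisRepresentations.LocalEPC

namespace EquivariantHom

variable {G : Type u} [Group G] [TopologicalSpace G] [IsTopologicalGroup G]
variable (N : Subgroup G) [N.Normal]
variable {Ω : Type u} [AddCommGroup Ω] [TopologicalSpace Ω] [DiscreteTopology Ω]
  (ω : ContinuousRep G ℤ Ω)
variable {Z : Type u} [AddCommGroup Z] [TopologicalSpace Z] [DiscreteTopology Z] [Finite Z]
  (ζ : ContinuousRep G ℤ Z)
variable {Y : Type*} [AddCommGroup Y] (τ : Representation ℤ G Y)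

omit [IsTopologicalGroup G] [N.Normal] [TopologicalSpace Z] [DiscreteTopology Z] in
/-- A map `N → Hom(Z, Ω)` (`Z` finite, `Hom(Z, Ω)` discrete) is continuous as soon as all its
evaluations `m ↦ f m z` are. [folklore] -/
private theorem continuous_of_eval (f : N → HomCarrier Z Ω) (hf : ∀ z : Z, Continuous fun m => f m z) :
    Continuous f := by
  classical
  haveI := Fintype.ofFinite Z
  rw [continuous_discrete_rng]
  intro F
  have hset : f ⁻¹' {F} = ⋂ z : Z, (fun m => f m z) ⁻¹' {F z} := by
    ext m
    simp only [Set.mem_preimage, Set.mem_singleton_iff, Set.mem_iInter]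
    exact ⟨fun h z => by rw [h], fun h => HomCarrier.ext h⟩
  rw [hset]
  exact isOpen_iInter_of_finite fun z => (continuous_discrete_rng.1 (hf z)) (F z)

omit [N.Normal] in
/-- **Evaluation at `z ∈ Z`** takes a continuous cocycle `φ : N → Hom(Z, Ω) = Z^D` to a continuous
cocycle `m ↦ φ(m)(z) : N → Ω`, when `N` acts trivially on `Z`. [folklore] -/
private theorem exists_eval (hZ : ∀ n ∈ N, ∀ z : Z, ζ n z = z)
    (φ : contOneCocycles (subgroupRep (ζ.homRep ω).toTopRep N)) (z : Z) :
    ∃ ψ : contOneCocycles (subgroupRep ω.toTopRep N), ∀ m : N, ψ.1 m = φ.1 m z := by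
  refine ⟨⟨⟨fun m => φ.1 m z,
    (continuous_of_discreteTopology (f := fun F : HomCarrier Z Ω => F z)).comp φ.1.continuous⟩,
    fun m m' => ?_⟩, fun m => rfl⟩
  change φ.1 (m * m') z = φ.1 m z + ω (m : G) (φ.1 m' z)
  rw [φ.2 m m', subgroupRep_ρ_apply]
  change (φ.1 m + (ζ.homRep ω) (m : G) (φ.1 m')) z = _
  rw [HomCarrier.add_apply, ContinuousRep.homRep_apply_apply_apply]
  have h : ζ (m : G)⁻¹ z = z := by
    have := hZ (m : G)⁻¹ (N.inv_mem m.2) z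
    exact this
  rw [h]

/-- **`#{G-invariant φ ∈ Z¹_cont(N, Z^D)} = #Hom_G(Z, Y)`** along a `G`-equivariant additive
isomorphism `Ψ : Y ≃ Z¹_cont(N, Ω)`, for `N ⊴ G` acting trivially on the finite discrete `Z` and on
the discrete `Ω` (`Z^D = Hom(Z, Ω)` the tree's `homRep`; `(g·φ)(m) = g φ(g⁻¹ m g)`).
[cite: MilneADT2006, I §2 proof of Thm 2.8 (p. 34)] [cite: SerreLocalFields1979, VII §5] -/
theorem natCard_invariant_cocycles_homRep_eq
    (hΩ : ∀ n ∈ N, ∀ v : Ω, ω n v = v) (hZ : ∀ n ∈ N, ∀ z : Z, ζ n z = z)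
    (Ψ : Y ≃+ contOneCocycles (subgroupRep ω.toTopRep N))
    (hΨ : ∀ (g : G) (y : Y), Ψ (τ g y) =
      contOneCocycles.pullback (subgroupConj N g) (conjRepHom ω.toTopRep N g) (Ψ y)) :
    Nat.card {φ : contOneCocycles (subgroupRep (ζ.homRep ω).toTopRep N) //
        ∀ g : G, contOneCocycles.pullback (subgroupConj N g)
          (conjRepHom (ζ.homRep ω).toTopRep N g) φ = φ} =
      Nat.card (Representation.IntertwiningMap ζ.toRepresentation τ) := by
  classical
  -- evaluation cocycles
  choose ev hev using exists_eval N ω ζ hZ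
  have hev_add : ∀ (φ : contOneCocycles (subgroupRep (ζ.homRep ω).toTopRep N)) (z z' : Z),
      ev φ (z + z') = ev φ z + ev φ z' := fun φ z z' => by
    apply Subtype.ext; ext m
    change (ev φ (z + z')).1 m = (ev φ z).1 m + (ev φ z').1 m
    rw [hev, hev, hev, map_add]
  -- values of `Ψ y` under conjugation
  have hΨval : ∀ (g : G) (y : Y) (m : N),
      (Ψ y).1 m = ω g ((Ψ (τ g⁻¹ y)).1 (subgroupConj N g m)) := fun g y m => by
    have h := hΨ g (τ g⁻¹ y)
    rw [← Module.End.mul_apply, ← map_mul, mul_inv_cancel, map_one, Module.End.one_apply] at h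
    conv_lhs => rw [h]
    rfl
  -- inverse direction `Θ ↦ φ_Θ`
  have hΘcoc : ∀ Θ : Representation.IntertwiningMap ζ.toRepresentation τ,
      ∃ φ : contOneCocycles (subgroupRep (ζ.homRep ω).toTopRep N),
        ∀ (m : N) (z : Z), φ.1 m z = (Ψ (Θ z)).1 m := by
    intro Θ
    let f : N → HomCarrier Z Ω := fun m =>
      HomCarrier.ofAddMonoidHom
        { toFun := fun z => (Ψ (Θ z)).1 m
          map_zero' := by
            rw [map_zero, map_zero]; rfl
          map_add' := fun z z' => by
            rw [map_add, map_add]; rfl }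
    have hf : ∀ m z, f m z = (Ψ (Θ z)).1 m := fun m z => rfl
    have hfc : Continuous f := continuous_of_eval N (fun m => f m) fun z => (Ψ (Θ z)).1.continuous
    refine ⟨⟨⟨f, hfc⟩, fun m m' => HomCarrier.ext fun z => ?_⟩, fun m z => rfl⟩
    change f (m * m') z = (f m + (ζ.homRep ω) (m : G) (f m')) z
    rw [HomCarrier.add_apply, ContinuousRep.homRep_apply_apply_apply, hf, hf, hf,
      (Ψ (Θ z)).2 m m', subgroupRep_ρ_apply]
    have h1 : ζ (m : G)⁻¹ z = z := hZ (m : G)⁻¹ (N.inv_mem m.2) z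
    rw [h1]
    change _ + ω (m : G) _ = _ + ω (m : G) _
    rw [hΩ (m : G) m.2]
  choose coc hcoc using hΘcoc
  -- the bijection
  refine Nat.card_congr
    { toFun := fun φ =>
        { toLinearMap := (AddMonoidHom.mk' (fun z => Ψ.symm (ev φ.1 z))
            (fun z z' => by rw [hev_add, map_add])).toIntLinearMap
          isIntertwining' := fun g => by
            refine LinearMap.ext fun z => ?_
            change Ψ.symm (ev φ.1 (ζ g z)) = τ g (Ψ.symm (ev φ.1 z))
            apply Ψ.injective
            rw [Ψ.apply_symm_apply, hΨ, Ψ.apply_symm_apply]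
            apply Subtype.ext; ext m
            rw [hev, conj_pullback_apply]
            change φ.1.1 m (ζ g z) = ω g ((ev φ.1 z).1 (subgroupConj N g m))
            rw [hev]
            have hφ := congrArg
              (fun ψ : contOneCocycles (subgroupRep (ζ.homRep ω).toTopRep N) => ψ.1 m (ζ g z)) (φ.2 g)
            rw [← hφ]
            change ω g (φ.1.1 (subgroupConj N g m) (ζ g⁻¹ (ζ g z))) = _
            rw [← Module.End.mul_apply, ← map_mul, inv_mul_cancel, map_one, Module.End.one_apply] }
      invFun := fun Θ => ⟨coc Θ, fun g => by
        apply Subtype.ext; ext m z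
        rw [conj_pullback_apply]
        change ω g ((coc Θ).1 (subgroupConj N g m) (ζ g⁻¹ z)) = (coc Θ).1 m z
        have hΘ : Θ (ζ g⁻¹ z) = τ g⁻¹ (Θ z) := Θ.isIntertwining _ _ g⁻¹ z
        rw [hcoc, hcoc, hΨval g (Θ z) m, hΘ]⟩
      left_inv := fun φ => by
        apply Subtype.ext; apply Subtype.ext; ext m z
        change (coc _).1 m z = φ.1.1 m z
        rw [hcoc]
        change (Ψ (Ψ.symm (ev φ.1 z))).1 m = _
        rw [Ψ.apply_symm_apply, hev]
      right_inv := fun Θ => by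
        refine Representation.IntertwiningMap.ext (LinearMap.ext fun z => ?_)
        change Ψ.symm (ev (coc Θ) z) = Θ z
        apply Ψ.injective
        rw [Ψ.apply_symm_apply]
        apply Subtype.ext; ext m
        rw [hev, hcoc] }

end EquivariantHom

/-! ### Variant with unified module structure and a bijective additive map

For `Y` a quotient of a `ℤ`-module by a submodule the `Module ℤ Y` instance carried by a
`Representation ℤ G Y` is `Submodule.Quotient.module`, not `AddCommGroup.toIntModule`; the variant
below takes the module structure of `Y` as an implicit (unified) argument and `Ψ` as a bijective
`→+`, which is the form produced by the equivariant Kummer isomorphism (stage C3a). -/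

namespace EquivariantHom

variable {G : Type u} [Group G] [TopologicalSpace G] [IsTopologicalGroup G]
variable (N : Subgroup G) [N.Normal]
variable {Ω : Type u} [AddCommGroup Ω] [TopologicalSpace Ω] [DiscreteTopology Ω]
  (ω : ContinuousRep G ℤ Ω)
variable {Z : Type u} [AddCommGroup Z] [TopologicalSpace Z] [DiscreteTopology Z] [Finite Z]
  (ζ : ContinuousRep G ℤ Z)

/-- **`#{G-invariant φ ∈ Z¹_cont(N, Z^D)} = #Hom_G(Z, Y)`** along a `G`-equivariant BIJECTIVE
additive map `Ψ : Y → Z¹_cont(N, Ω)`, for `N ⊴ G` acting trivially on the finite discrete `Z` and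
on the discrete `Ω`; the `ℤ`-module structure of `Y` is the one carried by the representation `τ`.
[cite: MilneADT2006, I §2 proof of Thm 2.8 (p. 34)] [cite: SerreLocalFields1979, VII §5] -/
theorem natCard_invariant_cocycles_homRep_eq_of_bijective
    {Y : Type*} {instY : AddCommGroup Y} {instM : Module ℤ Y} (τ : Representation ℤ G Y)
    (hΩ : ∀ n ∈ N, ∀ v : Ω, ω n v = v) (hZ : ∀ n ∈ N, ∀ z : Z, ζ n z = z)
    (Ψ : Y →+ contOneCocycles (subgroupRep ω.toTopRep N)) (hbij : Bijective Ψ)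
    (hΨ : ∀ (g : G) (y : Y), Ψ (τ g y) =
      contOneCocycles.pullback (subgroupConj N g) (conjRepHom ω.toTopRep N g) (Ψ y)) :
    Nat.card {φ : contOneCocycles (subgroupRep (ζ.homRep ω).toTopRep N) //
        ∀ g : G, contOneCocycles.pullback (subgroupConj N g)
          (conjRepHom (ζ.homRep ω).toTopRep N g) φ = φ} =
      Nat.card (Representation.IntertwiningMap ζ.toRepresentation τ) := by
  -- all `ℤ`-module structures on `Y` coincide
  obtain rfl : instM = AddCommGroup.toIntModule Y := Subsingleton.elim _ _
  exact natCard_invariant_cocycles_homRep_eq N ω ζ τ hΩ hZ (AddEquiv.ofBijective Ψ hbij)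
    fun g y => hΨ g y

end EquivariantHom

end Literature.NumberTheory.GaloisRepresentations.LocalEPC

end Part2

/-!
## Part 3 — port of `Summits/BirchSwinnertonDyer/Rank1Residual/GaloisImage/KummerSubgroupCocycles.lean`

# Kummer cocycles of the subgroup `Gal(k̄/E) ≤ Γ_k`: `Hom_cont(Gal(k̄/E), μₙ) = Eˣ/Eˣⁿ`, equivariantly
# (cell `b2b-bsdres`, team n1011, row T-EPC = Tate's local Euler–Poincaré characteristic; seat p04 GEN 8; stage C2)

HONEST FRAMING (cell `b2b-bsdres`, run/shared/lean/b2b/bsd-rank1-residual/, verbatim in every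
file): the goal of the cell is to DELETE the COMBINATION-SHAPED residual classes of the
Birch–Swinnerton-Dyer formula for ALL analytic-rank `≤ 1` elliptic curves over `ℚ` — "full BSD
formula for every rank `≤ 1` curve in class `C`" assembled STRICTLY from published theorems — so
that the rank-`≤ 1` remainder becomes exactly the CONSTRUCTION-SHAPED classes, which are TYPED
(missing-input `Prop`s), NOT attempted. This is not "finishing BSD". Team n1011 (N10 / N11, the
additive block X4 ∧ `p = 3`): research route; no claim beyond the stated classes; nothing is
booked; no mark / label is changed by this file. Theorems only (no definition, no named fact, no
`sorry`); TOOL theorems of Galois cohomology.  (Placement: Summits/GaloisImage with the T-EPC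
cone.)

## What

Kummer theory for the open subgroup `N = Gal(k̄/E) ≤ Γ_k` of a subextension `E ⊆ k̄` (the tree's
`galFixing k E`), with values in the tree's discrete module `μₙ = DiscreteGaloisModule.mu k n`
restricted to `N` (Serre, *Local Fields* X §3; *Galois Cohomology* II §1.2): for `α ∈ k̄ˣ` with
`αⁿ` fixed by `N` the map `g ↦ g(α)/α` is a continuous `1`-cocycle of `N` with values in `μₙ`
(`exists_cocycle`), multiplicative in `α` (`muVal_mul`); EVERY continuous cocycle `N → μₙ` is of
this form (`exists_eq_smul_div`, Hilbert 90 for `N` = the tree's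
`subsingleton_one_units_galFixing`); the cocycle of `α` vanishes iff `α` is `N`-fixed, i.e. (in
characteristic `0`, Galois correspondence) iff `α ∈ E` (`forall_smul_div_eq_one_iff_mem`); and the
conjugation action of `g ∈ Γ_k` on cocycles (`(g·φ)(m) = g φ(g⁻¹ m g)`, the tree's
`contOneCocycles.pullback (subgroupConj N g) (conjRepHom _ N g)`) takes the cocycle of `α` to the
cocycle of `g α` (`muVal_conj_pullback`).  Together: `α ↦ (g ↦ g α / α)` induces a `Γ_k`-equivariant
isomorphism `Eˣ/Eˣⁿ ≅ Hom_cont(Gal(k̄/E), μₙ)` when `μₙ ⊆ E` — the input "`H¹(N, ℤ/p) = E^×/E^{×p}`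
as a `G`-module" of Milne's proof of *ADT* I Thm. 2.8 (stage C of the T-EPC programme; the counted
form is the sequel `KummerSubgroupCount`).

References: J.-P. Serre, *Local Fields* (1979), X §3 [SerreLocalFields1979]; J.-P. Serre,
*Galois Cohomology* (1997), II §1.2 [SerreGaloisCohomology1997]; J. S. Milne, *Arithmetic Duality
Theorems* (2006), I §2, proof of Thm. 2.8 [MilneADT2006].
-/

section Part3


open _root_.CategoryTheory _root_.Function _root_.Field
open Literature.NumberTheory.GaloisRepresentations
open Literature.NumberTheory.GaloisRepresentations.DiscreteGaloisModule
open Literature.NumberTheory.GaloisRepresentations.LocalWeilDatum (galFixing mem_galFixing_iff)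
open Literature.NumberTheory.EllipticCurves (subgroupConj subgroupConj_apply_coe)

universe u

namespace Literature.NumberTheory.GaloisRepresentations.LocalEPC

namespace KummerSubgroup

variable (k : Type u) [Field k] (n : ℕ) (E : IntermediateField k (AlgebraicClosure k))

/-- For `g ∈ Gal(k̄/E)` and `α ∈ k̄ˣ` with `αⁿ` fixed by `Gal(k̄/E)`, `g(α)/α` is an `n`-th root of
unity. [cite: SerreLocalFields1979, X §3] -/
theorem smul_div_mem_rootsOfUnity (α : (AlgebraicClosure k)ˣ)
    (hα : ∀ g ∈ galFixing k E, g • α ^ n = α ^ n) (g : galFixing k E) :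
    (g : absoluteGaloisGroup k) • α / α ∈ rootsOfUnity n (AlgebraicClosure k) := by
  rw [mem_rootsOfUnity, div_pow, ← smul_pow', hα g g.2, div_self']

/-- **The Kummer cocycle of `α` on `N = Gal(k̄/E)`**: for `α ∈ k̄ˣ` with `αⁿ` fixed by `N` there is
a continuous `1`-cocycle `φ : N → μₙ` (for the restriction to `N` of the Galois module `μₙ`) with
values `φ(g) = g(α)/α`. [cite: SerreLocalFields1979, X §3] [cite: SerreGaloisCohomology1997, II §1.2] -/
theorem exists_cocycle (α : (AlgebraicClosure k)ˣ) (hα : ∀ g ∈ galFixing k E, g • α ^ n = α ^ n) :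
    ∃ φ : contOneCocycles (subgroupRep (mu k n).toTopRep (galFixing k E)),
      ∀ g : galFixing k E, muVal k n (φ.1 g) = (g : absoluteGaloisGroup k) • α / α := by
  let f : galFixing k E → MuCarrier k n := fun g =>
    MuCarrier.ofRootsOfUnity ⟨(g : absoluteGaloisGroup k) • α / α, smul_div_mem_rootsOfUnity k n E α hα g⟩
  have hf : ∀ g, muVal k n (f g) = (g : absoluteGaloisGroup k) • α / α := fun g => rfl
  have hlc : IsLocallyConstant f := by
    refine IsLocallyConstant.desc _ (muVal k n) ?_ (muVal_injective k n)
    have h1 : IsLocallyConstant fun g : galFixing k E => (g : absoluteGaloisGroup k) • α :=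
      (isLocallyConstant_smul_units k α).comp_continuous continuous_subtype_val
    exact h1.div (IsLocallyConstant.const _)
  refine ⟨⟨⟨f, hlc.continuous⟩, fun g h => muVal_injective k n ?_⟩, fun g => rfl⟩
  change muVal k n (f (g * h)) = muVal k n (f g + (mu k n).toContRepresentation (g : absoluteGaloisGroup k) (f h))
  rw [muVal_add, muVal_toContRepresentation_apply, hf, hf, hf, Subgroup.coe_mul, mul_smul, smul_div']
  rw [mul_comm, div_mul_div_cancel]

/-- Cocycles of `N` with values in `μₙ` are determined by their values in `k̄ˣ`. [folklore] -/
private theorem cocycle_eq_of_muVal_eq {φ ψ : contOneCocycles (subgroupRep (mu k n).toTopRep (galFixing k E))}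
    (h : ∀ g, muVal k n (φ.1 g) = muVal k n (ψ.1 g)) : φ = ψ :=
  Subtype.ext (ContinuousMap.ext fun g => muVal_injective k n (h g))

/-- The values `g(αβ)/(αβ) = (g(α)/α)(g(β)/β)`: the Kummer cocycle is multiplicative in `α`.
[cite: SerreLocalFields1979, X §3] -/
theorem smul_div_mul (α β : (AlgebraicClosure k)ˣ) (g : absoluteGaloisGroup k) :
    g • (α * β) / (α * β) = (g • α / α) * (g • β / β) := by
  rw [smul_mul', mul_div_mul_comm]

/-- The values `g(αᵐ)/αᵐ = (g(α)/α)ᵐ`. [folklore] -/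
private theorem smul_div_pow (α : (AlgebraicClosure k)ˣ) (g : absoluteGaloisGroup k) (m : ℕ) :
    g • (α ^ m) / α ^ m = (g • α / α) ^ m := by
  rw [smul_pow', div_pow]

/-- **Every continuous cocycle `Gal(k̄/E) → μₙ` is a Kummer cocycle** `g ↦ g(α)/α` with `αⁿ` fixed
by `Gal(k̄/E)`: Hilbert's Theorem 90 for the subgroup (`H¹(Gal(k̄/E), k̄ˣ) = 0`, the tree's
`subsingleton_one_units_galFixing`). [cite: SerreLocalFields1979, X §1 Prop. 2, X §3]
[cite: SerreGaloisCohomology1997, II §1.2 Prop. 1] -/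
theorem exists_eq_smul_div (φ : contOneCocycles (subgroupRep (mu k n).toTopRep (galFixing k E))) :
    ∃ α : (AlgebraicClosure k)ˣ, (∀ g ∈ galFixing k E, g • α ^ n = α ^ n) ∧
      ∀ g : galFixing k E, muVal k n (φ.1 g) = (g : absoluteGaloisGroup k) • α / α := by
  -- the cocycle with values in `k̄ˣ`
  let u : C(galFixing k E, UnitsCarrier k) :=
    ⟨fun g => UnitsCarrier.ofUnits (muVal k n (φ.1 g)),
      (continuous_of_discreteTopology (f := fun v : MuCarrier k n => UnitsCarrier.ofUnits (muVal k n v))).comp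
        φ.1.continuous⟩
  have hu : ∀ g, (UnitsCarrier.toAdditive (u g)).toMul = muVal k n (φ.1 g) := fun g => rfl
  have hmem : u ∈ contOneCocycles (subgroupRep (units k).toTopRep (galFixing k E)) := by
    intro g h
    apply UnitsCarrier.toAdditive.injective
    apply Additive.toMul.injective
    rw [map_add, toMul_add]
    change muVal k n (φ.1 (g * h)) = muVal k n (φ.1 g) *
      (UnitsCarrier.toAdditive (units k (g : absoluteGaloisGroup k) (u h))).toMul
    rw [units_apply_apply, toMul_ofMul, hu, φ.2 g h, muVal_add]
    rfl
  haveI : Subsingleton (continuousCohomology 1 (subgroupRep (units k).toTopRep (galFixing k E))) :=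
    subsingleton_one_units_galFixing (k := k) E
  have h0 : oneCocycleClass (subgroupRep (units k).toTopRep (galFixing k E)) ⟨u, hmem⟩ = 0 :=
    Subsingleton.elim _ _
  obtain ⟨v, hv⟩ := (oneCocycleClass_eq_zero_iff _ _).1 h0
  refine ⟨(UnitsCarrier.toAdditive v).toMul, fun g hg => ?_, fun g => ?_⟩
  · -- `g αⁿ = (g α)ⁿ = (φ(g) α)ⁿ = αⁿ`
    have h := hv ⟨g, hg⟩
    have h' : muVal k n (φ.1 ⟨g, hg⟩) = g • (UnitsCarrier.toAdditive v).toMul / (UnitsCarrier.toAdditive v).toMul := by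
      have := congrArg (fun w => (UnitsCarrier.toAdditive w).toMul) h
      simpa [hu, toMul_sub] using this
    have hpow : (g • (UnitsCarrier.toAdditive v).toMul / (UnitsCarrier.toAdditive v).toMul) ^ n = 1 := by
      rw [← h', muVal_pow_eq_one]
    rw [div_pow, ← smul_pow', div_eq_one] at hpow
    exact hpow
  · have h := hv g
    have := congrArg (fun w => (UnitsCarrier.toAdditive w).toMul) h
    simpa [hu, toMul_sub] using this

/-- `α ∈ k̄ˣ` has trivial Kummer cocycle on `Gal(k̄/E)` iff it is fixed by `Gal(k̄/E)`. [folklore] -/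
private theorem forall_smul_div_eq_one_iff (α : (AlgebraicClosure k)ˣ) :
    (∀ g : galFixing k E, (g : absoluteGaloisGroup k) • α / α = 1) ↔
      ∀ g ∈ galFixing k E, g • (α : AlgebraicClosure k) = α := by
  constructor
  · intro h g hg
    have h1 := h ⟨g, hg⟩
    rw [div_eq_one] at h1
    have := congrArg Units.val h1
    rwa [Units.coe_smul] at this
  · intro h g
    rw [div_eq_one]
    exact Units.ext (by rw [Units.coe_smul]; exact h g g.2)

/-- **Galois correspondence** (characteristic `0`): `α ∈ k̄` is fixed by `Gal(k̄/E)` iff `α ∈ E`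
(Mathlib `InfiniteGalois.fixedField_fixingSubgroup`). [folklore] -/
private theorem forall_smul_eq_iff_mem [CharZero k] (x : AlgebraicClosure k) :
    (∀ g ∈ galFixing k E, g • x = x) ↔ x ∈ E := by
  constructor
  · intro h
    rw [← InfiniteGalois.fixedField_fixingSubgroup E, IntermediateField.mem_fixedField_iff]
    intro σ hσ
    have hmem : (Field.absoluteGaloisGroup.toAlgEquiv k).symm σ ∈ galFixing k E := by
      rw [mem_galFixing_iff]
      intro y hy
      rw [Field.absoluteGaloisGroup.smul_def, MulEquiv.apply_symm_apply]
      exact (IntermediateField.mem_fixingSubgroup_iff _ _).1 hσ y hy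
    have := h _ hmem
    rwa [Field.absoluteGaloisGroup.smul_def, MulEquiv.apply_symm_apply] at this
  · intro hx g hg
    exact (mem_galFixing_iff k).1 hg x hx

/-- **Triviality of the Kummer cocycle** (characteristic `0`): the cocycle `g ↦ g(α)/α` of
`Gal(k̄/E)` vanishes iff `α ∈ E`. [cite: SerreLocalFields1979, X §3] -/
theorem forall_smul_div_eq_one_iff_mem [CharZero k] (α : (AlgebraicClosure k)ˣ) :
    (∀ g : galFixing k E, (g : absoluteGaloisGroup k) • α / α = 1) ↔ (α : AlgebraicClosure k) ∈ E := by
  rw [forall_smul_div_eq_one_iff, forall_smul_eq_iff_mem]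

/-- For `E/k` normal, `g ∈ Γ_k` and `α` with `αⁿ` fixed by `Gal(k̄/E)`, also `(gα)ⁿ` is fixed by
`Gal(k̄/E)`. [folklore] -/
private theorem smul_pow_fixed [(galFixing k E).Normal] (α : (AlgebraicClosure k)ˣ)
    (hα : ∀ g ∈ galFixing k E, g • α ^ n = α ^ n) (g : absoluteGaloisGroup k) :
    ∀ m ∈ galFixing k E, m • (g • α) ^ n = (g • α) ^ n := by
  intro m hm
  have hconj : g⁻¹ * m * g ∈ galFixing k E := by
    have := Subgroup.Normal.conj_mem inferInstance m hm g⁻¹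
    rwa [inv_inv] at this
  rw [← smul_pow', ← mul_smul]
  have : m * g = g * (g⁻¹ * m * g) := by group
  rw [this, mul_smul, hα _ hconj]

/-- **Equivariance of the Kummer cocycles**: for `E/k` normal and `g ∈ Γ_k`, the conjugate
`(g·φ)(m) = g φ(g⁻¹ m g)` of a cocycle `φ` of `Gal(k̄/E)` with values `m(α)/α` has values
`m(gα)/(gα)` — `Eˣ/Eˣⁿ ≅ Hom_cont(Gal(k̄/E), μₙ)` is `Gal(E/k)`-equivariant.
[cite: MilneADT2006, I §2 proof of Thm 2.8] [cite: SerreLocalFields1979, X §3] -/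
theorem muVal_conj_pullback [(galFixing k E).Normal]
    (φ : contOneCocycles (subgroupRep (mu k n).toTopRep (galFixing k E)))
    (α : (AlgebraicClosure k)ˣ)
    (hφ : ∀ m : galFixing k E, muVal k n (φ.1 m) = (m : absoluteGaloisGroup k) • α / α)
    (g : absoluteGaloisGroup k) (m : galFixing k E) :
    muVal k n ((contOneCocycles.pullback (subgroupConj (galFixing k E) g)
      (conjRepHom (mu k n).toTopRep (galFixing k E) g) φ).1 m) =
      (m : absoluteGaloisGroup k) • (g • α) / (g • α) := by
  rw [conj_pullback_apply]
  change muVal k n (mu k n g (φ.1 (subgroupConj (galFixing k E) g m))) = _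
  rw [muVal_apply, hφ, subgroupConj_apply_coe, smul_div', ← mul_smul, ← mul_smul]
  congr 1
  rw [← mul_assoc, ← mul_assoc, mul_inv_cancel, one_mul]

end KummerSubgroup

end Literature.NumberTheory.GaloisRepresentations.LocalEPC

end Part3

/-!
## Part 4 — port of `Summits/BirchSwinnertonDyer/Rank1Residual/GaloisImage/KummerSubgroupEquiv.lean`

# The equivariant Kummer isomorphism `Eˣ/Eˣⁿ ≃ Hom_cont(Gal(k̄/E), μₙ)` for `μₙ ⊆ E`
# (cell `b2b-bsdres`, team n1011, row T-EPC = Tate's local Euler–Poincaré characteristic; seat p04 GEN 8; stage C3a)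

HONEST FRAMING (cell `b2b-bsdres`, run/shared/lean/b2b/bsd-rank1-residual/, verbatim in every
file): the goal of the cell is to DELETE the COMBINATION-SHAPED residual classes of the
Birch–Swinnerton-Dyer formula for ALL analytic-rank `≤ 1` elliptic curves over `ℚ` — "full BSD
formula for every rank `≤ 1` curve in class `C`" assembled STRICTLY from published theorems — so
that the rank-`≤ 1` remainder becomes exactly the CONSTRUCTION-SHAPED classes, which are TYPED
(missing-input `Prop`s), NOT attempted. This is not "finishing BSD". Team n1011 (N10 / N11, the
additive block X4 ∧ `p = 3`): research route; no claim beyond the stated classes; nothing is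
booked; no mark / label is changed by this file. Theorems only (no definition, no named fact, no
`sorry`); TOOL theorems of Galois cohomology.  (Placement: Summits/GaloisImage with the T-EPC
cone.)

## What

For a field `k` of characteristic `0`, `n ≥ 1`, and a normal subextension `E ⊆ k̄` whose fixing
group `N = Gal(k̄/E)` (the tree's `galFixing k E`) acts trivially on `μₙ(k̄)` (i.e. `μₙ ⊆ E`):

* `KummerSubgroup.exists_equivariant_bijective` — there is a bijective additive map
  `Ψ : Eˣ/Eˣⁿ → Z¹_cont(N, μₙ)` (`= Hom_cont(N, μₙ)`, the tree's `contOneCocycles` of the restricted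
  module `μₙ`) with `Ψ(u)(m) = m(α)/α` for ANY `α ∈ k̄ˣ` with `αⁿ = u`, and which is
  `Γ_k`-EQUIVARIANT: `Ψ(g · x) = g · Ψ(x)`, `Γ_k` acting on `Eˣ/Eˣⁿ` through `Gal(E/k)`
  (`resGal E`, the representation `ofMulDistribMulAction (E ≃ₐ[k] E) Eˣ` of stages B1–B7 pulled
  back to `Γ_k`, modulo `n`) and on cocycles by conjugation, `(g·φ)(m) = g φ(g⁻¹ m g)` (the tree's
  `contOneCocycles.pullback (subgroupConj N g) (conjRepHom _ N g)`).

This is "`H¹(Gal(K̄/L), ℤ/pℤ) ≅ L^×/L^{×p}` as `G`-modules" in Milne's proof of *ADT* I Thm. 2.8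
(p. 34, with `μ_p ⊆ L`), assembled from the cocycle-level facts of stage C2
(`KummerSubgroupCocycles`: existence, Hilbert 90 surjectivity, triviality `↔ α ∈ E`, conjugation).

References: J. S. Milne, *Arithmetic Duality Theorems* (2006), I §2, proof of Thm. 2.8
[MilneADT2006]; J.-P. Serre, *Local Fields* (1979), X §3 [SerreLocalFields1979].
-/

section Part4


open _root_.CategoryTheory _root_.Function _root_.Field
open Literature.NumberTheory.GaloisRepresentations
open Literature.NumberTheory.GaloisRepresentations.DiscreteGaloisModule
open Literature.NumberTheory.GaloisRepresentations.LocalWeilDatum (galFixing mem_galFixing_iff)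
open Literature.NumberTheory.EllipticCurves (subgroupConj subgroupConj_apply_coe)

universe u

namespace Literature.NumberTheory.GaloisRepresentations.LocalEPC

namespace KummerSubgroup

variable (k : Type u) [Field k] (n : ℕ) (E : IntermediateField k (AlgebraicClosure k))

/-- Two `n`-th roots of the same element have the same Kummer cocycle on a subgroup fixing `μₙ`:
if `αⁿ = βⁿ` and `m` fixes `μₙ(k̄)` then `m(α)/α = m(β)/β`. [folklore] -/
private theorem smul_div_eq_of_pow_eq (hn : 0 < n)
    (hμ : ∀ g ∈ galFixing k E, ∀ ζ : MuCarrier k n, mu k n g ζ = ζ)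
    {α β : (AlgebraicClosure k)ˣ} (h : α ^ n = β ^ n) {m : absoluteGaloisGroup k}
    (hm : m ∈ galFixing k E) : m • α / α = m • β / β := by
  have hζ : (α / β) ^ n = 1 := by rw [div_pow, h, div_self']
  let ζ : rootsOfUnity n (AlgebraicClosure k) := ⟨α / β, (mem_rootsOfUnity _ _).2 hζ⟩
  have hfix : m • (α / β) = α / β := by
    have h1 := congrArg (fun v => muVal k n v) (hμ m hm (MuCarrier.ofRootsOfUnity ζ))
    rw [muVal_apply, muVal_ofRootsOfUnity] at h1
    exact h1
  have _ := hn
  have h2 : m • α / m • β = α / β := by rw [← smul_div', hfix]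
  rw [div_eq_div_iff_mul_eq_mul] at h2 ⊢
  rw [h2, mul_comm]

set_option synthInstance.maxHeartbeats 200000 in
/-- The `k̄`-value of the Galois action on `Eˣ` through `Gal(E/k)`:
`((resGal E g) • u : k̄) = g • (u : k̄)`. [folklore] -/
private theorem coe_resGal_smul_units [Normal k E] (g : absoluteGaloisGroup k) (u : (↥E)ˣ) :
    (((resGal E g • u : (↥E)ˣ) : E) : AlgebraicClosure k) = g • ((u : E) : AlgebraicClosure k) :=
  coe_resGal_apply E g (u : E)

/-- `n`-th roots in `k̄ˣ` of units of `E`. [folklore] -/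
private theorem exists_root (hn : 0 < n) (u : (↥E)ˣ) :
    ∃ α : (AlgebraicClosure k)ˣ, (α : AlgebraicClosure k) ^ n = ((u : E) : AlgebraicClosure k) := by
  obtain ⟨z, hz⟩ := IsAlgClosed.exists_pow_nat_eq (((u : E) : AlgebraicClosure k)) hn
  have hz0 : z ≠ 0 := by
    rintro rfl
    rw [zero_pow hn.ne'] at hz
    have h0 : ((u : E) : AlgebraicClosure k) = 0 := hz.symm
    exact Units.ne_zero u (by exact_mod_cast h0)
  exact ⟨Units.mk0 z hz0, hz⟩

/-- For `α ∈ k̄ˣ` with `αⁿ ∈ E`, `αⁿ` is fixed by `Gal(k̄/E)`. [folklore] -/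
private theorem pow_fixed_of_pow_eq (α : (AlgebraicClosure k)ˣ) (u : (↥E)ˣ)
    (hα : (α : AlgebraicClosure k) ^ n = ((u : E) : AlgebraicClosure k)) :
    ∀ g ∈ galFixing k E, g • α ^ n = α ^ n := fun g hg =>
  Units.ext (by
    rw [Units.coe_smul, Units.val_pow_eq_pow_val, hα]
    exact (mem_galFixing_iff k).1 hg _ (u : E).2)

/-- **A Kummer cocycle for each unit of `E`**: for `u ∈ Eˣ` there is a continuous cocycle `φ` of
`Gal(k̄/E)` with values `φ(m) = m(α)/α` for EVERY `n`-th root `α` of `u` (the choice of root does not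
matter because `μₙ` is fixed by `Gal(k̄/E)`). [cite: SerreLocalFields1979, X §3] -/
theorem exists_cocycle_units (hn : 0 < n)
    (hμ : ∀ g ∈ galFixing k E, ∀ ζ : MuCarrier k n, mu k n g ζ = ζ) (u : (↥E)ˣ) :
    ∃ φ : contOneCocycles (subgroupRep (mu k n).toTopRep (galFixing k E)),
      ∀ α : (AlgebraicClosure k)ˣ, (α : AlgebraicClosure k) ^ n = ((u : E) : AlgebraicClosure k) →
        ∀ m : galFixing k E, muVal k n (φ.1 m) = (m : absoluteGaloisGroup k) • α / α := by
  obtain ⟨α₀, hα₀⟩ := exists_root k n E hn u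
  obtain ⟨φ, hφ⟩ := exists_cocycle k n E α₀ (pow_fixed_of_pow_eq k n E α₀ u hα₀)
  refine ⟨φ, fun α hα m => ?_⟩
  rw [hφ]
  refine smul_div_eq_of_pow_eq k n E hn hμ (Units.ext ?_) m.2
  rw [Units.val_pow_eq_pow_val, Units.val_pow_eq_pow_val, hα₀, hα]

section Family

variable {k n E}
variable (Φ : (↥E)ˣ → contOneCocycles (subgroupRep (mu k n).toTopRep (galFixing k E)))
  (hΦ : ∀ (u : (↥E)ˣ) (α : (AlgebraicClosure k)ˣ),
    (α : AlgebraicClosure k) ^ n = ((u : E) : AlgebraicClosure k) →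
    ∀ m : galFixing k E, muVal k n ((Φ u).1 m) = (m : absoluteGaloisGroup k) • α / α)
include hΦ

/-- A family of Kummer cocycles `u ↦ (m ↦ m(ⁿ√u)/ⁿ√u)` is multiplicative. [folklore] -/
private theorem family_mul (hn : 0 < n) (u v : (↥E)ˣ) : Φ (u * v) = Φ u + Φ v := by
  obtain ⟨α, hα⟩ := exists_root k n E hn u
  obtain ⟨β, hβ⟩ := exists_root k n E hn v
  refine cocycle_eq_of_muVal_eq k n E fun m => ?_
  have hαβ : ((α * β : (AlgebraicClosure k)ˣ) : AlgebraicClosure k) ^ n =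
      (((u * v : (↥E)ˣ) : E) : AlgebraicClosure k) := by
    rw [Units.val_mul, mul_pow, hα, hβ, Units.val_mul]; rfl
  rw [hΦ (u * v) (α * β) hαβ m, smul_div_mul]
  change _ = muVal k n ((Φ u).1 m + (Φ v).1 m)
  rw [muVal_add, hΦ u α hα m, hΦ v β hβ m]

/-- A family of Kummer cocycles vanishes on `n`-th powers. [folklore] -/
private theorem family_pow (w : (↥E)ˣ) : Φ (w ^ n) = 0 := by
  refine cocycle_eq_of_muVal_eq k n E fun m => ?_
  have hw0 : ((w : E) : AlgebraicClosure k) ≠ 0 := by exact_mod_cast Units.ne_zero w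
  have hroot : ((Units.mk0 _ hw0 : (AlgebraicClosure k)ˣ) : AlgebraicClosure k) ^ n =
      (((w ^ n : (↥E)ˣ) : E) : AlgebraicClosure k) := by
    rw [Units.val_mk0, Units.val_pow_eq_pow_val]; rfl
  rw [hΦ _ _ hroot m]
  have hfix : (m : absoluteGaloisGroup k) • (Units.mk0 _ hw0 : (AlgebraicClosure k)ˣ) = Units.mk0 _ hw0 :=
    Units.ext (by rw [Units.coe_smul, Units.val_mk0]; exact (mem_galFixing_iff k).1 m.2 _ (w : E).2)
  rw [hfix, div_self']
  rfl

/-- A family of Kummer cocycles has kernel exactly the `n`-th powers (characteristic `0`: a trivial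
cocycle means `ⁿ√u ∈ E` by the Galois correspondence). [cite: SerreLocalFields1979, X §3] -/
theorem family_eq_zero_iff [CharZero k] (hn : 0 < n) (u : (↥E)ˣ) :
    Φ u = 0 ↔ ∃ w : (↥E)ˣ, w ^ n = u := by
  constructor
  · intro hu
    obtain ⟨α, hα⟩ := exists_root k n E hn u
    have hmem : ((α : (AlgebraicClosure k)ˣ) : AlgebraicClosure k) ∈ E := by
      rw [← forall_smul_div_eq_one_iff_mem]
      intro g
      have h := hΦ u α hα g
      rw [hu] at h
      change muVal k n 0 = _ at h
      rw [muVal_zero] at h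
      exact h.symm
    have hw0 : (⟨_, hmem⟩ : E) ≠ 0 := by
      intro h
      exact Units.ne_zero α (congrArg (fun z : E => (z : AlgebraicClosure k)) h)
    refine ⟨Units.mk0 _ hw0, Units.ext (Subtype.ext ?_)⟩
    change ((α : (AlgebraicClosure k)ˣ) : AlgebraicClosure k) ^ n = ((u : E) : AlgebraicClosure k)
    exact hα
  · rintro ⟨w, rfl⟩
    exact family_pow Φ hΦ w

/-- A family of Kummer cocycles is onto the continuous cocycles (Hilbert 90 for `Gal(k̄/E)`).
[cite: SerreLocalFields1979, X §1 Prop. 2, X §3] -/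
theorem family_surjective [CharZero k] : Surjective Φ := by
  intro φ
  obtain ⟨α, hαN, hαφ⟩ := exists_eq_smul_div k n E φ
  have hmem : ((α ^ n : (AlgebraicClosure k)ˣ) : AlgebraicClosure k) ∈ E := by
    rw [← forall_smul_eq_iff_mem]
    intro g hg
    have := congrArg Units.val (hαN g hg)
    rwa [Units.coe_smul] at this
  have hw0 : (⟨_, hmem⟩ : E) ≠ 0 := by
    intro h
    exact Units.ne_zero (α ^ n) (congrArg (fun z : E => (z : AlgebraicClosure k)) h)
  refine ⟨Units.mk0 _ hw0, cocycle_eq_of_muVal_eq k n E fun m => ?_⟩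
  rw [hΦ (Units.mk0 _ hw0) α (Units.val_pow_eq_pow_val α n).symm m, hαφ]

set_option synthInstance.maxHeartbeats 200000 in
/-- A family of Kummer cocycles is `Γ_k`-equivariant for `E/k` normal: the cocycle of `g(u)` is the
conjugate `m ↦ g φ(g⁻¹ m g)` of the cocycle `φ` of `u`. [cite: MilneADT2006, I §2 proof of Thm 2.8] -/
theorem family_smul [Normal k E] [(galFixing k E).Normal] (hn : 0 < n) (g : absoluteGaloisGroup k)
    (u : (↥E)ˣ) :
    Φ (resGal E g • u) = contOneCocycles.pullback (subgroupConj (galFixing k E) g)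
      (conjRepHom (mu k n).toTopRep (galFixing k E) g) (Φ u) := by
  obtain ⟨α, hα⟩ := exists_root k n E hn u
  refine cocycle_eq_of_muVal_eq k n E fun m => ?_
  have hroot : ((g • α : (AlgebraicClosure k)ˣ) : AlgebraicClosure k) ^ n =
      (((resGal E g • u : (↥E)ˣ) : E) : AlgebraicClosure k) := by
    rw [coe_resGal_smul_units, Units.coe_smul, ← smul_pow', hα]
  rw [hΦ _ _ hroot m, muVal_conj_pullback k n E (Φ u) α (hΦ u α hα) g m]

/-- A family of Kummer cocycles descends to a bijective additive map `Eˣ/Eˣⁿ → Z¹_cont(N, μₙ)`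
(characteristic `0`). [cite: SerreLocalFields1979, X §3] -/
theorem family_exists_bijective [CharZero k] (hn : 0 < n) :
    ∃ Ψ : (Additive (↥E)ˣ ⧸ LinearMap.range (LinearMap.lsmul ℤ (Additive (↥E)ˣ) n)) →+
        contOneCocycles (subgroupRep (mu k n).toTopRep (galFixing k E)),
      Bijective Ψ ∧ ∀ u : (↥E)ˣ, Ψ (Submodule.Quotient.mk (Additive.ofMul u)) = Φ u := by
  set P : Submodule ℤ (Additive (↥E)ˣ) := LinearMap.range (LinearMap.lsmul ℤ (Additive (↥E)ˣ) n)
    with hP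
  -- the additive map on `Additive Eˣ`
  obtain ⟨Ψ₀, hΨ₀⟩ : ∃ Ψ₀ : Additive (↥E)ˣ →+ contOneCocycles (subgroupRep (mu k n).toTopRep (galFixing k E)),
      ∀ x, Ψ₀ x = Φ (Additive.toMul x) :=
    ⟨AddMonoidHom.mk' (fun x => Φ (Additive.toMul x)) fun x y => by
      rw [toMul_add, family_mul Φ hΦ hn], fun x => rfl⟩
  have hker : P ≤ LinearMap.ker Ψ₀.toIntLinearMap := by
    rintro _ ⟨x, rfl⟩
    rw [LinearMap.mem_ker, LinearMap.lsmul_apply, AddMonoidHom.coe_toIntLinearMap, hΨ₀, toMul_zsmul,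
      zpow_natCast, family_pow Φ hΦ]
  -- its descent to the quotient
  obtain ⟨Ψ₁, hΨ₁⟩ : ∃ Ψ₁ : (Additive (↥E)ˣ ⧸ P) →+ contOneCocycles (subgroupRep (mu k n).toTopRep (galFixing k E)),
      ∀ u : (↥E)ˣ, Ψ₁ (Submodule.Quotient.mk (Additive.ofMul u)) = Φ u :=
    ⟨(P.liftQ Ψ₀.toIntLinearMap hker).toAddMonoidHom, fun u => by
      rw [LinearMap.toAddMonoidHom_coe, Submodule.liftQ_apply, AddMonoidHom.coe_toIntLinearMap, hΨ₀,
        toMul_ofMul]⟩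
  have hΨ₁' : ∀ x : Additive (↥E)ˣ, Ψ₁ (Submodule.Quotient.mk x) = Φ (Additive.toMul x) := fun x =>
    hΨ₁ (Additive.toMul x)
  refine ⟨Ψ₁, ⟨?_, fun φ => ?_⟩, hΨ₁⟩
  · rw [injective_iff_map_eq_zero]
    intro x hx
    induction x using Submodule.Quotient.induction_on with
    | H x =>
    rw [hΨ₁'] at hx
    obtain ⟨w, hw⟩ := (family_eq_zero_iff Φ hΦ hn _).1 hx
    rw [Submodule.Quotient.mk_eq_zero]
    refine ⟨Additive.ofMul w, ?_⟩
    rw [LinearMap.lsmul_apply]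
    change Additive.ofMul (w ^ (n : ℤ)) = x
    rw [zpow_natCast, hw]
    rfl
  · obtain ⟨u, hu⟩ := family_surjective Φ hΦ φ
    exact ⟨Submodule.Quotient.mk (Additive.ofMul u), (hΨ₁ u).trans hu⟩

end Family

set_option maxHeartbeats 1000000 in
set_option synthInstance.maxHeartbeats 200000 in
/-- **The equivariant Kummer isomorphism for the subgroup `Gal(k̄/E)`.**  For `k` of characteristic
`0`, `n ≥ 1`, `E/k` normal inside `k̄` with `μₙ(k̄)` fixed by `N = Gal(k̄/E)`: a BIJECTIVE additive
map `Ψ : Eˣ/Eˣⁿ → Z¹_cont(N, μₙ)` with `Ψ(u)(m) = m(α)/α` whenever `αⁿ = u`, and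
`Ψ(g·x) = g·Ψ(x)` for `g ∈ Γ_k` (`Γ_k` acting on `Eˣ` through `Gal(E/k)` and on cocycles by
conjugation).  Injectivity: a trivial cocycle means `α ∈ E` (Galois correspondence); surjectivity:
Hilbert 90 for `N`.  (Stated with `→+` and `Bijective`, not `≃ₗ[ℤ]`: the two `ℤ`-module structures
on a submodule quotient are only propositionally cheap to identify.)
[cite: MilneADT2006, I §2 proof of Thm 2.8 (p. 34)] [cite: SerreLocalFields1979, X §3] -/
theorem exists_equivariant_bijective [CharZero k] (hn : 0 < n) [Normal k E] [(galFixing k E).Normal]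
    (hμ : ∀ g ∈ galFixing k E, ∀ ζ : MuCarrier k n, mu k n g ζ = ζ) :
    ∃ Ψ : (Additive (↥E)ˣ ⧸ LinearMap.range (LinearMap.lsmul ℤ (Additive (↥E)ˣ) n)) →+
        contOneCocycles (subgroupRep (mu k n).toTopRep (galFixing k E)),
      Bijective Ψ ∧
      (∀ (u : (↥E)ˣ) (α : (AlgebraicClosure k)ˣ),
          (α : AlgebraicClosure k) ^ n = ((u : E) : AlgebraicClosure k) →
        ∀ m : galFixing k E,
          muVal k n ((Ψ (Submodule.Quotient.mk (Additive.ofMul u))).1 m) =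
            (m : absoluteGaloisGroup k) • α / α) ∧
      (∀ (g : absoluteGaloisGroup k) (x : Additive (↥E)ˣ ⧸ LinearMap.range (LinearMap.lsmul ℤ (Additive (↥E)ˣ) n)),
        Ψ (Representation.quotient
            ((Representation.ofMulDistribMulAction (↥E ≃ₐ[k] ↥E) (↥E)ˣ).comp (resGal E)) _
            (ModPRepCount.range_lsmul_le_comap
              ((Representation.ofMulDistribMulAction (↥E ≃ₐ[k] ↥E) (↥E)ˣ).comp (resGal E)) n) g x) =
          contOneCocycles.pullback (subgroupConj (galFixing k E) g)
            (conjRepHom (mu k n).toTopRep (galFixing k E) g) (Ψ x)) := by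
  set ρU : Representation ℤ (absoluteGaloisGroup k) (Additive (↥E)ˣ) :=
    (Representation.ofMulDistribMulAction (↥E ≃ₐ[k] ↥E) (↥E)ˣ).comp (resGal E) with hρU
  set P : Submodule ℤ (Additive (↥E)ˣ) := LinearMap.range (LinearMap.lsmul ℤ (Additive (↥E)ˣ) n)
    with hP
  have hquot : ∀ (g : absoluteGaloisGroup k) (x : Additive (↥E)ˣ),
      Representation.quotient ρU P (ModPRepCount.range_lsmul_le_comap ρU n) g (Submodule.Quotient.mk x) =
        Submodule.Quotient.mk (ρU g x) := fun g x => by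
    rw [Representation.quotient_apply, Submodule.mapQ_apply]
  have hρUg : ∀ (g : absoluteGaloisGroup k) (x : Additive (↥E)ˣ),
      ρU g x = Additive.ofMul (resGal E g • Additive.toMul x) := fun g x => by
    rw [hρU, MonoidHom.comp_apply, Representation.ofMulDistribMulAction_apply_apply]
  -- the family of Kummer cocycles and its descent
  choose Φ hΦ using exists_cocycle_units k n E hn hμ
  obtain ⟨Ψ, hbij, hΨ⟩ := family_exists_bijective Φ hΦ hn
  refine ⟨Ψ, hbij, fun u α hα m => ?_, fun g x => ?_⟩
  · rw [hΨ]
    exact hΦ u α hα m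
  · induction x using Submodule.Quotient.induction_on with
    | H x =>
    have h2 : Ψ (Submodule.Quotient.mk x) = Φ (Additive.toMul x) := hΨ (Additive.toMul x)
    rw [hquot, hρUg, hΨ, h2, family_smul Φ hΦ hn]

end KummerSubgroup

end Literature.NumberTheory.GaloisRepresentations.LocalEPC

end Part4

/-!
## Part 5 — port of `Summits/BirchSwinnertonDyer/Rank1Residual/GaloisImage/RootsOfUnityTorsionUnits.lean`

# `μₙ(k̄) ≃ Eˣ[n]` as `Γ_k`-modules when `μₙ ⊆ E`
# (cell `b2b-bsdres`, team n1011, row T-EPC = Tate's local Euler–Poincaré characteristic; seat p04 GEN 8; stage C4d)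

HONEST FRAMING (cell `b2b-bsdres`, run/shared/lean/b2b/bsd-rank1-residual/, verbatim in every
file): the goal of the cell is to DELETE the COMBINATION-SHAPED residual classes of the
Birch–Swinnerton-Dyer formula for ALL analytic-rank `≤ 1` elliptic curves over `ℚ` — "full BSD
formula for every rank `≤ 1` curve in class `C`" assembled STRICTLY from published theorems — so
that the rank-`≤ 1` remainder becomes exactly the CONSTRUCTION-SHAPED classes, which are TYPED
(missing-input `Prop`s), NOT attempted. This is not "finishing BSD". Team n1011 (N10 / N11, the
additive block X4 ∧ `p = 3`): research route; no claim beyond the stated classes; nothing is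
booked; no mark / label is changed by this file. Theorems only (no definition, no named fact, no
`sorry`); TOOL theorems of Galois theory.  (Placement: Summits/GaloisImage with the T-EPC cone.)

## What

For `k` of characteristic `0`, `n`, and a normal subextension `E ⊆ k̄` whose fixing group
`Gal(k̄/E)` acts trivially on `μₙ(k̄)`: the roots of unity lie in `E` (Galois correspondence) and
`ζ ↦ ζ` is an isomorphism of `Γ_k`-modules between the tree's `μₙ = DiscreteGaloisModule.mu k n` and
the `n`-torsion `Eˣ[n]` of the `Gal(E/k)`-module `Eˣ` of stages B1–B7 (the subrepresentation
`ker (n : Additive Eˣ → Additive Eˣ)` of `Representation.ofMulDistribMulAction (E ≃ₐ[k] E) Eˣ`),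
pulled back to `Γ_k` along `resGal E`:

* `KummerSubgroup.muVal_mem` — `μₙ(k̄) ⊆ E`;
* `KummerSubgroup.nonempty_equiv_mu_torsionUnits` — the equivalence of representations.

This identifies the factor `#Hom_Δ(Z, Eˣ[p])` of Milne's Lemma 2.11 (stage B7) with `#Hom_Γ(Z, μ_p)`.

References: J. S. Milne, *Arithmetic Duality Theorems* (2006), I §2 proof of Thm. 2.8
[MilneADT2006]; J.-P. Serre, *Local Fields* (1979), X §3 [SerreLocalFields1979].
-/

section Part5


open _root_.Function _root_.Field
open Literature.NumberTheory.GaloisRepresentations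
open Literature.NumberTheory.GaloisRepresentations.DiscreteGaloisModule
open Literature.NumberTheory.GaloisRepresentations.LocalWeilDatum (galFixing mem_galFixing_iff)

universe u

namespace Literature.NumberTheory.GaloisRepresentations.LocalEPC

namespace KummerSubgroup

variable (k : Type u) [Field k] (n : ℕ) (E : IntermediateField k (AlgebraicClosure k))

/-- **`μₙ(k̄) ⊆ E`** when `Gal(k̄/E)` fixes `μₙ(k̄)` (characteristic `0`, Galois correspondence).
[folklore] -/
private theorem muVal_mem [CharZero k] (hμ : ∀ g ∈ galFixing k E, ∀ ζ : MuCarrier k n, mu k n g ζ = ζ)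
    (ζ : MuCarrier k n) : ((muVal k n ζ : (AlgebraicClosure k)ˣ) : AlgebraicClosure k) ∈ E := by
  rw [← forall_smul_eq_iff_mem]
  intro g hg
  have h := congrArg (fun v => ((muVal k n v : (AlgebraicClosure k)ˣ) : AlgebraicClosure k)) (hμ g hg ζ)
  simp only [muVal_apply, Units.coe_smul] at h
  exact h

/-- The unit of `E` underlying a root of unity, and its properties (value, `n`-torsion).
[folklore] -/
private theorem exists_units_of_mu [CharZero k] (hμ : ∀ g ∈ galFixing k E, ∀ ζ : MuCarrier k n, mu k n g ζ = ζ) :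
    ∃ ι : MuCarrier k n →+ Additive (↥E)ˣ,
      (∀ ζ, (((Additive.toMul (ι ζ) : (↥E)ˣ) : E) : AlgebraicClosure k) = muVal k n ζ) ∧
      Injective ι ∧
      (∀ ζ, ι ζ ∈ LinearMap.ker (LinearMap.lsmul ℤ (Additive (↥E)ˣ) n)) ∧
      (∀ x ∈ LinearMap.ker (LinearMap.lsmul ℤ (Additive (↥E)ˣ) n), ∃ ζ, ι ζ = x) := by
  have hne : ∀ ζ : MuCarrier k n, (⟨_, muVal_mem k n E hμ ζ⟩ : E) ≠ 0 := fun ζ h =>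
    Units.ne_zero (muVal k n ζ) (congrArg (fun z : E => (z : AlgebraicClosure k)) h)
  let u : MuCarrier k n → (↥E)ˣ := fun ζ => Units.mk0 _ (hne ζ)
  have hu : ∀ ζ, (((u ζ : (↥E)ˣ) : E) : AlgebraicClosure k) = muVal k n ζ := fun ζ => rfl
  have hu_inj : ∀ ζ ζ', u ζ = u ζ' → ζ = ζ' := fun ζ ζ' h =>
    muVal_injective k n (Units.ext (by rw [← hu, ← hu, h]))
  have hu_mul : ∀ ζ ζ', u (ζ + ζ') = u ζ * u ζ' := fun ζ ζ' =>
    Units.ext (Subtype.ext (by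
      change (((u (ζ + ζ') : (↥E)ˣ) : E) : AlgebraicClosure k) = ((u ζ : E) : AlgebraicClosure k) * ((u ζ' : E) : AlgebraicClosure k)
      rw [hu, hu, hu, muVal_add, Units.val_mul]))
  let ι : MuCarrier k n →+ Additive (↥E)ˣ :=
    { toFun := fun ζ => Additive.ofMul (u ζ)
      map_zero' := by
        have h : u 0 = 1 := Units.ext (Subtype.ext (by
          rw [hu, muVal_zero, Units.val_one]; rfl))
        rw [h]; rfl
      map_add' := fun ζ ζ' => by rw [hu_mul]; rfl }
  have hι : ∀ ζ, Additive.toMul (ι ζ) = u ζ := fun ζ => rfl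
  refine ⟨ι, fun ζ => hu ζ, fun ζ ζ' h => hu_inj ζ ζ' (by rw [← hι, ← hι, h]), fun ζ => ?_, fun x hx => ?_⟩
  · rw [LinearMap.mem_ker, LinearMap.lsmul_apply, natCast_zsmul]
    change Additive.ofMul ((u ζ) ^ n) = Additive.ofMul 1
    refine congrArg Additive.ofMul (Units.ext (Subtype.ext ?_))
    rw [Units.val_pow_eq_pow_val, IntermediateField.coe_pow, hu, ← Units.val_pow_eq_pow_val, muVal_pow_eq_one,
      Units.val_one]
    rfl
  · rw [LinearMap.mem_ker, LinearMap.lsmul_apply, natCast_zsmul] at hx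
    have hxn : (Additive.toMul x) ^ n = 1 := by
      rw [← toMul_nsmul, hx, toMul_zero]
    -- the root of unity in `k̄`
    have hval : (Units.map (algebraMap (↥E) (AlgebraicClosure k)).toMonoidHom (Additive.toMul x)) ^ n = 1 := by
      rw [← map_pow, hxn, map_one]
    let ζ : rootsOfUnity n (AlgebraicClosure k) := ⟨_, (mem_rootsOfUnity _ _).2 hval⟩
    refine ⟨MuCarrier.ofRootsOfUnity ζ, ?_⟩
    change Additive.ofMul (u (MuCarrier.ofRootsOfUnity ζ)) = x
    rw [← ofMul_toMul x]
    refine congrArg Additive.ofMul (Units.ext (Subtype.ext ?_))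
    rw [hu, muVal_ofRootsOfUnity]
    rfl

/-- **`μₙ(k̄) ≃ Eˣ[n]` as `Γ_k`-representations** (`E/k` normal inside `k̄`, `Gal(k̄/E)` fixing
`μₙ(k̄)`, characteristic `0`): `ζ ↦ ζ ∈ Eˣ` identifies the tree's Galois module `μₙ` with the
`n`-torsion subrepresentation of `Additive Eˣ` under `Gal(E/k)`, pulled back along `Γ_k → Gal(E/k)`.
[cite: MilneADT2006, I §2 proof of Thm 2.8 (p. 34)] [cite: SerreLocalFields1979, X §3] -/
theorem nonempty_equiv_mu_torsionUnits [CharZero k] [Normal k E]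
    (hμ : ∀ g ∈ galFixing k E, ∀ ζ : MuCarrier k n, mu k n g ζ = ζ) :
    Nonempty ((mu k n).toRepresentation.Equiv
      ((((Representation.ofMulDistribMulAction (↥E ≃ₐ[k] ↥E) (↥E)ˣ).subrepresentation _
          (ModPRepCount.ker_lsmul_le_comap
            (Representation.ofMulDistribMulAction (↥E ≃ₐ[k] ↥E) (↥E)ˣ) n))).comp (resGal E))) := by
  classical
  set ρU := Representation.ofMulDistribMulAction (↥E ≃ₐ[k] ↥E) (↥E)ˣ with hρU
  set T := LinearMap.ker (LinearMap.lsmul ℤ (Additive (↥E)ˣ) n) with hT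
  obtain ⟨ι, hιval, hιinj, hιmem, hιsurj⟩ := exists_units_of_mu k n E hμ
  -- the bijection onto `T`
  let e₀ : MuCarrier k n → T := fun ζ => ⟨ι ζ, hιmem ζ⟩
  have he₀ : ∀ ζ, ((e₀ ζ : T) : Additive (↥E)ˣ) = ι ζ := fun ζ => rfl
  have hbij : Bijective e₀ := by
    refine ⟨fun ζ ζ' h => hιinj (by rw [← he₀, ← he₀, h]), fun x => ?_⟩
    obtain ⟨ζ, hζ⟩ := hιsurj x.1 x.2
    exact ⟨ζ, Subtype.ext hζ⟩
  let e₁ := Equiv.ofBijective e₀ hbij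
  have he₁ : ∀ ζ, ((e₁ ζ : T) : Additive (↥E)ˣ) = ι ζ := fun ζ => rfl
  have hadd : ∀ ζ ζ', e₁ (ζ + ζ') = e₁ ζ + e₁ ζ' := fun ζ ζ' =>
    Subtype.ext (by rw [Submodule.coe_add, he₁, he₁, he₁, map_add])
  -- equivariance on values in `k̄`
  have hequiv : ∀ (g : absoluteGaloisGroup k) (ζ : MuCarrier k n),
      e₁ ((mu k n) g ζ) = (ρU.subrepresentation T (ModPRepCount.ker_lsmul_le_comap ρU n)) (resGal E g) (e₁ ζ) := by
    intro g ζ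
    apply Subtype.ext
    rw [he₁, Representation.subrepresentation_apply]
    change ι ((mu k n) g ζ) = ρU (resGal E g) (ι ζ)
    rw [hρU, Representation.ofMulDistribMulAction_apply_apply, ← ofMul_toMul (ι ((mu k n) g ζ))]
    refine congrArg Additive.ofMul (Units.ext (Subtype.ext ?_))
    rw [hιval, coe_resGal_smul_units, hιval, muVal_apply, Units.coe_smul]
  refine ⟨Representation.Equiv.mk
    { toFun := e₁
      invFun := e₁.symm
      map_add' := hadd
      map_smul' := fun c ζ => ?_
      left_inv := e₁.symm_apply_apply
      right_inv := e₁.apply_symm_apply } fun g => LinearMap.ext fun ζ => hequiv g ζ⟩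
  -- `ℤ`-linearity from additivity
  have h := map_zsmul (AddMonoidHom.mk' e₁ hadd) c ζ
  change e₁ (c • ζ) = c • e₁ ζ
  exact h

end KummerSubgroup

end Literature.NumberTheory.GaloisRepresentations.LocalEPC

end Part5

/-!
## Part 6 — port of `Summits/BirchSwinnertonDyer/Rank1Residual/GaloisImage/EPCRepresentationGlue.lean`

# Representation-theoretic glue for the tame-layer Euler–Poincaré characteristic
# (cell `b2b-bsdres`, team n1011, row T-EPC = Tate's local Euler–Poincaré characteristic; seat p04 GEN 8; stage C4a)

HONEST FRAMING (cell `b2b-bsdres`, run/shared/lean/b2b/bsd-rank1-residual/, verbatim in every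
file): the goal of the cell is to DELETE the COMBINATION-SHAPED residual classes of the
Birch–Swinnerton-Dyer formula for ALL analytic-rank `≤ 1` elliptic curves over `ℚ` — "full BSD
formula for every rank `≤ 1` curve in class `C`" assembled STRICTLY from published theorems — so
that the rank-`≤ 1` remainder becomes exactly the CONSTRUCTION-SHAPED classes, which are TYPED
(missing-input `Prop`s), NOT attempted. This is not "finishing BSD". Team n1011 (N10 / N11, the
additive block X4 ∧ `p = 3`): research route; no claim beyond the stated classes; nothing is
booked; no mark / label is changed by this file. Theorems only (no definition, no named fact, no
`sorry`); TOOL theorems (bookkeeping of representations).  (Placement: Summits/GaloisImage with the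
T-EPC cone.)

## What

Bookkeeping used to plug stages C1–C3 (cohomology of the tame subgroup) into stage B7 (Milne's
Lemma 2.11, which is stated for the finite group `Gal(E/K)`), all elementary:

* `EPCGlue.natCard_invariantCocycles_congr` — the number of `G`-invariant continuous `1`-cocycles of
  a normal subgroup `N` is invariant under isomorphisms of topological `G`-modules (used with the
  tree's `biDualIso : M ≅ M^{DD}`);
* `EPCGlue.natCard_intertwiningMap_congr_of_eq` — `#Hom_G` only depends on the actions as functions;
* `EPCGlue.natCard_intertwiningMap_comp_of_surjective`, `exists_representation_comp_eq`,
  `natCard_invariants_comp_of_surjective` — representations trivial on `ker π` descend along a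
  surjection `π : G → H`, with the same intertwining maps and invariants;
* `EPCGlue.natCard_intertwiningMap_eq_natCard_invariants_homRep` —
  `#Hom_G(Z, Ω) = #(Hom(Z, Ω))^G` for the tree's dual module `homRep`.

References: J. S. Milne, *Arithmetic Duality Theorems* (2006), I §0, I §2 [MilneADT2006];
J.-P. Serre, *Local Fields* (1979), VII §5 [SerreLocalFields1979].
-/

section Part6


open _root_.CategoryTheory _root_.Function
open Literature.NumberTheory.GaloisRepresentations
open Literature.NumberTheory.EllipticCurves (subgroupConj subgroupConj_apply_coe)

universe u

namespace Literature.NumberTheory.GaloisRepresentations.LocalEPC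

namespace EPCGlue

/-! ### Invariant cocycles along an isomorphism of topological modules -/

section Cocycles

variable {G : Type u} [Group G] [TopologicalSpace G] [IsTopologicalGroup G]
variable (N : Subgroup G) [N.Normal]
variable {M₁ : Type u} [AddCommGroup M₁] [TopologicalSpace M₁] [DiscreteTopology M₁]
variable {M₂ : Type u} [AddCommGroup M₂] [TopologicalSpace M₂] [DiscreteTopology M₂]
variable {ρ₁ : ContinuousRep G ℤ M₁} {ρ₂ : ContinuousRep G ℤ M₂}

omit [IsTopologicalGroup G] [N.Normal] in
/-- Push-forward of a continuous cocycle of `N` along a morphism of topological `G`-modules.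
[folklore] -/
private theorem exists_map_cocycle (f : ρ₁.toTopRep ⟶ ρ₂.toTopRep)
    (φ : contOneCocycles (subgroupRep ρ₁.toTopRep N)) :
    ∃ ψ : contOneCocycles (subgroupRep ρ₂.toTopRep N), ∀ m : N, ψ.1 m = f.hom (φ.1 m) := by
  refine ⟨⟨(f.hom : C(M₁, M₂)).comp φ.1, fun m m' => ?_⟩, fun m => rfl⟩
  change f.hom (φ.1 (m * m')) = f.hom (φ.1 m) + ρ₂ (m : G) (f.hom (φ.1 m'))
  rw [φ.2 m m', map_add, subgroupRep_ρ_apply]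
  change f.hom (φ.1 m) + f.hom (ρ₁ (m : G) (φ.1 m')) = _
  rw [ContinuousRep.hom_comm_apply]

/-- **`#{G-invariant cocycles of N}` is invariant under isomorphisms of topological `G`-modules.**
[folklore] -/
private theorem natCard_invariantCocycles_congr (e : ρ₁.toTopRep ≅ ρ₂.toTopRep) :
    Nat.card {φ : contOneCocycles (subgroupRep ρ₁.toTopRep N) //
        ∀ g : G, contOneCocycles.pullback (subgroupConj N g) (conjRepHom ρ₁.toTopRep N g) φ = φ} =
      Nat.card {φ : contOneCocycles (subgroupRep ρ₂.toTopRep N) //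
        ∀ g : G, contOneCocycles.pullback (subgroupConj N g) (conjRepHom ρ₂.toTopRep N g) φ = φ} := by
  classical
  choose F hF using exists_map_cocycle N e.hom
  choose B hB using exists_map_cocycle N e.inv
  have hBF : ∀ φ, B (F φ) = φ := fun φ => by
    apply Subtype.ext; ext m
    rw [hB, hF, ← TopRep.comp_apply, e.hom_inv_id, TopRep.id_apply]
  have hFB : ∀ ψ, F (B ψ) = ψ := fun ψ => by
    apply Subtype.ext; ext m
    rw [hF, hB, ← TopRep.comp_apply, e.inv_hom_id, TopRep.id_apply]
  -- compatibility with conjugation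
  have hconjF : ∀ (g : G) (φ : contOneCocycles (subgroupRep ρ₁.toTopRep N)),
      contOneCocycles.pullback (subgroupConj N g) (conjRepHom ρ₂.toTopRep N g) (F φ) =
        F (contOneCocycles.pullback (subgroupConj N g) (conjRepHom ρ₁.toTopRep N g) φ) := fun g φ => by
    apply Subtype.ext; ext m
    rw [conj_pullback_apply, hF, hF, conj_pullback_apply]
    change ρ₂ g (e.hom.hom _) = e.hom.hom (ρ₁ g _)
    rw [ContinuousRep.hom_comm_apply]
  have hconjB : ∀ (g : G) (ψ : contOneCocycles (subgroupRep ρ₂.toTopRep N)),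
      contOneCocycles.pullback (subgroupConj N g) (conjRepHom ρ₁.toTopRep N g) (B ψ) =
        B (contOneCocycles.pullback (subgroupConj N g) (conjRepHom ρ₂.toTopRep N g) ψ) := fun g ψ => by
    apply Subtype.ext; ext m
    rw [conj_pullback_apply, hB, hB, conj_pullback_apply]
    change ρ₁ g (e.inv.hom _) = e.inv.hom (ρ₂ g _)
    rw [ContinuousRep.hom_comm_apply]
  refine Nat.card_congr
    { toFun := fun φ => ⟨F φ.1, fun g => by rw [hconjF, φ.2 g]⟩
      invFun := fun ψ => ⟨B ψ.1, fun g => by rw [hconjB, ψ.2 g]⟩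
      left_inv := fun φ => Subtype.ext (hBF φ.1)
      right_inv := fun ψ => Subtype.ext (hFB ψ.1) }

end Cocycles

/-! ### Intertwining maps and invariants only depend on the actions -/

section Intertwining

variable {G : Type*} [Group G]
variable {Z : Type*} [AddCommGroup Z] [Module ℤ Z] {Y : Type*} [AddCommGroup Y] [Module ℤ Y]

/-- `#Hom_G(Z, Y)` only depends on the actions as functions. [folklore] -/
private theorem natCard_intertwiningMap_congr_of_eq {σ₁ σ₂ : Representation ℤ G Z} {τ₁ τ₂ : Representation ℤ G Y}
    (hσ : ∀ g z, σ₁ g z = σ₂ g z) (hτ : ∀ g y, τ₁ g y = τ₂ g y) :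
    Nat.card (Representation.IntertwiningMap σ₁ τ₁) = Nat.card (Representation.IntertwiningMap σ₂ τ₂) := by
  refine Nat.card_congr
    { toFun := fun f => f.toLinearMap.intertwiningMap_of_isIntertwiningMap σ₂ τ₂ fun g z => by
        rw [← hσ, ← hτ]; exact f.isIntertwining σ₁ τ₁ g z
      invFun := fun f => f.toLinearMap.intertwiningMap_of_isIntertwiningMap σ₁ τ₁ fun g z => by
        rw [hσ, hτ]; exact f.isIntertwining σ₂ τ₂ g z
      left_inv := fun f => Representation.IntertwiningMap.ext rfl
      right_inv := fun f => Representation.IntertwiningMap.ext rfl }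

variable {H : Type*} [Group H]

/-- **Intertwining maps along a surjection**: for `π : G → H` onto, `Hom_G(π^*Z, π^*Y) = Hom_H(Z, Y)`
(same underlying additive maps). [folklore] -/
private theorem natCard_intertwiningMap_comp_of_surjective (π : G →* H) (hπ : Surjective π)
    (σ : Representation ℤ H Z) (τ : Representation ℤ H Y) :
    Nat.card (Representation.IntertwiningMap (σ.comp π) (τ.comp π)) =
      Nat.card (Representation.IntertwiningMap σ τ) := by
  refine Nat.card_congr
    { toFun := fun f => f.toLinearMap.intertwiningMap_of_isIntertwiningMap σ τ fun h z => by
        obtain ⟨g, rfl⟩ := hπ h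
        exact f.isIntertwining (σ.comp π) (τ.comp π) g z
      invFun := fun f => f.toLinearMap.intertwiningMap_of_isIntertwiningMap (σ.comp π) (τ.comp π)
        fun g z => f.isIntertwining σ τ (π g) z
      left_inv := fun f => Representation.IntertwiningMap.ext rfl
      right_inv := fun f => Representation.IntertwiningMap.ext rfl }

/-- **Descent along a surjection**: a representation of `G` on which `ker π` acts trivially is
pulled back from a (unique) representation of `H`. [folklore] -/
private theorem exists_representation_comp_eq (π : G →* H) (hπ : Surjective π) (σ : Representation ℤ G Z)
    (hker : ∀ g, π g = 1 → ∀ z, σ g z = z) :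
    ∃ σ' : Representation ℤ H Z, ∀ g z, σ' (π g) z = σ g z := by
  -- `σ` is constant on the fibres of `π`
  have hfib : ∀ g g' : G, π g = π g' → σ g = σ g' := fun g g' h => by
    have h1 : π (g⁻¹ * g') = 1 := by rw [map_mul, map_inv, h, inv_mul_cancel]
    have h2 : σ (g⁻¹ * g') = 1 := LinearMap.ext fun z => hker _ h1 z
    calc σ g = σ g * σ (g⁻¹ * g') := by rw [h2, mul_one]
      _ = σ g' := by rw [← map_mul, mul_inv_cancel_left]
  let s := Function.surjInv hπ
  have hs : ∀ h, π (s h) = h := Function.surjInv_eq hπ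
  refine ⟨{ toFun := fun h => σ (s h)
            map_one' := by rw [hfib (s 1) 1 (by rw [hs, map_one]), map_one]
            map_mul' := fun h h' => by
              rw [hfib (s (h * h')) (s h * s h') (by rw [hs, map_mul, hs, hs]), map_mul] },
    fun g z => ?_⟩
  change σ (s (π g)) z = σ g z
  rw [hfib (s (π g)) g (hs _)]

/-- Invariants along a surjection: `(π^*Z)^G = Z^H`. [folklore] -/
private theorem natCard_invariants_comp_of_surjective (π : G →* H) (hπ : Surjective π)
    (σ : Representation ℤ H Z) :
    Nat.card (Representation.invariants (σ.comp π)) = Nat.card σ.invariants := by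
  refine Nat.card_congr
    { toFun := fun z => ⟨z.1, fun h => by obtain ⟨g, rfl⟩ := hπ h; exact z.2 g⟩
      invFun := fun z => ⟨z.1, fun g => z.2 (π g)⟩
      left_inv := fun z => rfl
      right_inv := fun z => rfl }

end Intertwining

/-! ### `Hom_G(Z, Ω) = (Z^D)^G` -/

section HomRep

variable {G : Type u} [Group G] [TopologicalSpace G] [IsTopologicalGroup G]
variable {Z : Type u} [AddCommGroup Z] [TopologicalSpace Z] [DiscreteTopology Z] [Finite Z]
variable {Ω : Type u} [AddCommGroup Ω] [TopologicalSpace Ω] [DiscreteTopology Ω]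
variable (ζ : ContinuousRep G ℤ Z) (ω : ContinuousRep G ℤ Ω)

/-- **`#Hom_G(Z, Ω) = #(Hom(Z, Ω))^G`** for the tree's dual module `Z^D = homRep ζ ω`
(an additive map is equivariant iff it is a `G`-fixed element of `Z^D`). [cite: MilneADT2006, I §0] -/
theorem natCard_intertwiningMap_eq_natCard_invariants_homRep :
    Nat.card (Representation.IntertwiningMap ζ.toRepresentation ω.toRepresentation) =
      Nat.card (ζ.homRep ω).toTopRep.ρ.invariants := by
  refine Nat.card_congr
    { toFun := fun f => ⟨HomCarrier.ofAddMonoidHom f.toLinearMap.toAddMonoidHom, fun g => by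
        change (ζ.homRep ω) g _ = _
        rw [ContinuousRep.homRep_apply_eq_self_iff]
        intro z
        exact (f.isIntertwining ζ.toRepresentation ω.toRepresentation g z).symm⟩
      invFun := fun F => ((F.1 : Z →+ Ω).toIntLinearMap).intertwiningMap_of_isIntertwiningMap
        ζ.toRepresentation ω.toRepresentation fun g z => by
          have h := F.2 g
          change (ζ.homRep ω) g F.1 = F.1 at h
          rw [ContinuousRep.homRep_apply_eq_self_iff] at h
          exact (h z).symm
      left_inv := fun f => Representation.IntertwiningMap.ext rfl
      right_inv := fun F => Subtype.ext (HomCarrier.ext fun z => rfl) }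

omit [IsTopologicalGroup G] [Finite Z] in
/-- **`#Z^G` is invariant under isomorphisms of topological `G`-modules** (counted form of the tree's
`invariantsEquivOfIso`). [folklore] -/
private theorem natCard_invariants_congr {M₂ : Type u} [AddCommGroup M₂] [TopologicalSpace M₂] [DiscreteTopology M₂]
    {ρ₂ : ContinuousRep G ℤ M₂} (e : ζ.toTopRep ≅ ρ₂.toTopRep) :
    Nat.card ζ.toTopRep.ρ.invariants = Nat.card ρ₂.toTopRep.ρ.invariants :=
  Nat.card_congr (invariantsEquivOfIso e)

end HomRep

end EPCGlue

end Literature.NumberTheory.GaloisRepresentations.LocalEPC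

end Part6

/-!
## Part 7 — port of `Summits/BirchSwinnertonDyer/Rank1Residual/GaloisImage/EPCLocalFieldGlue.lean`

# Local-field glue for the tame layer: the extended valuation on a finite `E/K`
# (cell `b2b-bsdres`, team n1011, row T-EPC = Tate's local Euler–Poincaré characteristic; seat p04 GEN 8; stage C4b)

HONEST FRAMING (cell `b2b-bsdres`, run/shared/lean/b2b/bsd-rank1-residual/, verbatim in every
file): the goal of the cell is to DELETE the COMBINATION-SHAPED residual classes of the
Birch–Swinnerton-Dyer formula for ALL analytic-rank `≤ 1` elliptic curves over `ℚ` — "full BSD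
formula for every rank `≤ 1` curve in class `C`" assembled STRICTLY from published theorems — so
that the rank-`≤ 1` remainder becomes exactly the CONSTRUCTION-SHAPED classes, which are TYPED
(missing-input `Prop`s), NOT attempted. This is not "finishing BSD". Team n1011 (N10 / N11, the
additive block X4 ∧ `p = 3`): research route; no claim beyond the stated classes; nothing is
booked; no mark / label is changed by this file. Theorems only (no definition, no named fact, no
`sorry`); TOOL theorems on local fields.  (Placement: Summits/GaloisImage with the T-EPC cone.)

## What

Stage B7 (Milne's Lemma 2.11) is stated for an abstract finite Galois `E/K` with `E` a
non-archimedean local field whose valuation is `Gal(E/K)`-invariant, `|p| < 1`, and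
`𝒪_K = K ∩ 𝒪_E`.  For a finite extension `L` of the local field `K` equipped with the tree's
structures `FiniteExtension.valuativeRel/topologicalSpace K L` (the spectral norm; Serre,
*Local Fields* II §2 Prop. 3, Cor. 2) this file checks those hypotheses:

* `EPCLocalField.valuation_algEquiv` — `K`-automorphisms preserve the extended valuation
  (uniqueness of the prolongation; Mathlib `spectralNorm_eq_of_equiv`);
* `EPCLocalField.algebraMap_mem_integer_iff` — `algebraMap K L a ∈ 𝒪_L ↔ a ∈ 𝒪_K`;
* `EPCLocalField.valuation_natCast_lt_one_iff` — `|n|_L < 1 ↔ |n|_K < 1`;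
* `EPCLocalField.exists_submodule_integer` — `𝒪_K` as a membership-characterised `ℤ`-submodule;
* `EPCLocalField.index_galFixing`, `natCard_algEquiv_eq_index` — for `E ⊆ k̄` normal over `k`,
  `#Gal(E/k) = (Γ_k : Gal(k̄/E))`, and `Γ_k / Gal(k̄/E)` is finite.

References: J.-P. Serre, *Local Fields* (1979), II §2 Prop. 3 and Cor. 2 [SerreLocalFields1979];
J. S. Milne, *Arithmetic Duality Theorems* (2006), I §2 [MilneADT2006].
-/

section Part7


open _root_.Function _root_.Field
open scoped ValuativeRel
open Literature.NumberTheory.GaloisRepresentations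
open Literature.NumberTheory.GaloisRepresentations.LocalWeilDatum (galFixing mem_galFixing_iff)

universe u

namespace Literature.NumberTheory.GaloisRepresentations.LocalEPC

namespace EPCLocalField

section Valuation

variable (K : Type*) [Field K] [ValuativeRel K] [TopologicalSpace K] [IsNonarchimedeanLocalField K]
  (L : Type*) [Field L] [Algebra K L] [FiniteDimensional K L]

/-- **`K`-automorphisms preserve the extended valuation** of a finite extension `L/K` of a
non-archimedean local field (uniqueness of the prolongation: the valuation is given by the spectral
norm, which is `Gal(L/K)`-invariant, Mathlib `spectralNorm_eq_of_equiv`).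
[cite: SerreLocalFields1979, Ch. II §2 Cor. 2] -/
theorem valuation_algEquiv (σ : L ≃ₐ[K] L) (x : L) :
    letI := FiniteExtension.valuativeRel K L
    ValuativeRel.valuation L (σ x) = ValuativeRel.valuation L x := by
  letI := FiniteExtension.valuativeRel K L
  have hnorm : @Norm.norm L (FiniteExtension.normedField K L).toNorm (σ x) =
      @Norm.norm L (FiniteExtension.normedField K L).toNorm x := by
    rw [FiniteExtension.norm_def, FiniteExtension.norm_def]
    letI := IsNonarchimedeanLocalField.nontriviallyNormedField K
    exact (spectralNorm_eq_of_equiv σ x).symm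
  refine le_antisymm ?_ ?_
  · rw [← (ValuativeRel.valuation L).vle_iff_le, FiniteExtension.vle_iff_norm_le, hnorm]
  · rw [← (ValuativeRel.valuation L).vle_iff_le, FiniteExtension.vle_iff_norm_le, hnorm]

/-- **`algebraMap K L a ∈ 𝒪_L ↔ a ∈ 𝒪_K`**: the extended valuation prolongs that of `K`.
[cite: SerreLocalFields1979, Ch. II §2 Cor. 2] -/
theorem algebraMap_mem_integer_iff (a : K) :
    letI := FiniteExtension.valuativeRel K L
    algebraMap K L a ∈ 𝒪[L] ↔ a ∈ 𝒪[K] := by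
  letI := FiniteExtension.valuativeRel K L
  haveI := FiniteExtension.valuativeExtension K L
  rw [Valuation.mem_integer_iff, Valuation.mem_integer_iff, ← (ValuativeRel.valuation L).vle_one_iff,
    ← (ValuativeRel.valuation K).vle_one_iff, ← map_one (algebraMap K L),
    ValuativeExtension.vle_iff_vle]

/-- **`|n|_L < 1 ↔ |n|_K < 1`** for a natural number `n`. [cite: SerreLocalFields1979, Ch. II §2 Cor. 2] -/
theorem valuation_natCast_lt_one_iff (n : ℕ) :
    letI := FiniteExtension.valuativeRel K L
    ValuativeRel.valuation L n < 1 ↔ ValuativeRel.valuation K n < 1 := by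
  letI := FiniteExtension.valuativeRel K L
  haveI := FiniteExtension.valuativeExtension K L
  rw [lt_iff_not_ge, lt_iff_not_ge, ← (ValuativeRel.valuation L).one_vle_iff,
    ← (ValuativeRel.valuation K).one_vle_iff, ← map_natCast (algebraMap K L), ← map_one (algebraMap K L),
    ValuativeExtension.vle_iff_vle]

/-- **`𝒪_K = K ∩ 𝒪_L` as a membership-characterised `ℤ`-submodule of `K`** (the `OK` of stage B7).
[folklore] -/
private theorem exists_submodule_integer :
    letI := FiniteExtension.valuativeRel K L
    ∃ OK : Submodule ℤ K, (∀ a : K, a ∈ OK ↔ algebraMap K L a ∈ 𝒪[L]) ∧ ∀ a : K, a ∈ OK ↔ a ∈ 𝒪[K] := by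
  letI := FiniteExtension.valuativeRel K L
  refine ⟨AddSubgroup.toIntSubmodule (𝒪[K]).toAddSubgroup, fun a => ?_, fun a => Iff.rfl⟩
  rw [algebraMap_mem_integer_iff]
  rfl

end Valuation

/-! ### The finite layer `Gal(E/k) = Γ_k / Gal(k̄/E)` -/

section Index

variable (k : Type u) [Field k] (E : IntermediateField k (AlgebraicClosure k)) [Normal k E]

/-- `(Γ_k : Gal(k̄/E)) = #Gal(E/k)` for a normal subextension `E ⊆ k̄`. [folklore] -/
private theorem index_galFixing : (galFixing k E).index = Nat.card (↥E ≃ₐ[k] ↥E) := by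
  rw [← ker_resGal E, Subgroup.index_ker, MonoidHom.range_eq_top.2 (resGal_surjective E),
    Subgroup.card_top]

/-- `Γ_k / Gal(k̄/E)` is finite for `E/k` finite normal. [folklore] -/
private theorem finite_quotient_galFixing [FiniteDimensional k E] :
    Finite (absoluteGaloisGroup k ⧸ galFixing k E) := by
  haveI : (galFixing k E).FiniteIndex := by
    refine ⟨?_⟩
    rw [index_galFixing]
    exact Nat.card_pos.ne'
  exact Subgroup.finite_quotient_of_finiteIndex

end Index

end EPCLocalField

end Literature.NumberTheory.GaloisRepresentations.LocalEPC

end Part7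

/-!
## Part 8 — port of `Summits/BirchSwinnertonDyer/Rank1Residual/GaloisImage/TameLayerEulerCharacteristic.lean`

# Tate's local Euler–Poincaré characteristic over the tame layer
# (cell `b2b-bsdres`, team n1011, row T-EPC = Tate's local Euler–Poincaré characteristic; seat p04 GEN 8; stage C5)

HONEST FRAMING (cell `b2b-bsdres`, run/shared/lean/b2b/bsd-rank1-residual/, verbatim in every
file): the goal of the cell is to DELETE the COMBINATION-SHAPED residual classes of the
Birch–Swinnerton-Dyer formula for ALL analytic-rank `≤ 1` elliptic curves over `ℚ` — "full BSD
formula for every rank `≤ 1` curve in class `C`" assembled STRICTLY from published theorems — so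
that the rank-`≤ 1` remainder becomes exactly the CONSTRUCTION-SHAPED classes, which are TYPED
(missing-input `Prop`s), NOT attempted. This is not "finishing BSD". Team n1011 (N10 / N11, the
additive block X4 ∧ `p = 3`): research route; no claim beyond the stated classes; nothing is
booked; no mark / label is changed by this file. Theorems only (no definition, no named fact, no
`sorry`).  (Placement: Summits/GaloisImage with the T-EPC cone.)

## What

**Tate's formula `#H⁰(K, M) · #H²(K, M) · (𝒪_K : #M · 𝒪_K) = #H¹(K, M)` for the tame layer**: `K` a
non-archimedean local field of characteristic `0` with `|p| < 1`, `E/K` a finite Galois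
subextension of `K̄` of degree prime to `p` containing `μ_p`, and `M` a finite discrete `Γ_K`-module
killed by `p` on which `Gal(K̄/E)` acts trivially (`TameLayer.localEulerPoincare`).  This is the
case of Milne, *ADT* I Thm. 2.8 to which the wild / unramified-`p` dévissage (stage D) reduces the
general finite module; its proof here is Milne's (pp. 33–34) with Lemma 2.10 (Brauer induction)
replaced by restriction to the tame subgroup:

* `h² = #Hom_Γ(M, μ_p)` — local duality in bidegree `(2,0)` (tree, `natCard_two_eq_natCard_invariants_homRep`);
* `h¹ = #{Γ-equivariant continuous homomorphisms Gal(K̄/E) → M}` (stage C1) `= #Hom_Γ(M^D, Eˣ/Eˣᵖ)`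
  (equivariant Kummer theory, stages C2–C3) `= #(𝒪_K/p)^r · #Hom_Γ(M^D, μ_p) · #(M^D)^Γ`
  (Milne's Lemma 2.11, stage B7, `#M = p^r`) `= (𝒪_K : #M 𝒪_K) · h⁰ · h²`.

References: J. S. Milne, *Arithmetic Duality Theorems* (2006), I §2 Thm. 2.8 and Lemmas 2.11–2.12
[MilneADT2006]; J.-P. Serre, *Galois Cohomology* (1997), II §5.7 Thm. 5 [SerreGaloisCohomology1997].
-/

section Part8


open _root_.CategoryTheory _root_.Function _root_.Field
open scoped ValuativeRel
open Literature.NumberTheory.GaloisRepresentations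
open Literature.NumberTheory.GaloisRepresentations.DiscreteGaloisModule
open Literature.NumberTheory.GaloisRepresentations.LocalWeilDatum
open Literature.NumberTheory.EllipticCurves (subgroupConj subgroupConj_apply_coe)

universe u

namespace Literature.NumberTheory.GaloisRepresentations.LocalEPC

namespace TameLayer

variable (K : Type u) [Field K] [ValuativeRel K] [TopologicalSpace K] [IsNonarchimedeanLocalField K]
  [CharZero K]
variable (p : ℕ) [hp : Fact p.Prime]
variable (E : IntermediateField K (AlgebraicClosure K)) [FiniteDimensional K E] [IsGalois K E]
variable {M : Type u} [AddCommGroup M] [TopologicalSpace M] [DiscreteTopology M] [Finite M]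
  (ρ : ContinuousRep (absoluteGaloisGroup K) ℤ M)

omit [ValuativeRel K] [TopologicalSpace K] [IsNonarchimedeanLocalField K] [CharZero K] hp
  [FiniteDimensional K E] [IsGalois K E] in
/-- `Gal(K̄/E)` acts trivially on `M^D = Hom(M, μ_p)` when it acts trivially on `M` and on `μ_p`.
[folklore] -/
private theorem homRep_apply_eq_self_of_mem
    (hμ : ∀ g ∈ galFixing K E, ∀ ζ : MuCarrier K p, mu K p g ζ = ζ)
    (hNM : ∀ g ∈ galFixing K E, ∀ m : M, ρ g m = m)
    (g : absoluteGaloisGroup K) (hg : g ∈ galFixing K E) (f : HomCarrier M (MuCarrier K p)) :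
    ρ.homRep (mu K p) g f = f := by
  rw [ContinuousRep.homRep_apply_eq_self_iff]
  intro m
  rw [hμ g hg, hNM g hg]

omit [ValuativeRel K] [TopologicalSpace K] [IsNonarchimedeanLocalField K] [CharZero K] in
/-- `#(M^D)^Γ` does not depend on how the exponent of `μ` is written. [folklore] -/
private theorem natCard_invariants_homRep_mu_congr {n m : ℕ} (h : n = m) :
    Nat.card (ρ.homRep (mu K n)).toTopRep.ρ.invariants =
      Nat.card (ρ.homRep (mu K m)).toTopRep.ρ.invariants := by
  subst h; rfl

omit [ValuativeRel K] [TopologicalSpace K] [IsNonarchimedeanLocalField K] in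
/-- **Step 1 (`h¹` through Kummer theory)**: `#H¹(K, M) = #Hom_Γ(M^D, Eˣ/Eˣᵖ)` with `Γ_K` acting on
`Eˣ/Eˣᵖ` through `Gal(E/K)` (stages C1, C3a, C3b and `M ≅ M^{DD}`).
[cite: MilneADT2006, I §2 proof of Thm 2.8 (pp. 33–34)] -/
theorem natCard_one_eq_natCard_intertwiningMap
    (hG : ¬ p ∣ (galFixing K E).index)
    (hμ : ∀ g ∈ galFixing K E, ∀ ζ : MuCarrier K p, mu K p g ζ = ζ)
    (hpM : ∀ m : M, p • m = 0) (hNM : ∀ g ∈ galFixing K E, ∀ m : M, ρ g m = m) :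
    Nat.card (continuousCohomology 1 ρ.toTopRep) =
      Nat.card (Representation.IntertwiningMap (ρ.homRep (mu K p)).toRepresentation
        (Representation.quotient
          ((Representation.ofMulDistribMulAction (↥E ≃ₐ[K] ↥E) (↥E)ˣ).comp (resGal E)) _
          (ModPRepCount.range_lsmul_le_comap
            ((Representation.ofMulDistribMulAction (↥E ≃ₐ[K] ↥E) (↥E)ˣ).comp (resGal E)) p))) := by
  classical
  haveI : (galFixing K E).Normal := normal_galFixing E
  haveI : NeZero p := ⟨hp.out.ne_zero⟩
  haveI : Fintype (absoluteGaloisGroup K ⧸ galFixing K E) :=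
    @Fintype.ofFinite _ (EPCLocalField.finite_quotient_galFixing K E)
  haveI : Finite (MuCarrier K p) := finite_muCarrier K p
  -- C1: `h¹ = #{Γ-invariant cocycles N → M}`
  rw [TrivialAction.natCard_continuousCohomology_one_eq ρ (galFixing K E) (isOpen_galFixing K E)
    (TrivialAction.bijective_index_smul_of_prime (galFixing K E) hpM hG) hNM]
  -- `M ≅ M^{DD}`
  rw [EPCGlue.natCard_invariantCocycles_congr (galFixing K E) (ρ.biDualIso (mu K p) (muEquivZMod K p) hpM)]
  -- Kummer + swap
  obtain ⟨Ψ, hbij, -, hΨ⟩ := KummerSubgroup.exists_equivariant_bijective K p E hp.out.pos hμ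
  exact EquivariantHom.natCard_invariant_cocycles_homRep_eq_of_bijective (galFixing K E) (mu K p)
    (ρ.homRep (mu K p)) _ hμ (homRep_apply_eq_self_of_mem K p E ρ hμ hNM) Ψ hbij hΨ

omit [ValuativeRel K] [TopologicalSpace K] [IsNonarchimedeanLocalField K] [CharZero K] hp
  [FiniteDimensional K E] in
/-- **Step 2 (descent to `Gal(E/K)`)**: for the descended action `σ'` of `Gal(E/K)` on `M^D`,
`#Hom_Γ(M^D, Eˣ/Eˣᵖ) = #Hom_{Gal(E/K)}(M^D, Eˣ/Eˣᵖ)`. [folklore] -/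
private theorem natCard_intertwiningMap_descend
    (σ' : Representation ℤ (↥E ≃ₐ[K] ↥E) (HomCarrier M (MuCarrier K p)))
    (hσ' : ∀ g f, σ' (resGal E g) f = (ρ.homRep (mu K p)).toRepresentation g f) :
    Nat.card (Representation.IntertwiningMap (ρ.homRep (mu K p)).toRepresentation
        (Representation.quotient
          ((Representation.ofMulDistribMulAction (↥E ≃ₐ[K] ↥E) (↥E)ˣ).comp (resGal E)) _
          (ModPRepCount.range_lsmul_le_comap
            ((Representation.ofMulDistribMulAction (↥E ≃ₐ[K] ↥E) (↥E)ˣ).comp (resGal E)) p))) =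
      Nat.card (Representation.IntertwiningMap σ'
        ((Representation.ofMulDistribMulAction (↥E ≃ₐ[K] ↥E) (↥E)ˣ).quotient _
          (ModPRepCount.range_lsmul_le_comap
            (Representation.ofMulDistribMulAction (↥E ≃ₐ[K] ↥E) (↥E)ˣ) p))) := by
  set ρU := Representation.ofMulDistribMulAction (↥E ≃ₐ[K] ↥E) (↥E)ˣ with hρU
  rw [← EPCGlue.natCard_intertwiningMap_comp_of_surjective (resGal E) (resGal_surjective E) σ']
  refine EPCGlue.natCard_intertwiningMap_congr_of_eq (fun g f => (hσ' g f).symm) fun g x => ?_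
  induction x using Submodule.Quotient.induction_on with
  | H y =>
  rw [Representation.quotient_apply, Submodule.mapQ_apply]
  change _ = (ρU.quotient _ (ModPRepCount.range_lsmul_le_comap ρU p)) (resGal E g) (Submodule.Quotient.mk y)
  rw [Representation.quotient_apply, Submodule.mapQ_apply]
  rfl

omit [ValuativeRel K] [TopologicalSpace K] [IsNonarchimedeanLocalField K] [FiniteDimensional K E] in
/-- **Step 3 (the torsion term)**: `#Hom_{Gal(E/K)}(M^D, Eˣ[p]) = #M^{Γ}` (`Eˣ[p] = μ_p`,
`Hom_Γ(M^D, μ_p) = (M^{DD})^Γ`, `M ≅ M^{DD}`). [cite: MilneADT2006, I §2 proof of Thm 2.8] -/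
theorem natCard_intertwiningMap_torsion_eq
    (hμ : ∀ g ∈ galFixing K E, ∀ ζ : MuCarrier K p, mu K p g ζ = ζ) (hpM : ∀ m : M, p • m = 0)
    (σ' : Representation ℤ (↥E ≃ₐ[K] ↥E) (HomCarrier M (MuCarrier K p)))
    (hσ' : ∀ g f, σ' (resGal E g) f = (ρ.homRep (mu K p)).toRepresentation g f) :
    Nat.card (Representation.IntertwiningMap σ'
        ((Representation.ofMulDistribMulAction (↥E ≃ₐ[K] ↥E) (↥E)ˣ).subrepresentation _
          (ModPRepCount.ker_lsmul_le_comap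
            (Representation.ofMulDistribMulAction (↥E ≃ₐ[K] ↥E) (↥E)ˣ) p))) =
      Nat.card ρ.toTopRep.ρ.invariants := by
  haveI : NeZero p := ⟨hp.out.ne_zero⟩
  haveI : Finite (MuCarrier K p) := finite_muCarrier K p
  rw [← EPCGlue.natCard_intertwiningMap_comp_of_surjective (resGal E) (resGal_surjective E) σ']
  obtain ⟨e⟩ := KummerSubgroup.nonempty_equiv_mu_torsionUnits K p E hμ
  rw [← ModPRepCount.natCard_intertwiningMap_congr_right _ _ _ e,
    EPCGlue.natCard_intertwiningMap_congr_of_eq (σ₂ := (ρ.homRep (mu K p)).toRepresentation)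
      (τ₂ := (mu K p).toRepresentation) hσ' (fun g y => rfl),
    EPCGlue.natCard_intertwiningMap_eq_natCard_invariants_homRep]
  exact (EPCGlue.natCard_invariants_congr ρ (ρ.biDualIso (mu K p) (muEquivZMod K p) hpM)).symm

omit [ValuativeRel K] [TopologicalSpace K] [IsNonarchimedeanLocalField K] [CharZero K] hp
  [FiniteDimensional K E] in
/-- **Step 4 (the invariants term)**: `#(M^D)^{Gal(E/K)} = #(M^D)^{Γ}`. [folklore] -/
private theorem natCard_invariants_descend
    (σ' : Representation ℤ (↥E ≃ₐ[K] ↥E) (HomCarrier M (MuCarrier K p)))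
    (hσ' : ∀ g f, σ' (resGal E g) f = (ρ.homRep (mu K p)).toRepresentation g f) :
    Nat.card σ'.invariants = Nat.card (ρ.homRep (mu K p)).toTopRep.ρ.invariants := by
  rw [← EPCGlue.natCard_invariants_comp_of_surjective (resGal E) (resGal_surjective E) σ']
  refine Nat.card_congr
    { toFun := fun f => ⟨f.1, fun g => by
        have h := f.2 g
        change σ' (resGal E g) f.1 = f.1 at h
        rw [hσ'] at h
        exact h⟩
      invFun := fun f => ⟨f.1, fun g => by
        change σ' (resGal E g) f.1 = f.1
        rw [hσ']
        exact f.2 g⟩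
      left_inv := fun f => rfl
      right_inv := fun f => rfl }

/-- **Tate's local Euler–Poincaré characteristic formula over the tame layer.**  Let `K` be a
non-archimedean local field of characteristic `0` with `|p| < 1`, `E ⊆ K̄` a finite Galois extension
of `K` of degree prime to `p` with `μ_p(K̄) ⊆ E` (i.e. fixed by `Gal(K̄/E)`), and `M` a finite
discrete `Γ_K`-module killed by `p` on which `Gal(K̄/E)` acts trivially.  Then `H¹(K, M)` and
`H²(K, M)` are finite and

  `#M^{Γ_K} · #H²(K, M) · #(𝒪_K / (#M) 𝒪_K) = #H¹(K, M)`.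

(Milne, *ADT* I Thm. 2.8 for such `M`; proof: `(2,0)`-duality, restriction to the tame subgroup,
equivariant Kummer theory and Lemma 2.11 — stages B and C of this directory.)
[cite: MilneADT2006, I §2 Thm 2.8, Lemmas 2.11–2.12 (pp. 31–34)]
[cite: SerreGaloisCohomology1997, II §5.7 Thm. 5] -/
theorem localEulerPoincare (hpv : ValuativeRel.valuation K p < 1)
    (hG : ¬ p ∣ (galFixing K E).index)
    (hμ : ∀ g ∈ galFixing K E, ∀ ζ : MuCarrier K p, mu K p g ζ = ζ)
    (hpM : ∀ m : M, p • m = 0) (hNM : ∀ g ∈ galFixing K E, ∀ m : M, ρ g m = m) :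
    Finite (continuousCohomology 1 ρ.toTopRep) ∧ Finite (continuousCohomology 2 ρ.toTopRep) ∧
      Nat.card ρ.toTopRep.ρ.invariants * Nat.card (continuousCohomology 2 ρ.toTopRep) *
          Nat.card (𝒪[K] ⧸ Ideal.span {((Nat.card M : ℕ) : 𝒪[K])}) =
        Nat.card (continuousCohomology 1 ρ.toTopRep) := by
  classical
  haveI : (galFixing K E).Normal := normal_galFixing E
  haveI : NeZero p := ⟨hp.out.ne_zero⟩
  -- `#M = p^r`
  obtain ⟨r, hr⟩ := exists_card_eq_prime_pow M (fun m => ⟨1, by rw [pow_one]; exact hpM m⟩ :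
    IsPrimaryTorsion p M)
  -- `h²` by `(2,0)`-duality
  haveI : Finite (MuCarrier K p) := finite_muCarrier K p
  obtain ⟨hfin2, h2⟩ := natCard_two_eq_natCard_invariants_homRep K ρ (k := 1)
    (fun m => by rw [pow_one]; exact hpM m)
  have h2' : Nat.card (continuousCohomology 2 ρ.toTopRep) =
      Nat.card (ρ.homRep (mu K p)).toTopRep.ρ.invariants :=
    h2.trans (natCard_invariants_homRep_mu_congr K ρ (pow_one p))
  refine ⟨finite_galoisCohomology_one_of_isNonarchimedeanLocalField ρ, hfin2, ?_⟩
  -- the descended action of `Gal(E/K)` on `M^D`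
  have hker : ∀ g, resGal E g = 1 → ∀ f : HomCarrier M (MuCarrier K p),
      (ρ.homRep (mu K p)).toRepresentation g f = f := fun g hg f => by
    have hgN : g ∈ galFixing K E := by rw [← ker_resGal E]; exact hg
    exact homRep_apply_eq_self_of_mem K p E ρ hμ hNM g hgN f
  obtain ⟨σ', hσ'⟩ := EPCGlue.exists_representation_comp_eq (resGal E) (resGal_surjective E)
    (ρ.homRep (mu K p)).toRepresentation hker
  -- `h¹ = #Hom_Δ(M^D, Eˣ/p)`
  have h1 := (natCard_one_eq_natCard_intertwiningMap K p E ρ hG hμ hpM hNM).trans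
    (natCard_intertwiningMap_descend K p E ρ σ' hσ')
  -- Milne's Lemma 2.11 over `E/K`
  letI := FiniteExtension.valuativeRel K (↥E)
  letI := FiniteExtension.topologicalSpace K (↥E)
  haveI := FiniteExtension.isNonarchimedeanLocalField K (↥E)
  obtain ⟨OK, hOK₁, hOK₂⟩ := EPCLocalField.exists_submodule_integer K (↥E)
  have hGΔ : ¬ p ∣ Nat.card (↥E ≃ₐ[K] ↥E) := by rwa [← EPCLocalField.index_galFixing K E]
  have hcard : Nat.card (HomCarrier M (MuCarrier K p)) = p ^ r := by
    rw [HomCarrier.natCard_eq (muEquivZMod K p) hpM, hr]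
  have h211 := OneUnits.natCard_modP_field_units_eq (K := K) (E := ↥E) p
    ((EPCLocalField.valuation_natCast_lt_one_iff K (↥E) p).2 hpv) (EPCLocalField.valuation_algEquiv K (↥E))
    hGΔ σ' (HomCarrier.nsmul_eq_zero_of_left hpM) hcard OK hOK₁
  rw [h211, natCard_intertwiningMap_torsion_eq K p E ρ hμ hpM σ' hσ',
    natCard_invariants_descend K p E ρ σ' hσ', ← h2'] at h1
  -- the integer term
  have hint : Nat.card (OK ⧸ LinearMap.range (LinearMap.lsmul ℤ OK p)) ^ r =
      Nat.card (𝒪[K] ⧸ Ideal.span {((Nat.card M : ℕ) : 𝒪[K])}) := by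
    rw [OneUnits.natCard_quotient_integer_eq p OK hOK₂, hr, Nat.cast_pow,
      QuotientPow.natCard_quotient_span_pow (p : 𝒪[K]) (OneUnits.integer_hypotheses p hpv).1 r]
  rw [h1, ← hint]
  ring

end TameLayer

end Literature.NumberTheory.GaloisRepresentations.LocalEPC

end Part8

/-!
## Part 9 — port of `Summits/BirchSwinnertonDyer/Rank1Residual/GaloisImage/EPCGaloisBaseChange.lean`

# Base change of the absolute Galois group to a finite subextension: `Γ_E ≃ₜ* Gal(K̄/E) ≤ Γ_K`
# (cell `b2b-bsdres`, team n1011, row T-EPC = Tate's local Euler–Poincaré characteristic; seat p04 GEN 8; stage D5b)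

HONEST FRAMING (cell `b2b-bsdres`, run/shared/lean/b2b/bsd-rank1-residual/, verbatim in every
file): the goal of the cell is to DELETE the COMBINATION-SHAPED residual classes of the
Birch–Swinnerton-Dyer formula for ALL analytic-rank `≤ 1` elliptic curves over `ℚ` — "full BSD
formula for every rank `≤ 1` curve in class `C`" assembled STRICTLY from published theorems — so
that the rank-`≤ 1` remainder becomes exactly the CONSTRUCTION-SHAPED classes, which are TYPED
(missing-input `Prop`s), NOT attempted. This is not "finishing BSD". Team n1011 (N10 / N11, the
additive block X4 ∧ `p = 3`): research route; no claim beyond the stated classes; nothing is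
booked; no mark / label is changed by this file. Theorems only (no definition, no named fact, no
`sorry`).  (Placement: Summits/GaloisImage with the T-EPC cone.)

## What

For a field `K` of characteristic `0` and a subextension `E ⊆ K̄` (`E : IntermediateField K K̄`):

* `EPCBaseChange.exists_continuousMulEquiv_galFixing` — an isomorphism of topological groups
  `ι : Γ_E ≃ₜ* Gal(K̄/E) = galFixing K E` (`Γ_E = Aut_E(Ē)` for the algebraic closure `Ē` of the
  field `E`; `K̄` is another algebraic closure of `E`) such that **if `ι g` fixes `μₙ(K̄)` then `g`
  fixes `μₙ(Ē)`** — the compatibility of the cyclotomic modules `mu K n` and `mu E n` needed to move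
  the hypothesis "`Γ_{E'}` acts trivially on `μ_p`" of the tame layer of Tate's theorem
  (`TameLayer.localEulerPoincare`) from `K` to `E`;
* `EPCBaseChange.mu_apply_eq_self_iff` — `mu K n σ ζ = ζ ↔ σ • ζ = ζ` in `K̄`;
* `EPCBaseChange.isGalois_of_normal_galFixing` — `Gal(K̄/E) ⊴ Γ_K → E/K` Galois (Krull);
* `EPCBaseChange.index_comap_equiv` — indices along `ι`.

References: J.-P. Serre, *Galois Cohomology* (1997), II §1.1 [SerreGaloisCohomology1997];
J. Neukirch, *Algebraic Number Theory* (1999), IV §1 [NeukirchANT1999].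
-/

section Part9


open _root_.Function _root_.Field _root_.IntermediateField
open Literature.NumberTheory.GaloisRepresentations
open Literature.NumberTheory.GaloisRepresentations.DiscreteGaloisModule
open Literature.NumberTheory.GaloisRepresentations.LocalWeilDatum

universe u

namespace Literature.NumberTheory.GaloisRepresentations.LocalEPC

namespace EPCBaseChange

variable (K : Type u) [Field K]

/-- `mu K n σ ζ = ζ` iff `σ` fixes the root of unity `ζ ∈ K̄`. [folklore] -/
private theorem mu_apply_eq_self_iff (n : ℕ) (σ : absoluteGaloisGroup K) (ζ : MuCarrier K n) :
    mu K n σ ζ = ζ ↔ σ • ((muVal K n ζ : (AlgebraicClosure K)ˣ) : AlgebraicClosure K) =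
      ((muVal K n ζ : (AlgebraicClosure K)ˣ) : AlgebraicClosure K) := by
  rw [← (muVal_injective K n).eq_iff, muVal_apply, Units.ext_iff, Units.coe_smul]

/-- An element of `K̄` with `x ^ n = 1` (`n ≠ 0`) fixed by every `σ` fixing `μₙ(K̄)`. [folklore] -/
private theorem smul_eq_self_of_pow_eq_one {n : ℕ} [NeZero n] {σ : absoluteGaloisGroup K}
    (hσ : ∀ ζ : MuCarrier K n, mu K n σ ζ = ζ) {x : AlgebraicClosure K} (hx : x ^ n = 1) :
    σ • x = x := by
  have h := (mu_apply_eq_self_iff K n σ (MuCarrier.ofRootsOfUnity (rootsOfUnity.mkOfPowEq x hx))).1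
    (hσ _)
  rwa [muVal_ofRootsOfUnity, rootsOfUnity.coe_mkOfPowEq] at h

variable [CharZero K]

/-- **`Γ_E ≃ₜ* Gal(K̄/E)` compatibly with the roots of unity.** For a subextension `E ⊆ K̄` of a
field `K` of characteristic `0` there is an isomorphism of topological groups
`ι : Γ_E ≃ₜ* galFixing K E` (`τ ↦ e⁻¹ ∘ τ ∘ e` restricted to `K`, for an `E`-isomorphism
`e : K̄ ≃ Ē` of algebraic closures of `E`; continuous bijective from a compact group to a
Hausdorff one) such that, for every `n ≠ 0`, if `ι g` fixes every `n`-th root of unity of `K̄`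
then `g` fixes every `n`-th root of unity of `Ē`. [cite: SerreGaloisCohomology1997, II §1.1]
[cite: NeukirchANT1999, IV §1] -/
theorem exists_continuousMulEquiv_galFixing (E : IntermediateField K (AlgebraicClosure K)) :
    ∃ ι : absoluteGaloisGroup E ≃ₜ* galFixing K E, ∀ (n : ℕ) [NeZero n] (g : absoluteGaloisGroup E),
      (∀ ζ : MuCarrier K n, mu K n ((ι g : galFixing K E) : absoluteGaloisGroup K) ζ = ζ) →
        ∀ ζ : MuCarrier E n, mu E n g ζ = ζ := by
  haveI : IsAlgClosure E (AlgebraicClosure K) :=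
    ⟨inferInstance, Algebra.IsAlgebraic.tower_top (K := K) E⟩
  haveI : CharZero E := charZero_of_injective_algebraMap (algebraMap K E).injective
  -- `ψ : Aut_E(K̄) ≃ₜ* Γ_E` and `φ : Aut_E(K̄) →* galFixing K E`
  let e : AlgebraicClosure K ≃ₐ[E] AlgebraicClosure E :=
    IsAlgClosure.equiv E (AlgebraicClosure K) (AlgebraicClosure E)
  let ψ : (AlgebraicClosure K ≃ₐ[E] AlgebraicClosure K) ≃ₜ* absoluteGaloisGroup E :=
    algEquivContinuousMulEquivAbsoluteGaloisGroup E (AlgebraicClosure K)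
  have hψ : ∀ (g : absoluteGaloisGroup E) (x : AlgebraicClosure K), (ψ.symm g) x = e.symm (g • e x) :=
    fun g x => rfl
  let f : absoluteGaloisGroup E →* galFixing K E := (galFixingOfAlgEquiv E).comp ψ.symm.toMonoidHom
  have hf : ∀ g x, ((f g : galFixing K E) : absoluteGaloisGroup K) • x = e.symm (g • e x) := fun g x => by
    rw [← hψ]; exact coe_galFixingOfAlgEquiv_smul E (ψ.symm g) x
  have hfc : Continuous f := (continuous_galFixingOfAlgEquiv E).comp ψ.symm.continuous
  have hfinj : Injective f := by
    intro g g' h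
    apply ψ.symm.injective
    ext x
    have := congrArg (fun t : galFixing K E => (t : absoluteGaloisGroup K) • x) h
    rw [hf, hf] at this
    rw [hψ, hψ, this]
  have hfsurj : Surjective f := fun t => by
    obtain ⟨τ, hτ⟩ := galFixingOfAlgEquiv_surjective E t
    refine ⟨ψ τ, ?_⟩
    change galFixingOfAlgEquiv E (ψ.symm (ψ τ)) = t
    rw [ψ.symm_apply_apply]
    exact hτ
  -- compact to Hausdorff: a homeomorphism
  let e₀ : absoluteGaloisGroup E ≃* galFixing K E := MulEquiv.ofBijective f ⟨hfinj, hfsurj⟩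
  let h₀ : absoluteGaloisGroup E ≃ₜ galFixing K E :=
    Continuous.homeoOfEquivCompactToT2 (f := e₀.toEquiv) hfc
  let ι : absoluteGaloisGroup E ≃ₜ* galFixing K E :=
    { e₀ with
      continuous_toFun := h₀.continuous
      continuous_invFun := h₀.symm.continuous }
  have hι : ∀ g x, ((ι g : galFixing K E) : absoluteGaloisGroup K) • x = e.symm (g • e x) := hf
  refine ⟨ι, fun n _ g hg ζ => ?_⟩
  -- `g` fixes `y = ζ ∈ Ē` because `ι g` fixes `e⁻¹ y ∈ μₙ(K̄)`
  rw [mu_apply_eq_self_iff]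
  set y : AlgebraicClosure E := ((muVal E n ζ : (AlgebraicClosure E)ˣ) : AlgebraicClosure E) with hy
  have hyn : y ^ n = 1 := by
    rw [hy, ← Units.val_pow_eq_pow_val, muVal_pow_eq_one, Units.val_one]
  have hxn : (e.symm y) ^ n = 1 := by rw [← map_pow, hyn, map_one]
  have key := smul_eq_self_of_pow_eq_one K hg hxn
  rw [hι, AlgEquiv.apply_symm_apply] at key
  exact e.symm.injective key

omit [CharZero K] in
/-- `E.fixingSubgroup` is the pull-back of `galFixing K E` along the identity `Aut_K(K̄) = Γ_K`. [folklore] -/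
private theorem fixingSubgroup_eq_comap (E : IntermediateField K (AlgebraicClosure K)) :
    E.fixingSubgroup = (galFixing K E).comap (absoluteGaloisGroup.toAlgEquiv K).symm.toMonoidHom := by
  ext σ
  rw [Subgroup.mem_comap, MulEquiv.coe_toMonoidHom, mem_galFixing_iff,
    IntermediateField.mem_fixingSubgroup_iff]
  simp only [absoluteGaloisGroup.toAlgEquiv_symm_apply]

/-- **`Gal(K̄/E) ⊴ Γ_K` implies `E/K` Galois** (fundamental theorem of infinite Galois theory,
Mathlib `InfiniteGalois.normal_iff_isGalois`; `K̄/K` is Galois in characteristic `0`).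
[cite: NeukirchANT1999, IV §1] -/
theorem isGalois_of_normal_galFixing (E : IntermediateField K (AlgebraicClosure K))
    [hN : (galFixing K E).Normal] : IsGalois K E := by
  haveI : E.fixingSubgroup.Normal := by
    rw [fixingSubgroup_eq_comap]
    exact Subgroup.Normal.comap hN _
  exact (InfiniteGalois.normal_iff_isGalois E).1 inferInstance

omit [CharZero K] in
/-- Index transport: for `ι : G ≃* S` onto a subgroup `S ≤ Γ` and `H ≤ Γ`, the pull-back of
`H ∩ S` has index `[S : H ∩ S]`. [folklore] -/
private theorem index_comap_equiv {G Γ : Type*} [Group G] [Group Γ] {S : Subgroup Γ} (ι : G ≃* S)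
    (H : Subgroup Γ) : ((H.subgroupOf S).comap ι.toMonoidHom).index = H.relIndex S :=
  Subgroup.index_comap_of_surjective _ ι.surjective

end EPCBaseChange

end Literature.NumberTheory.GaloisRepresentations.LocalEPC

end Part9

/-!
## Part 10 — port of `Summits/BirchSwinnertonDyer/Rank1Residual/GaloisImage/EPCBottomLayer.lean`

# The bottom layer of the `p`-tower in Tate's theorem: Euler–Poincaré count for `Gal(K̄/E) ≤ Γ_K`
# (cell `b2b-bsdres`, team n1011, row T-EPC = Tate's local Euler–Poincaré characteristic; seat p04 GEN 8; stage D5c)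

HONEST FRAMING (cell `b2b-bsdres`, run/shared/lean/b2b/bsd-rank1-residual/, verbatim in every
file): the goal of the cell is to DELETE the COMBINATION-SHAPED residual classes of the
Birch–Swinnerton-Dyer formula for ALL analytic-rank `≤ 1` elliptic curves over `ℚ` — "full BSD
formula for every rank `≤ 1` curve in class `C`" assembled STRICTLY from published theorems — so
that the rank-`≤ 1` remainder becomes exactly the CONSTRUCTION-SHAPED classes, which are TYPED
(missing-input `Prop`s), NOT attempted. This is not "finishing BSD". Team n1011 (N10 / N11, the
additive block X4 ∧ `p = 3`): research route; no claim beyond the stated classes; nothing is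
booked; no mark / label is changed by this file. Theorems only (no definition, no named fact, no
`sorry`).  (Placement: Summits/GaloisImage with the T-EPC cone.)

## What

`EPCBottom.epc_galFixing` — let `K` be a non-archimedean local field of characteristic `0` with
`|p| < 1`, `E/K` a finite Galois subextension of `K̄`, `M` a finite discrete `Γ_K`-module killed
by `p`, and `S₀ ⊴ Γ_K` an open normal subgroup acting trivially on `M` and on `μ_p(K̄)` with
`[Gal(K̄/E) : S₀ ∩ Gal(K̄/E)]` prime to `p`.  Then `H¹`, `H²` of `Gal(K̄/E) = galFixing K E` with
values in `M` are finite and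
`#M^{Gal(K̄/E)} · #H²(Gal(K̄/E), M) · #(𝒪_K / #M)^{[E:K]} = #H¹(Gal(K̄/E), M)`.
Proof: the tame layer of Tate's theorem over the local field `E` (stage C5
`TameLayer.localEulerPoincare`, applied to `Γ_E` and the subextension of `Ē` cut out by the
pull-back of `S₀`), transported along `Γ_E ≃ₜ* Gal(K̄/E)` (stages D5a, D5b), with
`#(𝒪_E / p^r) = #(𝒪_K / p^r)^{[E:K]}` (stage B6b, normal-basis lattice count).

References: J. S. Milne, *Arithmetic Duality Theorems* (2006), I §2 Thm. 2.8 and Lemma 2.12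
[MilneADT2006]; J.-P. Serre, *Galois Cohomology* (1997), II §5.7 [SerreGaloisCohomology1997].
-/

section Part10


open _root_.CategoryTheory _root_.Function _root_.Field
open scoped ValuativeRel
open Literature.NumberTheory.GaloisRepresentations
open Literature.NumberTheory.GaloisRepresentations.DiscreteGaloisModule
open Literature.NumberTheory.GaloisRepresentations.LocalWeilDatum

universe u

namespace Literature.NumberTheory.GaloisRepresentations.LocalEPC

namespace EPCBottom

variable (K : Type u) [Field K] [ValuativeRel K] [TopologicalSpace K] [IsNonarchimedeanLocalField K]
  [CharZero K]
variable (p : ℕ) [hp : Fact p.Prime]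
variable (E : IntermediateField K (AlgebraicClosure K)) [FiniteDimensional K E] [IsGalois K E]
variable {M : Type u} [AddCommGroup M] [TopologicalSpace M] [DiscreteTopology M] [Finite M]

omit [AddCommGroup M] [TopologicalSpace M] [DiscreteTopology M] [Finite M] in
/-- **`#(𝒪_E / #M) = #(𝒪_K / #M)^{[E:K]}`** for `#M = p^r`, `E/K` finite Galois inside `K̄` with
its local-field structure (`FiniteExtension`): Milne's Lemma 2.12 count `#(𝒪_E/p) = #(𝒪_K/p)^{[E:K]}`
(stage B6b) and `#(R/a^r) = #(R/a)^r`. [cite: MilneADT2006, I §2 Lemma 2.12 (p. 34)] -/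
theorem natCard_integer_quotient_card (hpv : ValuativeRel.valuation K p < 1) {r : ℕ} (hr : Nat.card M = p ^ r) :
    letI := FiniteExtension.valuativeRel K E
    Nat.card (𝒪[E] ⧸ Ideal.span {((Nat.card M : ℕ) : 𝒪[E])}) =
      Nat.card (𝒪[K] ⧸ Ideal.span {((Nat.card M : ℕ) : 𝒪[K])}) ^ Module.finrank K E := by
  letI := FiniteExtension.valuativeRel K E
  letI := FiniteExtension.topologicalSpace K E
  haveI := FiniteExtension.isNonarchimedeanLocalField K E
  haveI : CharZero E := charZero_of_injective_algebraMap (algebraMap K E).injective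
  have hpvE : ValuativeRel.valuation E p < 1 := (EPCLocalField.valuation_natCast_lt_one_iff K E p).2 hpv
  obtain ⟨OK, hOK, hOK'⟩ := EPCLocalField.exists_submodule_integer K E
  have hB := LocalIntegers.natCard_integer_quotient_eq_pow p hpvE
    (fun σ x => EPCLocalField.valuation_algEquiv K E σ x) OK hOK
  rw [OneUnits.natCard_quotient_integer_eq p OK hOK'] at hB
  have haE : ∀ x : 𝒪[E], (p : 𝒪[E]) * x = 0 → x = 0 := fun x hx =>
    (mul_eq_zero.1 hx).resolve_left (by
      intro h
      have h' : ((p : 𝒪[E]) : E) = 0 := by rw [h]; rfl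
      rw [SubringClass.coe_natCast, Nat.cast_eq_zero] at h'
      exact hp.out.ne_zero h')
  have haK : ∀ x : 𝒪[K], (p : 𝒪[K]) * x = 0 → x = 0 := fun x hx =>
    (mul_eq_zero.1 hx).resolve_left (by
      intro h
      have h' : ((p : 𝒪[K]) : K) = 0 := by rw [h]; rfl
      rw [SubringClass.coe_natCast, Nat.cast_eq_zero] at h'
      exact hp.out.ne_zero h')
  rw [hr, Nat.cast_pow, Nat.cast_pow, QuotientPow.natCard_quotient_span_pow _ haE,
    QuotientPow.natCard_quotient_span_pow _ haK, hB, ← pow_mul, ← pow_mul, mul_comm]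

/-- **Bottom layer.** For `K` non-archimedean local of characteristic `0` with `|p| < 1`, `E/K`
finite Galois inside `K̄`, `M` finite discrete killed by `p`, and an open normal `S₀ ⊴ Γ_K` acting
trivially on `M` and on `μ_p(K̄)` with `[Gal(K̄/E) : S₀ ∩ Gal(K̄/E)]` prime to `p`:
`H¹(Gal(K̄/E), M)`, `H²(Gal(K̄/E), M)` are finite and
`#M^{Gal(K̄/E)} · #H²(Gal(K̄/E), M) · #(𝒪_K/#M)^{[E:K]} = #H¹(Gal(K̄/E), M)` — Tate's formula over
the local field `E` in its tame case (stage C5), moved to the subgroup `Gal(K̄/E) ≤ Γ_K`.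
[cite: MilneADT2006, I §2 Thm 2.8] [cite: SerreGaloisCohomology1997, II §5.7 Thm. 5] -/
theorem epc_galFixing (hpv : ValuativeRel.valuation K p < 1)
    (ρ : ContinuousRep (absoluteGaloisGroup K) ℤ M) (hpM : ∀ m : M, p • m = 0)
    (S₀ : Subgroup (absoluteGaloisGroup K)) [hS₀ : S₀.Normal] (hS₀o : IsOpen (S₀ : Set (absoluteGaloisGroup K)))
    (hidx : ¬ p ∣ S₀.relIndex (galFixing K E))
    (hS₀M : ∀ g ∈ S₀, ∀ m : M, ρ g m = m) (hS₀μ : ∀ g ∈ S₀, ∀ ζ : MuCarrier K p, mu K p g ζ = ζ) :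
    Finite (continuousCohomology 1 (ρ.restrict (subgroupIncl (galFixing K E))).toTopRep) ∧
    Finite (continuousCohomology 2 (ρ.restrict (subgroupIncl (galFixing K E))).toTopRep) ∧
    Nat.card (ρ.restrict (subgroupIncl (galFixing K E))).toTopRep.ρ.invariants *
        Nat.card (continuousCohomology 2 (ρ.restrict (subgroupIncl (galFixing K E))).toTopRep) *
        Nat.card (𝒪[K] ⧸ Ideal.span {((Nat.card M : ℕ) : 𝒪[K])}) ^ Module.finrank K E =
      Nat.card (continuousCohomology 1 (ρ.restrict (subgroupIncl (galFixing K E))).toTopRep) := by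
  classical
  haveI : NeZero p := ⟨hp.out.ne_zero⟩
  haveI : CharZero E := charZero_of_injective_algebraMap (algebraMap K E).injective
  -- `#M = p^r` and the integer factor
  obtain ⟨r, hr⟩ := exists_card_eq_prime_pow M (fun m => ⟨1, by rw [pow_one]; exact hpM m⟩ :
    IsPrimaryTorsion p M)
  rw [← natCard_integer_quotient_card K p E hpv hr]
  -- the local field `E`
  letI := FiniteExtension.valuativeRel K E
  letI := FiniteExtension.topologicalSpace K E
  haveI := FiniteExtension.isNonarchimedeanLocalField K E
  have hpvE : ValuativeRel.valuation E p < 1 := (EPCLocalField.valuation_natCast_lt_one_iff K E p).2 hpv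
  -- `ι : Γ_E ≃ₜ* Gal(K̄/E)` and the pulled-back module
  obtain ⟨ι, hιμ⟩ := EPCBaseChange.exists_continuousMulEquiv_galFixing K E
  let ρ₁ : ContinuousRep (absoluteGaloisGroup E) ℤ M :=
    (ρ.restrict (subgroupIncl (galFixing K E))).restrict (ι : absoluteGaloisGroup E →ₜ* galFixing K E)
  have hc : ∀ g m, ρ₁ g m = (ρ.restrict (subgroupIncl (galFixing K E))) (ι g) m := fun _ _ => rfl
  -- the open normal subgroup `U₁ = ι⁻¹(S₀ ∩ Gal(K̄/E))` and its fixed field `E₁`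
  set U₁ : Subgroup (absoluteGaloisGroup E) :=
    (S₀.subgroupOf (galFixing K E)).comap (ι : absoluteGaloisGroup E →* galFixing K E) with hU₁
  have hmemU₁ : ∀ g, g ∈ U₁ ↔ ((ι g : galFixing K E) : absoluteGaloisGroup K) ∈ S₀ := fun g => by
    rw [hU₁, Subgroup.mem_comap, Subgroup.mem_subgroupOf]; rfl
  haveI hU₁n : U₁.Normal := Subgroup.Normal.comap (hS₀.subgroupOf _) _
  have hU₁o : IsOpen (U₁ : Set (absoluteGaloisGroup E)) :=
    ((hS₀o.preimage continuous_subtype_val).preimage ι.continuous)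
  have hU₁idx : U₁.index = S₀.relIndex (galFixing K E) :=
    Subgroup.index_comap_of_surjective _ ι.surjective
  obtain ⟨E₁, hE₁fd, hE₁⟩ := exists_galFixing_eq_of_isOpen U₁ hU₁o
  haveI := hE₁fd
  haveI : (galFixing (↥E) E₁).Normal := by rw [hE₁]; exact hU₁n
  haveI : IsGalois (↥E) E₁ := EPCBaseChange.isGalois_of_normal_galFixing (↥E) E₁
  -- hypotheses of the tame layer over `E`
  have hG : ¬ p ∣ (galFixing (↥E) E₁).index := by rwa [hE₁, hU₁idx]
  have hμ : ∀ g ∈ galFixing (↥E) E₁, ∀ ζ : MuCarrier (↥E) p, mu (↥E) p g ζ = ζ := by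
    intro g hg
    rw [hE₁, hmemU₁] at hg
    exact hιμ p g (fun ζ => hS₀μ _ hg ζ)
  have hNM : ∀ g ∈ galFixing (↥E) E₁, ∀ m : M, ρ₁ g m = m := by
    intro g hg m
    rw [hE₁, hmemU₁] at hg
    exact hS₀M _ hg m
  obtain ⟨hf1, hf2, hcount⟩ := TameLayer.localEulerPoincare (↥E) p E₁ ρ₁ hpvE hG hμ hpM hNM
  -- transport along `ι`
  rw [EPCTransport.natCard_continuousCohomology_congr ι _ _ hc 1,
    EPCTransport.natCard_continuousCohomology_congr ι _ _ hc 2,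
    EPCTransport.natCard_invariants_congr ι _ _ hc] at hcount
  exact ⟨(EPCTransport.finite_continuousCohomology_iff ι _ _ hc 1).1 hf1,
    (EPCTransport.finite_continuousCohomology_iff ι _ _ hc 2).1 hf2, hcount⟩

end EPCBottom

end Literature.NumberTheory.GaloisRepresentations.LocalEPC

end Part10

/-!
## Part 11 — port of `Summits/BirchSwinnertonDyer/Rank1Residual/GaloisImage/EPCTamePrelim.lean`

# Preliminaries for the tame chain in Tate's theorem: `μ_p`, the residue characteristic, kernels
# (cell `b2b-bsdres`, team n1011, row T-EPC = Tate's local Euler–Poincaré characteristic; seat p04 GEN 8; stage D3b-i)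

HONEST FRAMING (cell `b2b-bsdres`, run/shared/lean/b2b/bsd-rank1-residual/, verbatim in every
file): the goal of the cell is to DELETE the COMBINATION-SHAPED residual classes of the
Birch–Swinnerton-Dyer formula for ALL analytic-rank `≤ 1` elliptic curves over `ℚ` — "full BSD
formula for every rank `≤ 1` curve in class `C`" assembled STRICTLY from published theorems — so
that the rank-`≤ 1` remainder becomes exactly the CONSTRUCTION-SHAPED classes, which are TYPED
(missing-input `Prop`s), NOT attempted. This is not "finishing BSD". Team n1011 (N10 / N11, the
additive block X4 ∧ `p = 3`): research route; no claim beyond the stated classes; nothing is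
booked; no mark / label is changed by this file. Theorems only (no definition, no named fact, no
`sorry`).  (Placement: Summits/GaloisImage with the T-EPC cone.)

## What

Three small inputs of the `ℓ = p` case of Tate's local Euler–Poincaré formula (Milne *ADT* I
Thm. 2.8: "`L/K` finite Galois such that `Gal(K̄/L)` acts trivially on `M` and on `μ_p`"):

* `EPCTame.smul_pow_sub_one_eq_self` — a group acting on a cyclic group of exponent `p` acts
  through `(ℤ/p)ˣ`: `σ^{p-1}` acts trivially (Fermat); hence `EPCTame.mu_eq_self_of_pow`: **an
  element of `Γ_K` some `p`-power of which fixes `μ_p(K̄)` fixes `μ_p(K̄)`**;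
* `EPCTame.valuation_ringChar_lt_one` — `|p|_K < 1` for the residue characteristic `p`;
* `EPCTame.isOpen_ker` — the kernel of a finite discrete `Γ`-module is open.

References: J. S. Milne, *Arithmetic Duality Theorems* (2006), I §2 [MilneADT2006];
J.-P. Serre, *Local Fields* (1979), IV §2 [SerreLocalFields1979].
-/

section Part11


open _root_.Function _root_.Field
open scoped ValuativeRel
open Literature.NumberTheory.GaloisRepresentations
open Literature.NumberTheory.GaloisRepresentations.DiscreteGaloisModule

universe u

namespace Literature.NumberTheory.GaloisRepresentations.LocalEPC

namespace EPCTame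

/-! ### Automorphisms of a cyclic group of exponent `p` -/

section Cyclic

variable {G C : Type*} [Group G] [CommGroup C] [IsCyclic C] [MulDistribMulAction G C]

omit [IsCyclic C] in
/-- `σ^k` acts on a cyclic group as `g ↦ g^{m^k}` when `σ` acts as `g ↦ g^m`. [folklore] -/
private theorem pow_smul_eq_zpow {σ : G} {m : ℤ} (hm : ∀ g : C, σ • g = g ^ m) (k : ℕ) (g : C) :
    σ ^ k • g = g ^ (m ^ k) := by
  induction k generalizing g with
  | zero => rw [pow_zero, one_smul, pow_zero, zpow_one]
  | succ k ih => rw [pow_succ, mul_smul, hm, smul_zpow', ih, ← zpow_mul, ← pow_succ]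

/-- **A group acting on a cyclic group of prime exponent `p` acts through `(ℤ/p)ˣ`: `σ^{p-1}`
acts trivially** (an endomorphism of a cyclic group is `g ↦ g^m`, Mathlib `MonoidHom.map_cyclic`;
Fermat's little theorem). [folklore] -/
private theorem smul_pow_sub_one_eq_self {p : ℕ} (hp : p.Prime) (hC : ∀ c : C, c ^ p = 1) (σ : G) (c : C) :
    σ ^ (p - 1) • c = c := by
  obtain ⟨m, hm⟩ := MonoidHom.map_cyclic (MulDistribMulAction.toMonoidHom C σ)
  have hm' : ∀ g : C, σ • g = g ^ m := fun g => hm g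
  rw [pow_smul_eq_zpow hm']
  by_cases hdvd : (p : ℤ) ∣ m
  · -- `σ` acts as `g ↦ (g^p)^{m/p} = 1`: the group is trivial
    obtain ⟨q, rfl⟩ := hdvd
    have htriv : ∀ g : C, g = 1 := fun g => by
      apply MulAction.injective σ
      change σ • g = σ • (1 : C)
      rw [smul_one, hm', zpow_mul, zpow_natCast, hC, one_zpow]
    rw [htriv c, one_zpow]
  · have hcop : IsCoprime m p :=
      ((Prime.coprime_iff_not_dvd (Nat.prime_iff_prime_int.mp hp)).2 hdvd).symm
    have h1 : m ^ (p - 1) ≡ 1 [ZMOD p] := Int.ModEq.pow_card_sub_one_eq_one hp hcop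
    have hord : (orderOf c : ℤ) ∣ p := by exact_mod_cast orderOf_dvd_of_pow_eq_one (hC c)
    have h2 : m ^ (p - 1) ≡ 1 [ZMOD orderOf c] := Int.ModEq.of_dvd hord h1
    rw [← zpow_one c, ← zpow_mul, one_mul, zpow_one]
    conv_rhs => rw [← zpow_one c]
    exact zpow_eq_zpow_iff_modEq.2 h2

/-- If `σ^{p^k}` acts trivially on a cyclic group of exponent `p` then so does `σ`
(`gcd(p^k, p - 1) = 1`). [folklore] -/
private theorem smul_eq_self_of_pow {p : ℕ} (hp : p.Prime) (hC : ∀ c : C, c ^ p = 1) (σ : G) {k : ℕ}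
    (hk : ∀ c : C, σ ^ p ^ k • c = c) (c : C) : σ • c = c := by
  -- the subgroup of elements acting trivially
  let S : Subgroup G := ⨅ c : C, MulAction.stabilizer G c
  have hS : ∀ x : G, x ∈ S ↔ ∀ c : C, x • c = c := fun x => by
    simp only [S, Subgroup.mem_iInf, MulAction.mem_stabilizer_iff]
  have h1 : σ ^ p ^ k ∈ S := (hS _).2 hk
  have h2 : σ ^ (p - 1) ∈ S := (hS _).2 (smul_pow_sub_one_eq_self hp hC σ)
  have hcopr : Nat.Coprime (p ^ k) (p - 1) := by
    refine Nat.Coprime.pow_left k ((Nat.Prime.coprime_iff_not_dvd hp).2 ?_)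
    exact Nat.not_dvd_of_pos_of_lt (Nat.sub_pos_of_lt hp.one_lt) (Nat.sub_lt hp.pos one_pos)
  obtain ⟨u, v, huv⟩ := (Nat.isCoprime_iff_coprime.mpr hcopr)
  have hσ : σ = (σ ^ p ^ k) ^ u * (σ ^ (p - 1)) ^ v := by
    rw [← zpow_natCast, ← zpow_natCast σ (p - 1), ← zpow_mul, ← zpow_mul, ← zpow_add,
      mul_comm ((p ^ k : ℕ) : ℤ) u, mul_comm ((p - 1 : ℕ) : ℤ) v, huv, zpow_one]
  have hmem : σ ∈ S := by
    rw [hσ]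
    exact S.mul_mem (S.zpow_mem h1 u) (S.zpow_mem h2 v)
  exact (hS σ).1 hmem c

end Cyclic

/-! ### `μ_p(K̄)` -/

section Mu

variable (K : Type u) [Field K] (p : ℕ) [hp : Fact p.Prime]

omit hp in
/-- `mu K p σ ζ = ζ` iff `σ` fixes the underlying root of unity. [folklore] -/
private theorem mu_apply_eq_self_iff_smul (σ : absoluteGaloisGroup K) (ζ : MuCarrier K p) :
    mu K p σ ζ = ζ ↔
      σ • ((MuCarrier.toAdditive ζ).toMul : rootsOfUnity p (AlgebraicClosure K)) =
        (MuCarrier.toAdditive ζ).toMul := by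
  rw [← MuCarrier.toAdditive.injective.eq_iff, mu_apply_apply]
  exact Additive.ofMul.injective.eq_iff

/-- **An element of `Γ_K` a `p`-power of which fixes `μ_p(K̄)` fixes `μ_p(K̄)`** (`Aut μ_p` has
order `p - 1`). [cite: MilneADT2006, I §2 proof of Thm 2.8] -/
theorem mu_eq_self_of_pow (σ : absoluteGaloisGroup K) {k : ℕ}
    (h : ∀ ζ : MuCarrier K p, mu K p (σ ^ p ^ k) ζ = ζ) (ζ : MuCarrier K p) : mu K p σ ζ = ζ := by
  rw [mu_apply_eq_self_iff_smul]
  have hC : ∀ c : rootsOfUnity p (AlgebraicClosure K), c ^ p = 1 := fun c =>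
    Subtype.ext (by rw [SubmonoidClass.coe_pow, OneMemClass.coe_one]; exact (mem_rootsOfUnity _ _).1 c.2)
  refine smul_eq_self_of_pow hp.out hC σ (k := k) (fun c => ?_) _
  have := (mu_apply_eq_self_iff_smul K p (σ ^ p ^ k) (MuCarrier.ofRootsOfUnity c)).1 (h _)
  exact this

end Mu

/-! ### The residue characteristic and kernels -/

section LocalField

variable (K : Type u) [Field K] [ValuativeRel K] [TopologicalSpace K] [IsNonarchimedeanLocalField K]

/-- **`|p|_K < 1` for the residue characteristic `p = char 𝓀[K]`** (`p ↦ 0` in `𝓀[K]`, so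
`p ∈ 𝓂[K]`). [cite: SerreLocalFields1979, Ch. I §1] -/
theorem valuation_ringChar_lt_one :
    ValuativeRel.valuation K ((ringChar 𝓀[K] : ℕ) : K) < 1 := by
  have h0 : ((ringChar 𝓀[K] : ℕ) : 𝓀[K]) = 0 := ringChar.Nat.cast_ringChar
  have hmem : ((ringChar 𝓀[K] : ℕ) : 𝒪[K]) ∈ 𝓂[K] := by
    rw [← IsLocalRing.residue_eq_zero_iff, map_natCast]
    exact h0
  have hnu : ¬ IsUnit ((ringChar 𝓀[K] : ℕ) : 𝒪[K]) := (IsLocalRing.mem_maximalIdeal _).mp hmem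
  have := Valuation.Integer.not_isUnit_iff_valuation_lt_one.mp hnu
  rwa [SubringClass.coe_natCast] at this

end LocalField

section Kernel

variable {Γ : Type u} [Group Γ] [TopologicalSpace Γ]
variable {M : Type u} [AddCommGroup M] [TopologicalSpace M] [DiscreteTopology M] [Finite M]

/-- **The kernel of a finite discrete module is open**: `{g | ∀ m, ρ g m = m}` is a finite
intersection of open stabilisers. [folklore] -/
private theorem isOpen_setOf_forall_apply_eq (ρ : ContinuousRep Γ ℤ M) :
    IsOpen {g : Γ | ∀ m : M, ρ g m = m} := by
  have : {g : Γ | ∀ m : M, ρ g m = m} = ⋂ m : M, (fun g => ρ g m) ⁻¹' {m} := by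
    ext g; simp
  rw [this]
  exact isOpen_iInter_of_finite fun m => (isOpen_discrete _).preimage (ρ.continuous_apply_left m)

omit [DiscreteTopology M] [Finite M] in
/-- Membership in the kernel of the underlying representation. [folklore] -/
private theorem mem_ker_toRepresentation_iff (ρ : ContinuousRep Γ ℤ M) (g : Γ) :
    g ∈ ρ.toRepresentation.ker ↔ ∀ m : M, ρ g m = m := by
  rw [MonoidHom.mem_ker, LinearMap.ext_iff]
  rfl

/-- The kernel `ker ρ ≤ Γ` of a finite discrete module is an open (normal) subgroup. [folklore] -/
private theorem isOpen_ker (ρ : ContinuousRep Γ ℤ M) : IsOpen (ρ.toRepresentation.ker : Set Γ) := by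
  have : (ρ.toRepresentation.ker : Set Γ) = {g : Γ | ∀ m : M, ρ g m = m} := by
    ext g; exact mem_ker_toRepresentation_iff ρ g
  rw [this]
  exact isOpen_setOf_forall_apply_eq ρ

end Kernel

end EPCTame

end Literature.NumberTheory.GaloisRepresentations.LocalEPC

end Part11

/-!
## Part 12 — port of `Summits/BirchSwinnertonDyer/Rank1Residual/GaloisImage/EPCTameChain.lean`

# The tame chain of index-`p` subgroups of `Γ_K` for Tate's theorem
# (cell `b2b-bsdres`, team n1011, row T-EPC = Tate's local Euler–Poincaré characteristic; seat p04 GEN 8; stage D3b-ii)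

HONEST FRAMING (cell `b2b-bsdres`, run/shared/lean/b2b/bsd-rank1-residual/, verbatim in every
file): the goal of the cell is to DELETE the COMBINATION-SHAPED residual classes of the
Birch–Swinnerton-Dyer formula for ALL analytic-rank `≤ 1` elliptic curves over `ℚ` — "full BSD
formula for every rank `≤ 1` curve in class `C`" assembled STRICTLY from published theorems — so
that the rank-`≤ 1` remainder becomes exactly the CONSTRUCTION-SHAPED classes, which are TYPED
(missing-input `Prop`s), NOT attempted. This is not "finishing BSD". Team n1011 (N10 / N11, the
additive block X4 ∧ `p = 3`): research route; no claim beyond the stated classes; nothing is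
booked; no mark / label is changed by this file. Theorems only (no definition, no named fact, no
`sorry`).  (Placement: Summits/GaloisImage with the T-EPC cone.)

## What

* `EPCChain.exists_chain` — group theory: if `Γ/N` is finite and generated by the class of `γ`,
  then for every prime `p` there is a chain `Γ = Δ₀ ≥ Δ₁ ≥ ⋯ ≥ Δ_a ≥ N` of normal subgroups,
  `Δ_i` the pull-back of `⟨γ̄^{p^i}⟩`, with `[Δ_i : Δ_{i+1}] = p`, `[Γ : Δ_a] = p^a` and
  `p ∤ [Δ_a : N]`;
* `EPCChain.exists_wild_subgroup` — ramification: for an open normal `V ⊴ Γ_K` there is a normal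
  `J = I_K^{v₁} ≤ I_K` whose image in `Γ_K/V` is a `p`-group (`absUpperInertia_map_isPGroup`) such
  that **for every open normal `U ⊇ J V` the image of the inertia group `I_K` in `Γ_K/U` has order
  prime to `p`** (`absInertia_map_isCyclic`: `Γ_K → Γ_K/U` kills every `I_K^v`, `v > 0`, because
  the images of the `I_K^v` in `Γ_K/V` stabilise at `v₁`).

References: J.-P. Serre, *Local Fields* (1979), IV §2 Cor. 1, 3 of Prop. 7 [SerreLocalFields1979];
J.-P. Serre, *Galois Cohomology* (1997), II §5.7 [SerreGaloisCohomology1997].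
-/

section Part12


open _root_.Function _root_.Field
open scoped ValuativeRel
open Literature.NumberTheory.GaloisRepresentations

universe u

namespace Literature.NumberTheory.GaloisRepresentations.LocalEPC

namespace EPCChain

/-! ### The chain in a group with cyclic quotient -/

/-- **Chain of index-`p` normal subgroups above `N` when `Γ/N` is finite cyclic.** If every class
in `Γ/N` is a power of `γ̄`, `#(Γ/N) = p^a · m` with `p ∤ m`, then `Δ_i = π⁻¹⟨γ̄^{p^i}⟩`
(`0 ≤ i ≤ a`) are normal, `Δ₀ = Γ`, `[Δ_i : Δ_{i+1}] = p`, `[Γ : Δ_a] = p^a`, `[Δ_a : N] = m`.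
[folklore] -/
private theorem exists_chain {Γ : Type*} [Group Γ] (N : Subgroup Γ) [N.Normal] [Finite (Γ ⧸ N)] (γ : Γ)
    (hγ : ∀ q : Γ ⧸ N, ∃ i : ℕ, q = (QuotientGroup.mk γ : Γ ⧸ N) ^ i) {p : ℕ} (hp : p.Prime) :
    ∃ (a : ℕ) (Δ : ℕ → Subgroup Γ), Δ 0 = ⊤ ∧ (∀ i, N ≤ Δ i) ∧ (∀ i, (Δ i).Normal) ∧
      (∀ i, Δ (i + 1) ≤ Δ i) ∧ (∀ i < a, (Δ (i + 1)).relIndex (Δ i) = p) ∧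
      (Δ a).index = p ^ a ∧ ¬ p ∣ N.relIndex (Δ a) := by
  classical
  set g : Γ ⧸ N := QuotientGroup.mk γ with hgdef
  set f : Γ →* Γ ⧸ N := QuotientGroup.mk' N with hfdef
  have hf : Surjective f := QuotientGroup.mk'_surjective N
  have hmem : ∀ q : Γ ⧸ N, q ∈ Subgroup.zpowers g := fun q => by
    obtain ⟨i, rfl⟩ := hγ q
    exact Subgroup.npow_mem_zpowers g i
  have hord : orderOf g = Nat.card (Γ ⧸ N) := orderOf_eq_card_of_forall_mem_zpowers hmem
  have hn0 : Nat.card (Γ ⧸ N) ≠ 0 := Nat.card_pos.ne'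
  obtain ⟨a, m, hpm, hnm⟩ := Nat.exists_eq_pow_mul_and_not_dvd hn0 p hp.one_lt.ne'
  -- all elements of `Γ/N` commute
  have hcomm : ∀ x y : Γ ⧸ N, x * y = y * x := fun x y => by
    obtain ⟨i, rfl⟩ := hγ x
    obtain ⟨j, rfl⟩ := hγ y
    rw [← pow_add, ← pow_add, add_comm]
  -- the chain downstairs
  set D : ℕ → Subgroup (Γ ⧸ N) := fun i => Subgroup.zpowers (g ^ p ^ i) with hDdef
  have hDnormal : ∀ i, (D i).Normal := fun i =>
    ⟨fun x hx y => by rwa [hcomm y x, mul_inv_cancel_right]⟩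
  have hDcard : ∀ i ≤ a, Nat.card (D i) = p ^ (a - i) * m := fun i hi => by
    have hdvd : p ^ i ∣ orderOf g := by
      rw [hord, hnm]; exact (pow_dvd_pow p hi).mul_right m
    rw [hDdef, Nat.card_zpowers, orderOf_pow_of_dvd (pow_ne_zero i hp.ne_zero) hdvd, hord, hnm,
      ← pow_mul_pow_sub p hi, mul_assoc, Nat.mul_div_cancel_left _ (pow_pos hp.pos i)]
  have hDindex : ∀ i ≤ a, (D i).index = p ^ i := fun i hi => by
    have h := (D i).index_mul_card
    rw [hDcard i hi, hnm, ← pow_mul_pow_sub p hi, mul_assoc] at h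
    exact Nat.eq_of_mul_eq_mul_right (Nat.mul_pos (pow_pos hp.pos _) (Nat.pos_of_ne_zero fun hm => by
      rw [hm, mul_zero] at hnm; exact hn0 hnm)) h
  have hDle : ∀ i, D (i + 1) ≤ D i := fun i => by
    rw [hDdef, Subgroup.zpowers_le, pow_succ, pow_mul]
    exact Subgroup.npow_mem_zpowers _ p
  -- pull back
  refine ⟨a, fun i => (D i).comap f, ?_, fun i x hx => ?_, fun i => Subgroup.Normal.comap (hDnormal i) f,
    fun i => Subgroup.comap_mono (hDle i), fun i hi => ?_, ?_, ?_⟩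
  · -- `Δ 0 = ⊤`
    have : D 0 = ⊤ := by
      rw [eq_top_iff]
      intro q _
      rw [hDdef]
      simpa only [pow_zero, pow_one] using hmem q
    change (D 0).comap f = ⊤
    rw [this, Subgroup.comap_top]
  · -- `N ≤ Δ i`
    rw [Subgroup.mem_comap]
    have : f x = 1 := by rw [hfdef, QuotientGroup.mk'_apply, QuotientGroup.eq_one_iff]; exact hx
    rw [this]
    exact one_mem _
  · -- `[Δ i : Δ (i+1)] = p`
    rw [Subgroup.relIndex_comap, Subgroup.map_comap_eq_self_of_surjective hf]
    have h := Subgroup.relIndex_mul_index (hDle i)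
    rw [hDindex i hi.le, hDindex (i + 1) hi, pow_succ] at h
    exact Nat.eq_of_mul_eq_mul_left (pow_pos hp.pos i) (by rw [mul_comm]; exact h)
  · -- `[Γ : Δ a] = p^a`
    rw [Subgroup.index_comap_of_surjective _ hf, hDindex a le_rfl]
  · -- `[Δ a : N] = m`
    have hNle : N ≤ (D a).comap f := fun x hx => by
      rw [Subgroup.mem_comap]
      have : f x = 1 := by rw [hfdef, QuotientGroup.mk'_apply, QuotientGroup.eq_one_iff]; exact hx
      rw [this]
      exact one_mem _
    have h := Subgroup.relIndex_mul_index hNle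
    rw [Subgroup.index_comap_of_surjective _ hf, hDindex a le_rfl, Subgroup.index_eq_card, hnm,
      mul_comm (p ^ a) m] at h
    have hrel : N.relIndex ((D a).comap f) = m := Nat.eq_of_mul_eq_mul_right (pow_pos hp.pos a) h
    change ¬ p ∣ N.relIndex ((D a).comap f)
    rw [hrel]
    exact hpm

/-! ### The wild subgroup `J = I_K^{v₁}` -/

variable (K : Type u) [Field K] [ValuativeRel K] [TopologicalSpace K] [IsNonarchimedeanLocalField K]

/-- **The wild subgroup attached to an open normal `V ⊴ Γ_K`.** There is a normal subgroup
`J = I_K^{v₁} ≤ I_K` of `Γ_K` whose image in `Γ_K/V` is a `p`-group (`p` the residue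
characteristic) and such that for every open normal `U ⊴ Γ_K` containing `J` and `V` the image of
the inertia group `I_K` in `Γ_K/U` has order prime to `p` (the images of the ramification groups
`I_K^v`, `v > 0`, in the finite group `Γ_K/V` stabilise at some `v₁ > 0`, so `Γ_K → Γ_K/U` is tame).
[cite: SerreLocalFields1979, IV §2 Cor. 1 and Cor. 3 of Prop. 7] -/
theorem exists_wild_subgroup (V : Subgroup (absoluteGaloisGroup K)) [hVn : V.Normal]
    (hVo : IsOpen (V : Set (absoluteGaloisGroup K))) :
    ∃ J : Subgroup (absoluteGaloisGroup K), J.Normal ∧ J ≤ absInertia K ∧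
      IsPGroup (ringChar 𝓀[K]) (J.map (QuotientGroup.mk' V)) ∧
      ∀ (U : Subgroup (absoluteGaloisGroup K)) [U.Normal], IsOpen (U : Set (absoluteGaloisGroup K)) →
        J ≤ U → V ≤ U →
        (Nat.card ((absInertia K).map (QuotientGroup.mk' U))).Coprime (ringChar 𝓀[K]) := by
  classical
  haveI : CompactSpace (absoluteGaloisGroup K) := absoluteGaloisGroup_compactSpace K
  haveI : Finite (absoluteGaloisGroup K ⧸ V) := Subgroup.quotient_finite_of_isOpen V hVo
  haveI : DiscreteTopology (absoluteGaloisGroup K ⧸ V) := QuotientGroup.discreteTopology hVo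
  let π : absoluteGaloisGroup K →ₜ* (absoluteGaloisGroup K ⧸ V) :=
    ⟨QuotientGroup.mk' V, QuotientGroup.continuous_mk⟩
  -- the images of `I^v` in `Γ/V` stabilise near `0` (as in `InertiaCohomologyFinite`)
  let Pv : ℝ → Subgroup (absoluteGaloisGroup K ⧸ V) := fun v => (absUpperInertia K v).map π.toMonoidHom
  have hanti : ∀ {v v'}, v ≤ v' → Pv v' ≤ Pv v := fun h =>
    Subgroup.map_mono (absUpperInertia_antitone_holds K h)
  obtain ⟨v₁, hv₁, hstab⟩ : ∃ v₁ : ℝ, 0 < v₁ ∧ ∀ v, 0 < v → v ≤ v₁ → Pv v = Pv v₁ := by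
    let a : ℕ →o Subgroup (absoluteGaloisGroup K ⧸ V) := ⟨fun n => Pv (1 / (n + 1)), fun m n hmn => hanti (by
      apply one_div_le_one_div_of_le (by positivity); exact_mod_cast Nat.succ_le_succ hmn)⟩
    obtain ⟨n₀, hn₀⟩ := WellFoundedGT.monotone_chain_condition a
    refine ⟨1 / (n₀ + 1), by positivity, fun v hv hle => le_antisymm ?_ (hanti hle)⟩
    obtain ⟨n, hn⟩ := exists_nat_one_div_lt hv
    have h1 : (1 : ℝ) / ((max n n₀ : ℕ) + 1) ≤ v := by
      refine le_trans ?_ hn.le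
      apply one_div_le_one_div_of_le (by positivity)
      exact_mod_cast Nat.succ_le_succ (le_max_left n n₀)
    calc Pv v ≤ Pv (1 / ((max n n₀ : ℕ) + 1)) := hanti h1
      _ = a (max n n₀) := rfl
      _ = a n₀ := (hn₀ _ (le_max_right _ _)).symm
      _ = Pv (1 / (n₀ + 1)) := rfl
  set J : Subgroup (absoluteGaloisGroup K) := absUpperInertia K v₁ with hJdef
  haveI : J.Normal := absUpperInertia_normal K v₁
  have hJI : J ≤ absInertia K := absUpperInertia_le_absInertia_holds K v₁
  refine ⟨J, inferInstance, hJI, absUpperInertia_map_isPGroup_holds K (absoluteGaloisGroup K ⧸ V) π hv₁,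
    fun U _ hUo hJU hVU => ?_⟩
  haveI : DiscreteTopology (absoluteGaloisGroup K ⧸ U) := QuotientGroup.discreteTopology hUo
  let f : absoluteGaloisGroup K →ₜ* (absoluteGaloisGroup K ⧸ U) := ⟨QuotientGroup.mk' U, QuotientGroup.continuous_mk⟩
  have hkill : ∀ v : ℝ, 0 < v → ∀ σ ∈ absUpperInertia K v, f σ = 1 := by
    intro v hv σ hσ
    change QuotientGroup.mk' U σ = 1
    rw [QuotientGroup.mk'_apply, QuotientGroup.eq_one_iff]
    rcases le_total v v₁ with hle | hle
    · have hmemP : π.toMonoidHom σ ∈ Pv v₁ := hstab v hv hle ▸ Subgroup.mem_map_of_mem _ hσ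
      obtain ⟨y, hy, hyσ⟩ := Subgroup.mem_map.1 hmemP
      have hyσ' : y⁻¹ * σ ∈ V := by
        change QuotientGroup.mk' V y = QuotientGroup.mk' V σ at hyσ
        rwa [QuotientGroup.mk'_apply, QuotientGroup.mk'_apply, QuotientGroup.eq] at hyσ
      rw [show σ = y * (y⁻¹ * σ) by group]
      exact U.mul_mem (hJU hy) (hVU hyσ')
    · exact hJU (absUpperInertia_antitone_holds K hle hσ)
  exact (absInertia_map_isCyclic_holds K (absoluteGaloisGroup K ⧸ U) f hkill).2

end EPCChain

end Literature.NumberTheory.GaloisRepresentations.LocalEPC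

end Part12

/-!
## Part 13 — port of `Summits/BirchSwinnertonDyer/Rank1Residual/GaloisImage/EPCPrimeTorsion.lean`

# Tate's local Euler–Poincaré formula for modules killed by the residue characteristic
# (cell `b2b-bsdres`, team n1011, row T-EPC = Tate's local Euler–Poincaré characteristic; seat p04 GEN 8; stage D6)

HONEST FRAMING (cell `b2b-bsdres`, run/shared/lean/b2b/bsd-rank1-residual/, verbatim in every
file): the goal of the cell is to DELETE the COMBINATION-SHAPED residual classes of the
Birch–Swinnerton-Dyer formula for ALL analytic-rank `≤ 1` elliptic curves over `ℚ` — "full BSD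
formula for every rank `≤ 1` curve in class `C`" assembled STRICTLY from published theorems — so
that the rank-`≤ 1` remainder becomes exactly the CONSTRUCTION-SHAPED classes, which are TYPED
(missing-input `Prop`s), NOT attempted. This is not "finishing BSD". Team n1011 (N10 / N11, the
additive block X4 ∧ `p = 3`): research route; no claim beyond the stated classes; nothing is
booked; no mark / label is changed by this file. Theorems only (no definition, no named fact, no
`sorry`).  (Placement: Summits/GaloisImage with the T-EPC cone.)

## What

`EPCPrime.localEPC` — **Tate's local Euler–Poincaré characteristic formula
`#H⁰(K, M) · #H²(K, M) · #(𝒪_K / #M 𝒪_K) = #H¹(K, M)` for every finite discrete `Γ_K`-module `M`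
killed by the residue characteristic `p` of the non-archimedean local field `K` of characteristic
`0`** (Milne *ADT* I Thm. 2.8, the case `pM = 0`).  Assembly: wild dévissage (stage D3a) to
modules on which `V = ker(M) ∩ ker(μ_p)` and the wild group `J = I_K^{v₁}` act trivially
(`EPCPrime.localEPC_tame`); for those, the fixed field tower `K ⊂ ⋯ ⊂ K_a` of the `p`-part of
the cyclic quotient `Γ_K / I_K U` (stage D3b chain) descends the count from `Gal(K̄/K_a)`
(stage D5c: the tame layer of stage C5 over the local field `K_a`, `[K_a : K] = p^a`) to `Γ_K`
(stage D4 tower, tree `card_euler_cyclic_step`).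

References: J. S. Milne, *Arithmetic Duality Theorems* (2006), I §2 Thm. 2.8 [MilneADT2006];
J.-P. Serre, *Galois Cohomology* (1997), II §5.7 Thm. 5 [SerreGaloisCohomology1997].
-/

section Part13


open _root_.CategoryTheory _root_.Function _root_.Field
open scoped ValuativeRel
open Literature.NumberTheory.GaloisRepresentations
open Literature.NumberTheory.GaloisRepresentations.DiscreteGaloisModule
open Literature.NumberTheory.GaloisRepresentations.LocalWeilDatum

universe u

namespace Literature.NumberTheory.GaloisRepresentations.LocalEPC

namespace EPCPrime

variable (K : Type u) [Field K] [ValuativeRel K] [TopologicalSpace K] [IsNonarchimedeanLocalField K]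
  [CharZero K]
variable {M : Type u} [AddCommGroup M] [TopologicalSpace M] [DiscreteTopology M] [Finite M]

/-- **The tame case.** Let `p` be the residue characteristic, `V ⊴ Γ_K` open normal acting
trivially on `μ_p`, `J ⊴ Γ_K` with `J V / V` a `p`-group and such that the inertia group has image
of order prime to `p` in `Γ_K / U` for every open normal `U ⊇ J V`.  Then Tate's formula holds
for every finite discrete `M` killed by `p` on which `V` and `J` act trivially.
[cite: MilneADT2006, I §2 Thm 2.8] [cite: SerreGaloisCohomology1997, II §5.7 Thm. 5] -/
theorem localEPC_tame (V J : Subgroup (absoluteGaloisGroup K)) [hVn : V.Normal]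
    (hVμ : ∀ g ∈ V, ∀ ζ : MuCarrier K (ringChar 𝓀[K]), mu K (ringChar 𝓀[K]) g ζ = ζ)
    (hJP : IsPGroup (ringChar 𝓀[K]) (J.map (QuotientGroup.mk' V)))
    (hJtame : ∀ (U : Subgroup (absoluteGaloisGroup K)) [U.Normal], IsOpen (U : Set (absoluteGaloisGroup K)) →
        J ≤ U → V ≤ U →
        (Nat.card ((absInertia K).map (QuotientGroup.mk' U))).Coprime (ringChar 𝓀[K]))
    (ρ : ContinuousRep (absoluteGaloisGroup K) ℤ M) (hpM : ∀ m : M, ringChar 𝓀[K] • m = 0)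
    (hVM : ∀ g ∈ V, ∀ m : M, ρ g m = m) (hJM : ∀ g ∈ J, ∀ m : M, ρ g m = m) :
    Finite (continuousCohomology 1 ρ.toTopRep) ∧ Finite (continuousCohomology 2 ρ.toTopRep) ∧
      Nat.card ρ.toTopRep.ρ.invariants * Nat.card (continuousCohomology 2 ρ.toTopRep) *
          Nat.card (𝒪[K] ⧸ Ideal.span {((Nat.card M : ℕ) : 𝒪[K])}) =
        Nat.card (continuousCohomology 1 ρ.toTopRep) := by
  classical
  set p : ℕ := ringChar 𝓀[K] with hpdef
  haveI hp : Fact p.Prime := ⟨ringChar_residueField_prime (F := K)⟩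
  have hpv : ValuativeRel.valuation K p < 1 := EPCTame.valuation_ringChar_lt_one K
  haveI : CompactSpace (absoluteGaloisGroup K) := absoluteGaloisGroup_compactSpace K
  haveI : Finite (MuCarrier K p) := finite_muCarrier K p
  -- finiteness of `H¹(K, M)`, `H²(K, M)`
  have hf1 : Finite (continuousCohomology 1 ρ.toTopRep) :=
    finite_galoisCohomology_one_of_isNonarchimedeanLocalField ρ
  have hf2 : Finite (continuousCohomology 2 ρ.toTopRep) :=
    (natCard_two_eq_natCard_invariants_homRep K ρ (k := 1) (fun m => by rw [pow_one]; exact hpM m)).1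
  refine ⟨hf1, hf2, ?_⟩
  -- `U = ker(M) ∩ ker(μ_p)`, open normal, containing `V` and `J`
  set U : Subgroup (absoluteGaloisGroup K) := ρ.toRepresentation.ker ⊓ (mu K p).toRepresentation.ker
    with hUdef
  haveI hUn : U.Normal := Subgroup.normal_inf_normal _ _
  have hUo : IsOpen (U : Set (absoluteGaloisGroup K)) :=
    (EPCTame.isOpen_ker ρ).inter (EPCTame.isOpen_ker (mu K p))
  have hmemU : ∀ g, g ∈ U ↔ (∀ m : M, ρ g m = m) ∧ ∀ ζ : MuCarrier K p, mu K p g ζ = ζ := fun g => by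
    rw [hUdef, Subgroup.mem_inf, EPCTame.mem_ker_toRepresentation_iff, EPCTame.mem_ker_toRepresentation_iff]
  have hUM : ∀ g ∈ U, ∀ m : M, ρ g m = m := fun g hg => ((hmemU g).1 hg).1
  have hUμ : ∀ g ∈ U, ∀ ζ : MuCarrier K p, mu K p g ζ = ζ := fun g hg => ((hmemU g).1 hg).2
  have hVU : V ≤ U := fun g hg => (hmemU g).2 ⟨hVM g hg, hVμ g hg⟩
  have hJU : J ≤ U := by
    intro j hj
    refine (hmemU j).2 ⟨hJM j hj, ?_⟩
    -- `j^{p^k} ∈ V` acts trivially on `μ_p`, hence so does `j`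
    obtain ⟨k, hk⟩ := hJP ⟨QuotientGroup.mk' V j, Subgroup.mem_map_of_mem _ hj⟩
    have hk' : j ^ p ^ k ∈ V := by
      have := congrArg Subtype.val hk
      rw [SubmonoidClass.coe_pow, ← map_pow] at this
      exact (QuotientGroup.eq_one_iff _).1 this
    exact EPCTame.mu_eq_self_of_pow K p j (fun ζ => hVμ _ hk' ζ)
  -- `N = I_K U`, `Γ/N` cyclic generated by a Frobenius
  set N : Subgroup (absoluteGaloisGroup K) := absInertia K ⊔ U with hNdef
  haveI hNn : N.Normal := Subgroup.sup_normal _ _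
  have hUN : U ≤ N := le_sup_right
  have hNo : IsOpen (N : Set (absoluteGaloisGroup K)) := Subgroup.isOpen_mono hUN hUo
  haveI : Finite (absoluteGaloisGroup K ⧸ N) := Subgroup.quotient_finite_of_isOpen N hNo
  obtain ⟨φ, hφ⟩ := exists_isFrobPow_holds (F := K) 1
  have hγ : ∀ q : absoluteGaloisGroup K ⧸ N, ∃ i : ℕ, q = (QuotientGroup.mk φ : _ ⧸ N) ^ i :=
    exists_pow_eq_mk K hNo le_sup_left hφ
  obtain ⟨a, Δ, hΔ0, hNΔ, hΔn, hΔle, hΔidx, hΔa, hΔN⟩ := EPCChain.exists_chain N φ hγ hp.out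
  have hΔo : ∀ i, IsOpen (Δ i : Set (absoluteGaloisGroup K)) := fun i => Subgroup.isOpen_mono (hNΔ i) hNo
  -- the fixed field `E` of `Δ a`: Galois of degree `p^a`
  obtain ⟨E, hEfd, hE⟩ := exists_galFixing_eq_of_isOpen (Δ a) (hΔo a)
  haveI := hEfd
  haveI : (galFixing K E).Normal := by rw [hE]; exact hΔn a
  haveI : IsGalois K E := EPCBaseChange.isGalois_of_normal_galFixing K E
  have hdeg : Module.finrank K E = p ^ a := by
    rw [← IsGalois.card_aut_eq_finrank, ← EPCLocalField.index_galFixing K E, hE, hΔa]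
  -- `[Δ a : U]` is prime to `p`
  have hidx : ¬ p ∣ U.relIndex (galFixing K E) := by
    rw [hE, ← Subgroup.relIndex_mul_relIndex U N (Δ a) hUN (hNΔ a)]
    have h1 : ¬ p ∣ U.relIndex N := by
      have hker : U = (QuotientGroup.mk' U).ker := (QuotientGroup.ker_mk' U).symm
      have hcard : U.relIndex N = Nat.card ((absInertia K).map (QuotientGroup.mk' U)) := by
        conv_lhs => rw [hker]
        rw [Subgroup.relIndex_ker, hNdef, Subgroup.map_sup, QuotientGroup.map_mk'_self, sup_bot_eq]
      rw [hcard, ← Nat.Prime.coprime_iff_not_dvd hp.out]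
      exact (hJtame U hUo hJU hVU).symm
    intro h
    rcases (Nat.Prime.dvd_mul hp.out).1 h with h' | h'
    · exact h1 h'
    · exact hΔN h'
  -- bottom layer over `E`, moved to `Δ a`
  have hbottom := EPCBottom.epc_galFixing K p E hpv ρ hpM U hUo hidx hUM hUμ
  rw [hE, hdeg] at hbottom
  obtain ⟨-, -, hbot⟩ := hbottom
  -- the tower
  have hcd : GroupCdLE (absoluteGaloisGroup K) p 2 := groupCdLE_two_absoluteGaloisGroup K p
  haveI : Finite (continuousCohomology 1 (ρ.restrict (subgroupIncl (Δ 0))).toTopRep) := by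
    rw [hΔ0]; exact (EPCDescent.finite_restrict_top_iff ρ 1).2 hf1
  haveI : Finite (continuousCohomology 2 (ρ.restrict (subgroupIncl (Δ 0))).toTopRep) := by
    rw [hΔ0]; exact (EPCDescent.finite_restrict_top_iff ρ 2).2 hf2
  have htower := EPCDescent.epc_tower ρ hp.out hcd hpM Δ a (fun i _ => hΔle i)
    (fun i _ => (hΔn (i + 1)).subgroupOf (Δ i)) hΔidx (fun i _ => hΔo i)
    (Nat.card (𝒪[K] ⧸ Ideal.span {((Nat.card M : ℕ) : 𝒪[K])}))
  obtain ⟨-, -, himp⟩ := htower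
  have htop := himp hbot
  rw [hΔ0, EPCDescent.natCard_restrict_top ρ 1, EPCDescent.natCard_restrict_top ρ 2,
    EPCDescent.natCard_invariants_restrict_top ρ] at htop
  exact htop

/-- **Tate's local Euler–Poincaré characteristic formula for modules killed by the residue
characteristic**: for a non-archimedean local field `K` of characteristic `0` with residue
characteristic `p` and a finite discrete `Γ_K`-module `M` with `pM = 0`, `H¹(K, M)` and
`H²(K, M)` are finite and `#H⁰(K, M) · #H²(K, M) · #(𝒪_K / #M 𝒪_K) = #H¹(K, M)`.
[cite: MilneADT2006, I §2 Thm 2.8] [cite: SerreGaloisCohomology1997, II §5.7 Thm. 5] -/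
theorem localEPC (ρ : ContinuousRep (absoluteGaloisGroup K) ℤ M) (hpM : ∀ m : M, ringChar 𝓀[K] • m = 0) :
    Finite (continuousCohomology 1 ρ.toTopRep) ∧ Finite (continuousCohomology 2 ρ.toTopRep) ∧
      Nat.card ρ.toTopRep.ρ.invariants * Nat.card (continuousCohomology 2 ρ.toTopRep) *
          Nat.card (𝒪[K] ⧸ Ideal.span {((Nat.card M : ℕ) : 𝒪[K])}) =
        Nat.card (continuousCohomology 1 ρ.toTopRep) := by
  classical
  set p : ℕ := ringChar 𝓀[K] with hpdef
  haveI hp : Fact p.Prime := ⟨ringChar_residueField_prime (F := K)⟩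
  haveI : CompactSpace (absoluteGaloisGroup K) := absoluteGaloisGroup_compactSpace K
  haveI : Finite (MuCarrier K p) := finite_muCarrier K p
  -- `V = ker(M) ∩ ker(μ_p)`
  set V : Subgroup (absoluteGaloisGroup K) := ρ.toRepresentation.ker ⊓ (mu K p).toRepresentation.ker
    with hVdef
  haveI hVn : V.Normal := Subgroup.normal_inf_normal _ _
  have hVo : IsOpen (V : Set (absoluteGaloisGroup K)) :=
    (EPCTame.isOpen_ker ρ).inter (EPCTame.isOpen_ker (mu K p))
  have hmemV : ∀ g, g ∈ V ↔ (∀ m : M, ρ g m = m) ∧ ∀ ζ : MuCarrier K p, mu K p g ζ = ζ := fun g => by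
    rw [hVdef, Subgroup.mem_inf, EPCTame.mem_ker_toRepresentation_iff, EPCTame.mem_ker_toRepresentation_iff]
  have hVM : ∀ g ∈ V, ∀ m : M, ρ g m = m := fun g hg => ((hmemV g).1 hg).1
  have hVμ : ∀ g ∈ V, ∀ ζ : MuCarrier K p, mu K p g ζ = ζ := fun g hg => ((hmemV g).1 hg).2
  -- the wild subgroup and the dévissage
  obtain ⟨J, hJn, -, hJP, hJtame⟩ := EPCChain.exists_wild_subgroup K V hVo
  haveI := hJn
  exact EPCDevissage.localEPC_of_forall_trivial K V J hVo hJP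
    (fun τ hpA hVA hJA => localEPC_tame K V J hVμ hJP (fun U _ hUo hJU hVU => hJtame U hUo hJU hVU)
      τ hpA hVA hJA) ρ hpM hVM

end EPCPrime

end Literature.NumberTheory.GaloisRepresentations.LocalEPC

end Part13

/-!
## Part 14 — port of `Summits/BirchSwinnertonDyer/Rank1Residual/GaloisImage/EPCReductionToPrimeTorsion.lean`

# Reduction of Tate's local Euler–Poincaré formula to modules killed by a prime
# (cell `b2b-bsdres`, team n1011, row T-EPC = Tate's local Euler–Poincaré characteristic; seat p04 GEN 8; stage D2)

HONEST FRAMING (cell `b2b-bsdres`, run/shared/lean/b2b/bsd-rank1-residual/, verbatim in every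
file): the goal of the cell is to DELETE the COMBINATION-SHAPED residual classes of the
Birch–Swinnerton-Dyer formula for ALL analytic-rank `≤ 1` elliptic curves over `ℚ` — "full BSD
formula for every rank `≤ 1` curve in class `C`" assembled STRICTLY from published theorems — so
that the rank-`≤ 1` remainder becomes exactly the CONSTRUCTION-SHAPED classes, which are TYPED
(missing-input `Prop`s), NOT attempted. This is not "finishing BSD". Team n1011 (N10 / N11, the
additive block X4 ∧ `p = 3`): research route; no claim beyond the stated classes; nothing is
booked; no mark / label is changed by this file. Theorems only (no definition, no named fact, no
`sorry`).  (Placement: Summits/GaloisImage with the T-EPC cone.)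

## What

Milne, *ADT* I Thm. 2.8, proof: "We may assume `M` is killed by a prime" — induction on `#M`
through `0 → M[ℓ] → M → M/M[ℓ] → 0` with the multiplicativity of stage D1
(`EPCMul.localEPC_of_isSES`; `H³(F, M[ℓ]) = 0` by `cd_ℓ Γ_F ≤ 2`, tree `LocalFieldCdTwo`):

* `EPCMul.localEPC_of_subsingleton` — the formula for `M = 0`;
* `EPCMul.localEPC_of_forall_prime` — **if Tate's formula holds for every finite discrete
  `Γ_F`-module killed by a prime, it holds for every finite discrete `Γ_F`-module**.

References: J. S. Milne, *Arithmetic Duality Theorems* (2006), I §2 Thm. 2.8 [MilneADT2006];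
J.-P. Serre, *Galois Cohomology* (1997), II §5.7 [SerreGaloisCohomology1997].
-/

section Part14


open _root_.CategoryTheory _root_.Function _root_.Field
open scoped ValuativeRel
open Literature.NumberTheory.GaloisRepresentations

universe u

namespace Literature.NumberTheory.GaloisRepresentations.LocalEPC

namespace EPCMul

variable (F : Type u) [Field F] [ValuativeRel F] [TopologicalSpace F] [IsNonarchimedeanLocalField F]
  [CharZero F]

omit [TopologicalSpace F] [IsNonarchimedeanLocalField F] [CharZero F] in
/-- Tate's formula for the zero module: `1 · 1 · #(𝒪/(1)) = 1`. [folklore] -/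
private theorem localEPC_of_subsingleton {M : Type u} [AddCommGroup M] [TopologicalSpace M] [DiscreteTopology M]
    [Subsingleton M] (ρ : ContinuousRep (absoluteGaloisGroup F) ℤ M) :
    Finite (continuousCohomology 1 ρ.toTopRep) ∧ Finite (continuousCohomology 2 ρ.toTopRep) ∧
      Nat.card ρ.toTopRep.ρ.invariants * Nat.card (continuousCohomology 2 ρ.toTopRep) *
          Nat.card (𝒪[F] ⧸ Ideal.span {((Nat.card M : ℕ) : 𝒪[F])}) =
        Nat.card (continuousCohomology 1 ρ.toTopRep) := by
  haveI : Subsingleton ρ.toTopRep := ‹Subsingleton M›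
  haveI h1 := subsingleton_continuousCohomology_of_subsingleton ρ.toTopRep 0
  haveI h2 := subsingleton_continuousCohomology_of_subsingleton ρ.toTopRep 1
  haveI : Subsingleton ρ.toTopRep.ρ.invariants := inferInstance
  refine ⟨Finite.of_subsingleton, Finite.of_subsingleton, ?_⟩
  rw [Nat.card_of_subsingleton (0 : ρ.toTopRep.ρ.invariants),
    Nat.card_of_subsingleton (0 : continuousCohomology 2 ρ.toTopRep),
    Nat.card_of_subsingleton (0 : continuousCohomology 1 ρ.toTopRep), Nat.card_of_subsingleton (0 : M),
    Nat.cast_one, Ideal.span_singleton_one]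
  haveI : Subsingleton (𝒪[F] ⧸ (⊤ : Ideal 𝒪[F])) := Ideal.Quotient.subsingleton_iff.2 rfl
  rw [Nat.card_of_subsingleton (0 : 𝒪[F] ⧸ (⊤ : Ideal 𝒪[F]))]

/-- **Reduction to modules killed by a prime**: if Tate's local Euler–Poincaré formula holds for
every finite discrete `Γ_F`-module killed by a prime, it holds for every finite discrete
`Γ_F`-module (induction on `#M` through `0 → M[ℓ] → M → M/M[ℓ] → 0`, `H³(F, M[ℓ]) = 0` by
`cd Γ_F ≤ 2`, multiplicativity `localEPC_of_isSES`). [cite: MilneADT2006, I §2 Thm 2.8 (proof)] -/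
theorem localEPC_of_forall_prime
    (H : ∀ (ℓ : ℕ) [Fact ℓ.Prime] {M : Type u} [AddCommGroup M] [TopologicalSpace M] [DiscreteTopology M]
      [Finite M] (ρ : ContinuousRep (absoluteGaloisGroup F) ℤ M), (∀ m : M, ℓ • m = 0) →
      Finite (continuousCohomology 1 ρ.toTopRep) ∧ Finite (continuousCohomology 2 ρ.toTopRep) ∧
        Nat.card ρ.toTopRep.ρ.invariants * Nat.card (continuousCohomology 2 ρ.toTopRep) *
            Nat.card (𝒪[F] ⧸ Ideal.span {((Nat.card M : ℕ) : 𝒪[F])}) =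
          Nat.card (continuousCohomology 1 ρ.toTopRep))
    {M : Type u} [AddCommGroup M] [TopologicalSpace M] [DiscreteTopology M] [Finite M]
    (ρ : ContinuousRep (absoluteGaloisGroup F) ℤ M) :
    Finite (continuousCohomology 1 ρ.toTopRep) ∧ Finite (continuousCohomology 2 ρ.toTopRep) ∧
      Nat.card ρ.toTopRep.ρ.invariants * Nat.card (continuousCohomology 2 ρ.toTopRep) *
          Nat.card (𝒪[F] ⧸ Ideal.span {((Nat.card M : ℕ) : 𝒪[F])}) =
        Nat.card (continuousCohomology 1 ρ.toTopRep) := by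
  -- strong induction on `#M`
  suffices key : ∀ (k : ℕ) {M : Type u} [AddCommGroup M] [TopologicalSpace M] [DiscreteTopology M]
      [Finite M] (ρ : ContinuousRep (absoluteGaloisGroup F) ℤ M), Nat.card M = k →
      Finite (continuousCohomology 1 ρ.toTopRep) ∧ Finite (continuousCohomology 2 ρ.toTopRep) ∧
        Nat.card ρ.toTopRep.ρ.invariants * Nat.card (continuousCohomology 2 ρ.toTopRep) *
            Nat.card (𝒪[F] ⧸ Ideal.span {((Nat.card M : ℕ) : 𝒪[F])}) =
          Nat.card (continuousCohomology 1 ρ.toTopRep) from key _ ρ rfl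
  intro k
  induction k using Nat.strong_induction_on with
  | _ k ih =>
  intro M _ _ _ _ ρ hk
  classical
  by_cases hsub : Subsingleton M
  · exact localEPC_of_subsingleton F ρ
  haveI : Nontrivial M := not_subsingleton_iff_nontrivial.1 hsub
  letI := Fintype.ofFinite M
  -- a prime `ℓ` with an element of order `ℓ`
  have hM1 : Fintype.card M ≠ 1 := Fintype.one_lt_card.ne'
  obtain ⟨ℓ, hℓ, hℓd⟩ := Nat.exists_prime_and_dvd hM1
  haveI : Fact ℓ.Prime := ⟨hℓ⟩
  obtain ⟨x, hx⟩ := exists_prime_addOrderOf_dvd_card ℓ hℓd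
  -- `W = M[ℓ]`
  set W : Submodule ℤ M := LinearMap.ker (LinearMap.lsmul ℤ M ℓ) with hWdef
  have hW : ∀ g, W ≤ W.comap (ρ g) := fun g => ModPRepCount.ker_lsmul_le_comap ρ.toRepresentation ℓ g
  have hxW : x ∈ W := by
    rw [hWdef, LinearMap.mem_ker, LinearMap.lsmul_apply, natCast_zsmul, ← hx]
    exact addOrderOf_nsmul_eq_zero x
  have hx0 : x ≠ 0 := by
    intro h
    rw [h, addOrderOf_zero] at hx
    exact hℓ.one_lt.ne' hx.symm
  -- the pieces
  have hWℓ : ∀ w : W, ℓ • w = 0 := fun w => by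
    have hw : (w : M) ∈ LinearMap.ker (LinearMap.lsmul ℤ M ℓ) := by rw [← hWdef]; exact w.2
    rw [LinearMap.mem_ker, LinearMap.lsmul_apply, natCast_zsmul] at hw
    exact Subtype.ext hw
  have hA := H ℓ (ρ.subrepresentation W hW) hWℓ
  have hcardW : 1 < Nat.card W :=
    Finite.one_lt_card_iff_nontrivial.2 ⟨⟨⟨x, hxW⟩, 0, fun h => hx0 (congrArg Subtype.val h)⟩⟩
  have hC : Nat.card (M ⧸ W) < k := by
    have hmul : Nat.card M = Nat.card W * Nat.card (M ⧸ W) := Submodule.card_eq_card_quotient_mul_card W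
    rw [← hk, hmul]
    exact lt_mul_left Nat.card_pos hcardW
  have hQ := ih _ hC (ρ.quotient W hW) rfl
  haveI : Subsingleton (continuousCohomology 3 (ρ.subrepresentation W hW).toTopRep) :=
    subsingleton_continuousCohomology_of_two_lt F (ρ.subrepresentation W hW)
      (fun w => ⟨1, by rw [pow_one]; exact hWℓ w⟩) (by norm_num)
  exact localEPC_of_isSES F (isSES_subtype_mkQ ρ W hW) hA hQ

end EPCMul

end Literature.NumberTheory.GaloisRepresentations.LocalEPC

end Part14

/-!
## Part 15 — port of `Summits/BirchSwinnertonDyer/Rank1Residual/GaloisImage/LocalEulerPoincareCharacteristicHolds.lean`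

# Tate's local Euler–Poincaré characteristic formula: discharge of the named fact
# (cell `b2b-bsdres`, team n1011, row T-EPC = Tate's local Euler–Poincaré characteristic; seat p04 GEN 8; stage D7)

HONEST FRAMING (cell `b2b-bsdres`, run/shared/lean/b2b/bsd-rank1-residual/, verbatim in every
file): the goal of the cell is to DELETE the COMBINATION-SHAPED residual classes of the
Birch–Swinnerton-Dyer formula for ALL analytic-rank `≤ 1` elliptic curves over `ℚ` — "full BSD
formula for every rank `≤ 1` curve in class `C`" assembled STRICTLY from published theorems — so
that the rank-`≤ 1` remainder becomes exactly the CONSTRUCTION-SHAPED classes, which are TYPED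
(missing-input `Prop`s), NOT attempted. This is not "finishing BSD". Team n1011 (N10 / N11, the
additive block X4 ∧ `p = 3`): research route; no claim beyond the stated classes; nothing is
booked; no mark / label is changed by this file. Theorems only (no definition, no named fact, no
`sorry`).  (Placement: Summits/GaloisImage with the T-EPC cone; the discharge theorem carries the
`_root_.Literature…` name of the fact per the n1011 lead's rulings R5-64/65/66.)

## What

**Tate's local Euler–Poincaré characteristic formula** (Milne, *ADT* I Thm. 2.8; Serre, *CG* II
§5.7 Thm. 5; Tate 1962): for a non-archimedean local field `F` of characteristic `0` and every
finite discrete `Γ_F`-module `M`, `H¹(F, M)` and `H²(F, M)` are finite and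
`#H⁰(F, M) · #H²(F, M) · #(𝒪_F / #M 𝒪_F) = #H¹(F, M)`, i.e. `χ(F, M) = (𝒪_F : #M 𝒪_F)^{-1}`.
This proves the tree's named fact `Literature.NumberTheory.GaloisRepresentations.localEulerPoincareCharacteristic F`
(`def … : Prop`, file `Literature/NumberTheory/GaloisRepresentations/LocalEulerPoincareCharacteristic.lean`)
— the statement is used verbatim, nothing is restated.  Assembly: reduction to modules killed by one
prime `ℓ` (stage D2 `EPCMul.localEPC_of_forall_prime`); `ℓ ≠ p` is the tree's
`localEulerPoincareCharacteristic_of_isPrimaryTorsion_of_ne`; `ℓ = p` the residue characteristic is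
stage D6 `EPCPrime.localEPC` (wild dévissage, tame chain, cyclic descent, and the tame layer of
stage C5 built on the equivariant Kummer theory and Milne's Lemma 2.11 of stages B–C).

References: J. S. Milne, *Arithmetic Duality Theorems* (2006), I §2 Thm. 2.8 [MilneADT2006];
J.-P. Serre, *Galois Cohomology* (1997), II §5.7 Thm. 5 [SerreGaloisCohomology1997];
J. Tate, *Duality theorems in Galois cohomology over number fields*, ICM 1962 [Tate1962ICM].
-/

section Part15


open _root_.CategoryTheory _root_.Function _root_.Field
open scoped ValuativeRel
open Literature.NumberTheory.GaloisRepresentations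

universe u

namespace Literature.NumberTheory.GaloisRepresentations.LocalEPC

/-- **Tate's local Euler–Poincaré characteristic formula** — the named fact
`localEulerPoincareCharacteristic F` holds for every non-archimedean local field `F` of
characteristic `0`: for every finite discrete `Γ_F`-module `M`, `H¹(F, M)`, `H²(F, M)` are finite
and `#H⁰(F,M) · #H²(F,M) · #(𝒪_F/#M) = #H¹(F,M)`. [cite: MilneADT2006, I §2 Thm 2.8 (p. 31)]
[cite: SerreGaloisCohomology1997, II §5.7 Thm. 5] -/
theorem localEulerPoincareCharacteristic_holds
    (F : Type u) [Field F] [ValuativeRel F] [TopologicalSpace F] [IsNonarchimedeanLocalField F]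
    [CharZero F] : localEulerPoincareCharacteristic F := by
  intro M _ _ _ _ ρ
  refine EPCMul.localEPC_of_forall_prime F (fun ℓ _ A _ _ _ _ τ hℓ => ?_) ρ
  by_cases h : ℓ = ringChar 𝓀[F]
  · subst h
    exact EPCPrime.localEPC F τ hℓ
  · exact localEulerPoincareCharacteristic_of_isPrimaryTorsion_of_ne F τ
      (fun a => ⟨1, by rw [pow_one]; exact hℓ a⟩) h

/-- Tate's formula, unfolded form (same content as the named fact, for direct use).
[cite: MilneADT2006, I §2 Thm 2.8 (p. 31)] -/
theorem localEulerPoincare (F : Type u) [Field F] [ValuativeRel F] [TopologicalSpace F]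
    [IsNonarchimedeanLocalField F] [CharZero F]
    {M : Type u} [AddCommGroup M] [TopologicalSpace M] [DiscreteTopology M] [Finite M]
    (ρ : ContinuousRep (absoluteGaloisGroup F) ℤ M) :
    Finite (continuousCohomology 1 ρ.toTopRep) ∧ Finite (continuousCohomology 2 ρ.toTopRep) ∧
      Nat.card ρ.toTopRep.ρ.invariants * Nat.card (continuousCohomology 2 ρ.toTopRep) *
          Nat.card (𝒪[F] ⧸ Ideal.span {((Nat.card M : ℕ) : 𝒪[F])}) =
        Nat.card (continuousCohomology 1 ρ.toTopRep) :=
  Literature.NumberTheory.GaloisRepresentations.LocalEPC.localEulerPoincareCharacteristic_holds F ρ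

end Literature.NumberTheory.GaloisRepresentations.LocalEPC

end Part15

/-!
## Part 16 — port of `Summits/BirchSwinnertonDyer/BirchSwinnertonDyer/Theorems/SignedBaseChangeAnticyclotomicEisensteinDivisibilityLocalEulerPoincareCorank.lean`

# Route `SignedBaseChange`, crux `AnticyclotomicEisensteinDivisibility` (stmt-BirchSwinnertonDyer-20727),
# line `bdpline`, stub `stub_namedFactsSS`: the named fact
# `Greenberg2006.prop42_localEulerPoincareCorank` (Greenberg 2006 Prop. 4.2, the LOCAL
# Euler–Poincaré `Λ`-corank formula) is a THEOREM of the tree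

Width seat `bsd-line-sbc-p1-w2` gen 8 (D-0154 KEY row 7), `--supports stmt-BirchSwinnertonDyer-20727`.
The registered stub `stub_namedFactsSS` of the line `bdpline` (skeleton v27) lists, among its
Greenberg conjuncts, `Literature.NumberTheory.IwasawaTheory.Greenberg2006.prop42_localEulerPoincareCorank`
(R. Greenberg, *On the structure of certain Galois cohomology groups* (2006), Prop. 4.2:
`Σ_{i≤2} (−1)ⁱ corank_Λ Hⁱ(K_v, 𝒟) = −corank_Λ(𝒟)·[K_v:ℚ_p]` for `v ∣ p`, `= 0` for `v ∤ p`).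
The Literature file `Greenberg2006/LocalEulerPoincareCorank.lean` proves it from Tate's local
Euler–Poincaré characteristic formula (`localEulerPoincareCharacteristic F`, Milne ADT I Thm. 2.8),
which the tree proves Summits-side (`localEulerPoincareCharacteristic_holds`, cell `b2b-bsdres`).
Composing the two DISCHARGES the named fact unconditionally:
`Literature.NumberTheory.IwasawaTheory.Greenberg2006.prop42_localEulerPoincareCorank_holds`
(root-qualified, next to the fact's name, as for `localEulerPoincareCharacteristic_holds`).  Effect on the line: the Greenberg
conjuncts of `stub_namedFactsSS` that remain NAMED FACTS are `Greenberg2016.prop411/prop422`,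
`Greenberg2006.prop41`, and `Greenberg2006.prop32` (itself reduced to NSW (8.3.20) by the LEAD g6 /
w3 g6 / w4 g6 files).  HONEST FRAMING: a discharge of one published input; closes nothing by
itself; BSD / the crux are NOT proved here.

References: [Greenberg2006] §4 A Prop. 4.2 (p. 368); [MilneADT2006] I Thm. 2.8.
-/

section Part16


namespace Literature.NumberTheory.IwasawaTheory.Greenberg2006.LocalEulerPoincareCorank

/-- **Greenberg 2006, Prop. 4.2 — the local Euler–Poincaré `Λ`-corank formula — DISCHARGED**:
the named fact `Greenberg2006.prop42_localEulerPoincareCorank` holds (Tate's local Euler–Poincaré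
characteristic `localEulerPoincareCharacteristic_holds` fed into
`Greenberg2006.prop42_of_localEulerPoincareCharacteristic`).
[cite: Greenberg2006, §4 A Prop. 4.2 (p. 368 L14–22)] [cite: MilneADT2006, Ch. I §2, Thm. 2.8] -/
theorem prop42_localEulerPoincareCorank_holds :
    Literature.NumberTheory.IwasawaTheory.Greenberg2006.prop42_localEulerPoincareCorank :=
  Literature.NumberTheory.IwasawaTheory.Greenberg2006.prop42_of_localEulerPoincareCharacteristic
    fun F _ _ _ _ _ =>
      Literature.NumberTheory.GaloisRepresentations.LocalEPC.localEulerPoincareCharacteristic_holds F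

end Literature.NumberTheory.IwasawaTheory.Greenberg2006.LocalEulerPoincareCorank

end Part16

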